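import Mathlib.Analysis.Calculus.ContDiff.FiniteDimension
import Literature.Analysis.FluidPDE.BackwardUniquenessCoreC12
import Literature.Analysis.FluidPDE.BackwardHeatRegularityProofs
import Literature.Analysis.FluidPDE.ESSUniqueContinuationHolds
import HarnessLib

/-!
# Interior estimates and unique continuation for `|∂ₜu + Δu| ≤ c₁(|u| + |∇u|)` in the class `C¹ ∩ {∂ₓu ∈ C¹}`

Analysis/FluidPDE support file (theorems only; no definitions, no named facts) in the
backward-uniqueness / unique-continuation track used by the discharge of ESS Thm. 1.4
(`Literature.Analysis.FluidPDE.ess_local_holder`). Three parts, each the verbatim transcription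
to the class `C12(U)` (`u ∈ C¹(U)`, `∂ₑu = Du(·)(0,e) ∈ C¹(U)` for all `e`) of tree files proved
for jointly `C²` functions, whose proofs never used `∂ₜ²u`: (1) the interior gradient estimate
(`BackwardHeatGradientDoubling`, `BackwardHeatInteriorGradient`); (2) the `L∞–L²` estimate
(`BackwardHeatSubsolution`, `BackwardHeatRegularityProofs`); (3) unique continuation across
spatial boundaries, ESS 2003 Thm. 4.1 = Seregin 2014 Thm. A.2.4 (`UniqueContinuationCutoff`,
`UniqueContinuationRescale`, `UniqueContinuationCarleman`, `UniqueContinuationGaussian`,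
`ESSUniqueContinuationHolds`). The class `C12` is the regularity of the vorticity of a
Navier–Stokes solution smooth in space (jointly continuous spatial derivatives) and `C¹` in
time, which is what ESS §3 has for the blow-up limit; the printed theorems are for
`W^{2,1}_2 ⊇ C12`. Each part keeps its own `open`s in an anonymous section.

### Part — Interior gradient estimate for `|∂ₜu + Δu| ≤ c₁(|u| + |∇u|)` in the class `C¹ ∩ {∂ₓu ∈ C¹}`

Analysis/FluidPDE support file (theorems only; no definitions, no named facts) in the
backward-uniqueness / unique-continuation track used by the discharge of ESS Thm. 1.4
(`Literature.Analysis.FluidPDE.ess_local_holder`). The files `BackwardHeatGradientDoubling`,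
`BackwardHeatInteriorGradient` prove the interior gradient estimate (Seregin 2014, (A.3.7);
an input of Lemmas A.1–A.3) for `C²` solutions of the backward heat inequality by doubling of
variables. The argument is a maximum principle in the space variables at a fixed time plus a
one-sided time derivative: it uses `C²` slices and a `C¹` dependence on time, i.e. exactly the
class

  `C12(U)`: `u ∈ C¹(U)` and `∂ₑu = Du(·)(0, e) ∈ C¹(U)` for every `e ∈ E`

(the vorticity of a Navier–Stokes solution smooth in space and `C¹` in time). This file records
the dictionary between the frame operators `Carleman.dt/dx/lap` and slice derivatives in that
class, and the same estimates with the same constants and proofs: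

* dictionary: `contDiffOn_two_slice_c12` (slices are `C²`), `dx_dx_eq_slice_c12`,
  `lap_eq_laplacian_slice_c12`, `dt_add_lap_inner_const_c12`, `contDiffOn_one_dx_inner_const_c12`,
  `continuousOn_derivatives_c12`, `continuousOn_lap_gradSq_c12`;
* `doubling_sub_le_c12`, `norm_fderiv_slice_le_sqrt_c12`, `gradSq_le_of_sub_le_c12`
  (`BackwardHeatGradientDoubling` in the class);
* `exists_gradSq_le_cylinder_c12`, `exists_sqrt_gradSq_le_of_backwardHeat_c12`
  (`BackwardHeatInteriorGradient` in the class).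

## References

* G. Seregin, *Lecture notes on regularity theory for the Navier–Stokes equations*, World
  Scientific 2014, App. A.3, (A.3.7); App. A.2, Remark A.2. [Seregin2014]
* O. A. Ladyženskaja, V. A. Solonnikov, N. N. Ural'ceva, *Linear and quasi-linear equations of
  parabolic type*, AMS 1968, Chap. III §§8, 11.

### Part — The `L∞–L²` estimate (Seregin 2014, (A.2.18)) in the class `C¹ ∩ {∂ₓu ∈ C¹}`

Analysis/FluidPDE support file (theorems only; no definitions, no named facts) in the
backward-uniqueness / unique-continuation track used by the discharge of ESS Thm. 1.4
(`Literature.Analysis.FluidPDE.ess_local_holder`). `BackwardHeatSubsolution` and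
`BackwardHeatRegularityProofs` prove, for `C²` functions `v` with
`|∂ₜv + Δv| ≤ c₁(|∇v| + |v|)` near `[1/2, 1] × B̄(x₀, 1)`, the estimate
`|v(1/2, x₀)|² ≤ c₉ ∫_{]1/2,1[×B(x₀,1)} |v|²` (`Carleman.norm_sq_le_integral_of_backwardHeat`).
The proofs integrate by parts once in time and twice in space against smooth test functions,
so they only use `v ∈ C¹`, `∂ₑv ∈ C¹`; this file records them in the class

  `C12(U)`: `v ∈ C¹(U)` and `∂ₑv = Dv(·)(0, e) ∈ C¹(U)` for every `e ∈ E`.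

* `integral_mul_inner_dx_dx_c12`, `integral_mul_inner_dt_add_lap_c12`,
  `integral_heatOp_mul_norm_sq_nonpos_of_global_c12`, `integral_heatOp_mul_norm_sq_nonpos_c12`
  (the weak subsolution inequality, `BackwardHeatSubsolution` in the class);
* `norm_sq_le_integral_of_backwardHeat_c12` (Seregin 2014, (A.2.18), in the class).

## References

* G. Seregin, *Lecture notes on regularity theory for the Navier–Stokes equations*, World
  Scientific 2014, App. A.2, (A.2.18); App. A.3, (A.3.15). [Seregin2014]
* O. A. Ladyženskaja, V. A. Solonnikov, N. N. Ural'ceva, *Linear and quasi-linear equations of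
  parabolic type*, AMS 1968, Chap. III.

### Part — Unique continuation across spatial boundaries (ESS 2003, Thm. 4.1) in the class `C¹ ∩ {∂ₓu ∈ C¹}`

Analysis/FluidPDE support file (theorems only; no definitions, no named facts) in the
backward-uniqueness / unique-continuation track used by the discharge of ESS Thm. 1.4
(`Literature.Analysis.FluidPDE.ess_local_holder`). The tree proves Seregin's Thm. A.2.4
(`Carleman.uniqueContinuation_uncurried`, `ESSUniqueContinuationHolds.lean`, through
`UniqueContinuationCarleman`, `UniqueContinuationGaussian`) for jointly `C²` functions. Every
step of those proofs uses only `u ∈ C¹`, `∂ₑu ∈ C¹` (`e ∈ E`) — the cut-off Leibniz rule, the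
first Carleman inequality by density (`CarlemanDensityC12`), the interior gradient estimate
(`BackwardHeatInteriorC12`) and the `L∞–L²` estimate (`BackwardHeatSupL2C12`) — so the same
theorem holds, with the same proof, in the class

  `C12(O)`: `u ∈ C¹(O)` and `∂ₑu = Du(·)(0, e) ∈ C¹(O)` for every `e ∈ E`,

which is the regularity of the vorticity of a Navier–Stokes solution smooth in space and `C¹`
in time (ESS 2003, §3: the blow-up limit at regular times; the printed Thm. 4.1 is for
`W^{2,1}_2 ⊇ C12`).

* `norm_sq_dt_add_lap_cutoff_smul_le_c12`, `dx_dx_comp_parabolicDilation_c12`,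
  `lap_comp_parabolicDilation_c12`, `contDiffOn_one_dx_comp_parabolicDilation_c12`,
  `norm_dt_add_lap_comp_parabolicDilation_le_c12` — cut-off and rescaling lemmas in the class;
* `carleman_step_c12`, `exists_carleman_decay_c12` (`UniqueContinuationCarleman` in the class);
* `exists_gaussian_decay_c12` (Seregin 2014, Lemma A.1, in the class);
* `uniqueContinuation_uncurried_c12` (Seregin 2014, Thm. A.2.4 = ESS 2003, Thm. 4.1, in the
  class).

## References

* L. Escauriaza, G. Seregin, V. Šverák, Russ. Math. Surveys 58:2 (2003) 211–250, Thm. 4.1.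
* G. Seregin, *Lecture notes on regularity theory for the Navier–Stokes equations*, World
  Scientific 2014, App. A.2, Lemma A.1, Thm. 2.4, (A.2.3)–(A.2.18). [Seregin2014]
-/

noncomputable section

namespace Literature.Analysis.FluidPDE

/-! ## Part: BackwardHeatInteriorC12 -/

section
open Set Function Filter Topology InnerProductSpace Metric
open scoped InnerProductSpace RealInnerProductSpace Laplacian

namespace Carleman

/-! ### Dictionary: frame operators versus slice derivatives, in the class -/

section C12Dict

variable {E : Type*} [NormedAddCommGroup E] [InnerProductSpace ℝ E] [FiniteDimensional ℝ E]
variable {F : Type*} [NormedAddCommGroup F] [InnerProductSpace ℝ F]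
variable {g : ℝ × E → F} {U : Set (ℝ × E)}

omit [FiniteDimensional ℝ E] in
/-- On an open set where `g ∈ C¹`, `g` is differentiable. [folklore] -/
theorem differentiableAt_of_c1 (hU : IsOpen U) (h1 : ContDiffOn ℝ 1 g U) {z : ℝ × E}
    (hz : z ∈ U) : DifferentiableAt ℝ g z :=
  (h1.differentiableOn one_ne_zero).differentiableAt (hU.mem_nhds hz)

omit [FiniteDimensional ℝ E] in
/-- On an open set where every `∂ₑg ∈ C¹`, the frame derivative `∂ₑg` is differentiable. [folklore] -/
theorem differentiableAt_dx_c12 (hU : IsOpen U) (hx : ∀ e : E, ContDiffOn ℝ 1 (dx e g) U) (e : E)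
    {z : ℝ × E} (hz : z ∈ U) : DifferentiableAt ℝ (dx e g) z :=
  ((hx e).differentiableOn one_ne_zero).differentiableAt (hU.mem_nhds hz)

omit [FiniteDimensional ℝ E] [InnerProductSpace ℝ E] in
/-- The slice set `{y | (t, y) ∈ U}` of an open set is open. [folklore] -/
theorem isOpen_sliceSet (hU : IsOpen U) (t : ℝ) : IsOpen {y : E | (t, y) ∈ U} :=
  hU.preimage (Continuous.prodMk_right t)

/-- **Slices of functions of the class are `C²`**: if `g ∈ C¹(U)` and every `∂ₑg ∈ C¹(U)`
(`U` open), then `y ↦ g(t, y)` is `C²` on `{y | (t, y) ∈ U}` (its derivative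
`y ↦ D(g(t,·))(y)`, applied to `e`, is `∂ₑg(t, ·)`, a `C¹` function; finite dimension). [folklore] -/
theorem contDiffOn_two_slice_c12 (hU : IsOpen U) (h1 : ContDiffOn ℝ 1 g U)
    (hx : ∀ e : E, ContDiffOn ℝ 1 (dx e g) U) (t : ℝ) :
    ContDiffOn ℝ 2 (fun y => g (t, y)) {y : E | (t, y) ∈ U} := by
  set S : Set E := {y : E | (t, y) ∈ U} with hS
  have hSo : IsOpen S := isOpen_sliceSet hU t
  have hsl : ContDiffOn ℝ 1 (fun y => g (t, y)) S :=
    h1.comp (contDiffOn_const.prodMk contDiffOn_id) fun y hy => hy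
  rw [show (2 : WithTop ℕ∞) = 1 + 1 from rfl, contDiffOn_succ_iff_fderiv_of_isOpen hSo]
  refine ⟨hsl.differentiableOn one_ne_zero, fun h => ?_, ?_⟩
  · exact absurd h (by decide)
  · refine contDiffOn_clm_apply.2 fun e => ?_
    have hc : ContDiffOn ℝ 1 (fun y => dx e g (t, y)) S :=
      (hx e).comp (contDiffOn_const.prodMk contDiffOn_id) fun y hy => hy
    refine hc.congr fun y hy => ?_
    have hd : DifferentiableAt ℝ g (t, y) := differentiableAt_of_c1 hU h1 hy
    rw [dx_apply, fderiv_apply_zero_eq_fderiv_slice hd]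

/-- Slices are `C²` at interior points (pointwise form). [folklore] -/
theorem contDiffAt_two_slice_c12 (hU : IsOpen U) (h1 : ContDiffOn ℝ 1 g U)
    (hx : ∀ e : E, ContDiffOn ℝ 1 (dx e g) U) {t : ℝ} {x : E} (hz : (t, x) ∈ U) :
    ContDiffAt ℝ 2 (fun y => g (t, y)) x :=
  (contDiffOn_two_slice_c12 hU h1 hx t).contDiffAt ((isOpen_sliceSet hU t).mem_nhds hz)

omit [FiniteDimensional ℝ E] in
/-- Slices of a function of the class on an open set containing `[t₁, ∞) × E` are `C²` (the
replacement of `contDiff_slice_of_subset`). [folklore] -/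
theorem contDiff_two_slice_c12_of_subset [FiniteDimensional ℝ E] {t₁ : ℝ} (hU : IsOpen U)
    (hsub : Ici t₁ ×ˢ univ ⊆ U) (h1 : ContDiffOn ℝ 1 g U)
    (hx : ∀ e : E, ContDiffOn ℝ 1 (dx e g) U) {t : ℝ} (ht : t₁ ≤ t) :
    ContDiff ℝ 2 fun y => g (t, y) := by
  have hS : {y : E | (t, y) ∈ U} = univ :=
    eq_univ_of_forall fun y => hsub ⟨mem_Ici.2 ht, mem_univ y⟩
  have h := contDiffOn_two_slice_c12 hU h1 hx t
  rwa [hS, contDiffOn_univ] at h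

omit [FiniteDimensional ℝ E] in
/-- **Second frame derivatives are slice derivatives** in the class:
`dx e (dx e' g) (t, x) = D(y ↦ D(g(t,·))(y) e')(x) e`. [folklore] -/
theorem dx_dx_eq_slice_c12 (hU : IsOpen U) (h1 : ContDiffOn ℝ 1 g U)
    (hx : ∀ e : E, ContDiffOn ℝ 1 (dx e g) U) {t : ℝ} {x : E} (hz : (t, x) ∈ U) (e e' : E) :
    dx e (dx e' g) (t, x) = fderiv ℝ (fun y => fderiv ℝ (fun y => g (t, y)) y e') x e := by
  have hd : ∀ z ∈ U, DifferentiableAt ℝ g z := fun z hz' => differentiableAt_of_c1 hU h1 hz'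
  -- the function `G z = D(g(z.1,·))(z.2) e'` agrees with `dx e' g` near `(t, x)`
  have hev : dx e' g =ᶠ[𝓝 (t, x)] fun z => fderiv ℝ (fun y => g (z.1, y)) z.2 e' := by
    filter_upwards [hU.mem_nhds hz] with z hz'
    rw [show z = (z.1, z.2) from rfl, dx_apply, fderiv_apply_zero_eq_fderiv_slice (hd _ hz')]
  have hG : DifferentiableAt ℝ (fun z : ℝ × E => fderiv ℝ (fun y => g (z.1, y)) z.2 e') (t, x) :=
    (differentiableAt_dx_c12 hU hx e' hz).congr_of_eventuallyEq hev.symm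
  rw [dx_apply, hev.fderiv_eq, fderiv_apply_zero_eq_fderiv_slice hG e]

/-- **The frame Laplacian is Mathlib's Laplacian of the slice**, in the class:
`lap g (t, x) = Δ (g(t, ·)) x`. [folklore] -/
theorem lap_eq_laplacian_slice_c12 (hU : IsOpen U) (h1 : ContDiffOn ℝ 1 g U)
    (hx : ∀ e : E, ContDiffOn ℝ 1 (dx e g) U) {t : ℝ} {x : E} (hz : (t, x) ∈ U) :
    lap g (t, x) = (Δ fun y => g (t, y)) x := by
  rw [laplacian_eq_iteratedFDeriv_stdOrthonormalBasis]
  simp only [lap]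
  refine Finset.sum_congr rfl fun i _ => ?_
  rw [dx_dx_eq_slice_c12 hU h1 hx hz, iteratedFDeriv_two_apply]
  simp only [Matrix.cons_val_zero, Matrix.cons_val_one]
  have hut : ContDiffAt ℝ 2 (fun y => g (t, y)) x := contDiffAt_two_slice_c12 hU h1 hx hz
  have hd : DifferentiableAt ℝ (fderiv ℝ fun y => g (t, y)) x :=
    (hut.fderiv_right (m := 1) le_rfl).differentiableAt one_ne_zero
  rw [fderiv_clm_apply hd (differentiableAt_const _)]
  simp

omit [FiniteDimensional ℝ E] in
/-- Continuity on `U` of `g`, `∂ₜg`, `∂ₑg`, `∂ₑ∂ₑ'g` in the class. [folklore] -/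
theorem continuousOn_derivatives_c12 (hU : IsOpen U) (h1 : ContDiffOn ℝ 1 g U)
    (hx : ∀ e : E, ContDiffOn ℝ 1 (dx e g) U) :
    ContinuousOn g U ∧ ContinuousOn (dt g) U ∧ (∀ e, ContinuousOn (dx e g) U) ∧
      ∀ e e', ContinuousOn (dx e (dx e' g)) U := by
  have hf : ContinuousOn (fderiv ℝ g) U := h1.continuousOn_fderiv_of_isOpen hU le_rfl
  refine ⟨h1.continuousOn, hf.clm_apply continuousOn_const, fun e => hf.clm_apply continuousOn_const,
    fun e e' => ?_⟩
  exact ((hx e').continuousOn_fderiv_of_isOpen hU le_rfl).clm_apply continuousOn_const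

/-- Continuity on `U` of `Δₓg` and `|∇ₓg|²` in the class. [folklore] -/
theorem continuousOn_lap_gradSq_c12 (hU : IsOpen U) (h1 : ContDiffOn ℝ 1 g U)
    (hx : ∀ e : E, ContDiffOn ℝ 1 (dx e g) U) :
    ContinuousOn (lap g) U ∧ ContinuousOn (gradSq g) U := by
  obtain ⟨-, -, hdx, hdd⟩ := continuousOn_derivatives_c12 hU h1 hx
  refine ⟨?_, ?_⟩
  · change ContinuousOn (fun z => ∑ i, dx (stdOrthonormalBasis ℝ E i)
      (dx (stdOrthonormalBasis ℝ E i) g) z) U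
    exact continuousOn_finsetSum _ fun i _ => hdd _ _
  · change ContinuousOn (fun z => ∑ i, ‖dx (stdOrthonormalBasis ℝ E i) g z‖ ^ 2) U
    exact continuousOn_finsetSum _ fun i _ => ((hdx _).norm).pow 2

end C12Dict

/-! ### Scalar testing `⟪w, v⟫` in the class -/

section C12Inner

variable {E : Type*} [NormedAddCommGroup E] [InnerProductSpace ℝ E] [FiniteDimensional ℝ E]
variable {F : Type*} [NormedAddCommGroup F] [InnerProductSpace ℝ F]
variable {w : ℝ × E → F} {U : Set (ℝ × E)}

omit [FiniteDimensional ℝ E] in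
/-- `⟪w, v⟫ ∈ C¹(U)` for `w ∈ C¹(U)`. [folklore] -/
theorem contDiffOn_one_inner_const_c12 (h1 : ContDiffOn ℝ 1 w U) (v : F) :
    ContDiffOn ℝ 1 (fun z => ⟪w z, v⟫) U :=
  h1.inner ℝ contDiffOn_const

omit [FiniteDimensional ℝ E] in
/-- `∂ₑ⟪w, v⟫ ∈ C¹(U)` in the class (`∂ₑ⟪w, v⟫ = ⟪∂ₑw, v⟫` on `U`). [folklore] -/
theorem contDiffOn_one_dx_inner_const_c12 (hU : IsOpen U) (h1 : ContDiffOn ℝ 1 w U)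
    (hx : ∀ e : E, ContDiffOn ℝ 1 (dx e w) U) (v : F) (e : E) :
    ContDiffOn ℝ 1 (dx e fun z => ⟪w z, v⟫) U := by
  have h : ContDiffOn ℝ 1 (fun z => ⟪dx e w z, v⟫) U := (hx e).inner ℝ contDiffOn_const
  refine h.congr fun z hz => ?_
  simp only [dx_apply]
  exact fderiv_inner_const_apply (differentiableAt_of_c1 hU h1 hz) v _

/-- `(∂ₜ + Δ)⟪w, v⟫ = ⟪(∂ₜ + Δ)w, v⟫` at points of an open set, in the class. [folklore] -/
theorem dt_add_lap_inner_const_c12 (hU : IsOpen U) (h1 : ContDiffOn ℝ 1 w U)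
    (hx : ∀ e : E, ContDiffOn ℝ 1 (dx e w) U) (v : F) {z : ℝ × E} (hz : z ∈ U) :
    dt (fun z => ⟪w z, v⟫) z + lap (fun z => ⟪w z, v⟫) z = ⟪dt w z + lap w z, v⟫ := by
  have hd : ∀ z' ∈ U, DifferentiableAt ℝ w z' := fun z' hz' => differentiableAt_of_c1 hU h1 hz'
  have h1' : dt (fun z => ⟪w z, v⟫) z = ⟪dt w z, v⟫ := by
    simp only [dt_apply]
    exact fderiv_inner_const_apply (hd z hz) v _
  have h2 : ∀ e : E, dx e (dx e fun z => ⟪w z, v⟫) z = ⟪dx e (dx e w) z, v⟫ := by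
    intro e
    have hev : dx e (fun z => ⟪w z, v⟫) =ᶠ[𝓝 z] fun z' => ⟪dx e w z', v⟫ := by
      filter_upwards [hU.mem_nhds hz] with z' hz'
      simp only [dx_apply]
      exact fderiv_inner_const_apply (hd z' hz') v _
    rw [dx_apply, hev.fderiv_eq]
    rw [fderiv_inner_const_apply (differentiableAt_dx_c12 hU hx e hz) v _]
    rfl
  rw [h1', lap, lap, inner_add_left, sum_inner]
  congr 1
  exact Finset.sum_congr rfl fun i _ => h2 _

end C12Inner

/-! ### Cut-off products on a larger open set -/

section C12CutoffOn

variable {E : Type*} [NormedAddCommGroup E] [InnerProductSpace ℝ E] [FiniteDimensional ℝ E]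
variable {F : Type*} [NormedAddCommGroup F] [NormedSpace ℝ F]

omit [FiniteDimensional ℝ E] in
/-- A cut-off product `ηu`, `η ∈ C²`, `u ∈ C¹(U)`, is `C¹` on any set `V` whose points in
`tsupport η` lie in the open set `U` (near the other points it vanishes). [folklore] -/
theorem contDiffOn_one_cutoff_smul_of_c12 {η : ℝ × E → ℝ} {u : ℝ × E → F} {U V : Set (ℝ × E)}
    (hU : IsOpen U) (hη : ContDiff ℝ 2 η) (hu : ContDiffOn ℝ 1 u U)
    (hsupp : ∀ z ∈ V, z ∈ tsupport η → z ∈ U) :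
    ContDiffOn ℝ 1 (fun z => η z • u z) V := by
  intro z hz
  by_cases hzs : z ∈ tsupport η
  · have hzU : z ∈ U := hsupp z hz hzs
    exact ((hη.of_le (by norm_num)).contDiffAt.smul (hu.contDiffAt (hU.mem_nhds hzU))).contDiffWithinAt
  · have h0 : (fun z => η z • u z) =ᶠ[𝓝 z] fun _ => 0 := by
      filter_upwards [notMem_tsupport_iff_eventuallyEq.1 hzs] with z' hz'
      simp [hz']
    exact ((contDiffAt_const (c := (0 : F))).congr_of_eventuallyEq h0).contDiffWithinAt

omit [FiniteDimensional ℝ E] in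
/-- The frame derivatives `∂ₑ(ηu)` of such a cut-off product are `C¹` on `V` when moreover
every `∂ₑu ∈ C¹(U)` (`∂ₑ(ηu) = η ∂ₑu + (∂ₑη) u` on `U`, `= 0` off `tsupport η`). [folklore] -/
theorem contDiffOn_one_dx_cutoff_smul_of_c12 {η : ℝ × E → ℝ} {u : ℝ × E → F} {U V : Set (ℝ × E)}
    (hU : IsOpen U) (hη : ContDiff ℝ 2 η) (hu : ContDiffOn ℝ 1 u U)
    (hux : ∀ e : E, ContDiffOn ℝ 1 (dx e u) U)
    (hsupp : ∀ z ∈ V, z ∈ tsupport η → z ∈ U) (e : E) :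
    ContDiffOn ℝ 1 (dx e fun z => η z • u z) V := by
  have hdxη : ContDiff ℝ 1 (dx e η) :=
    (hη.fderiv_right (m := 1) le_rfl).clm_apply contDiff_const
  intro z hz
  by_cases hzs : z ∈ tsupport η
  · have hzU : z ∈ U := hsupp z hz hzs
    have h : ContDiffOn ℝ 1 (fun z => η z • dx e u z + dx e η z • u z) U :=
      (((hη.of_le (by norm_num)).contDiffOn.smul (hux e))).add (hdxη.contDiffOn.smul hu)
    have h' : ContDiffOn ℝ 1 (dx e fun z => η z • u z) U := by
      refine h.congr fun z hz => ?_
      simp only [dx_apply]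
      exact fderiv_cutoff_smul_apply_of_mem hU hη hu hz _
    exact (h'.contDiffAt (hU.mem_nhds hzU)).contDiffWithinAt
  · have h0 : (dx e fun z => η z • u z) =ᶠ[𝓝 z] fun _ => 0 := by
      filter_upwards [(isClosed_tsupport η).isOpen_compl.mem_nhds hzs] with z' hz'
      have h00 : fderiv ℝ (fun z => η z • u z) z' = 0 :=
        fderiv_of_notMem_tsupport (𝕜 := ℝ) fun h => hz' (tsupport_smul_subset_left η u h)
      simp [dx_apply, h00]
    exact ((contDiffAt_const (c := (0 : F))).congr_of_eventuallyEq h0).contDiffWithinAt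

end C12CutoffOn

/-! ### The doubling argument in the class -/

section DoublingC12

variable {E : Type*} [NormedAddCommGroup E] [InnerProductSpace ℝ E] [FiniteDimensional ℝ E]

/-- **Doubling of variables** (the core estimate). Let `g : ℝ × E → ℝ` be of the class `C¹ ∩ {∂ₓg ∈ C¹}` on an open set
containing `[t₁, ∞) × E`, vanish for `t ≥ T` and for `‖x‖ ≥ R₀`, and satisfy `|g| ≤ W`,
`|∂ₜg + Δg| ≤ N` for `t ≥ t₁`, with `0 < W` and `N < 4K`. Then for `L = √(8KW)` and all
`t ≥ t₁`, `‖x - y‖ ≤ L/(2K)`: `g(t,x) - g(t,y) ≤ L‖x - y‖ - K‖x - y‖²`. [folklore] -/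
theorem doubling_sub_le_c12 {g : ℝ × E → ℝ} {U : Set (ℝ × E)} {t₁ T R₀ N W K : ℝ}
    (hU : IsOpen U) (hsub : Ici t₁ ×ˢ univ ⊆ U) (hg : ContDiffOn ℝ 1 g U)
    (hgx : ∀ e : E, ContDiffOn ℝ 1 (dx e g) U)
    (hT : ∀ t x, T ≤ t → g (t, x) = 0) (hR : ∀ t x, R₀ ≤ ‖x‖ → g (t, x) = 0)
    (hW : ∀ t x, t₁ ≤ t → |g (t, x)| ≤ W) (hWpos : 0 < W)
    (hN : ∀ t x, t₁ ≤ t → |dt g (t, x) + lap g (t, x)| ≤ N) (hK : N < 4 * K) :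
    ∀ t x y, t₁ ≤ t → ‖x - y‖ ≤ Real.sqrt (8 * K * W) / (2 * K) →
      g (t, x) - g (t, y) ≤ Real.sqrt (8 * K * W) * ‖x - y‖ - K * ‖x - y‖ ^ 2 := by
  have hN0 : 0 ≤ N := (abs_nonneg _).trans (hN t₁ 0 le_rfl)
  have hK0 : 0 < K := by linarith
  set L := Real.sqrt (8 * K * W) with hL
  have hL0 : 0 < L := Real.sqrt_pos.2 (by positivity)
  have hLsq : L ^ 2 = 8 * K * W := Real.sq_sqrt (by positivity)
  set δ := L / (2 * K) with hδ
  have hδ0 : 0 < δ := by positivity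
  have hKδ : K * δ = L / 2 := by
    rw [hδ]; field_simp
  -- the barrier `φ`
  set φ : ℝ → ℝ := fun ρ => L * ρ - K * ρ ^ 2 with hφ
  have hφ0 : φ 0 = 0 := by simp [hφ]
  have hφδ : φ δ = 2 * W := by
    have : φ δ = δ * (L - K * δ) := by simp only [hφ]; ring
    rw [this, hKδ, hδ]
    field_simp
    nlinarith [hLsq]
  have hφnn : ∀ ρ, 0 ≤ ρ → ρ ≤ δ → 0 ≤ φ ρ := by
    intro ρ h0 h1
    have : φ ρ = ρ * (L - K * ρ) := by simp only [hφ]; ring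
    rw [this]
    refine mul_nonneg h0 ?_
    have : K * ρ ≤ K * δ := mul_le_mul_of_nonneg_left h1 hK0.le
    linarith
  have hφle : ∀ ρ, φ ρ ≤ L * ρ := fun ρ => by
    simp only [hφ]
    nlinarith [sq_nonneg ρ]
  -- points where `g` vanishes
  have hgW : ∀ t x, t₁ ≤ t → g (t, x) ≤ W := fun t x ht => (le_abs_self _).trans (hW t x ht)
  have hgW' : ∀ t x, t₁ ≤ t → -W ≤ g (t, x) := fun t x ht => (neg_abs_le _).trans' (by
    simpa using neg_le_neg (hW t x ht)) |>.trans (neg_abs_le _)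
  -- suppose the claim fails
  by_contra hcon
  push Not at hcon
  obtain ⟨t', x', y', ht', hxy', hlt⟩ := hcon
  -- the function `Ψ` on `ℝ × E × E`
  set Ψ : ℝ × E × E → ℝ := fun q => g (q.1, q.2.1) - g (q.1, q.2.2) - φ ‖q.2.1 - q.2.2‖ with hΨ
  have hΨ' : 0 < Ψ (t', x', y') := by
    simp only [hΨ]
    linarith
  -- a compact set carrying the positive part of `Ψ`
  set T' := max T t' with hT'
  set R₁ := max (R₀ + δ) (max ‖x'‖ ‖y'‖) with hR₁
  set D' : Set (ℝ × E × E) :=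
    (Icc t₁ T' ×ˢ (closedBall (0 : E) R₁ ×ˢ closedBall (0 : E) R₁)) ∩
      {q | ‖q.2.1 - q.2.2‖ ≤ δ} with hD'
  have hD'c : IsCompact D' := by
    refine (isCompact_Icc.prod ((isCompact_closedBall _ _).prod (isCompact_closedBall _ _))).inter_right ?_
    exact isClosed_le (by fun_prop) continuous_const
  have hmem' : (t', x', y') ∈ D' := by
    refine ⟨⟨⟨ht', le_max_right _ _⟩, ?_, ?_⟩, hxy'⟩
    · simp only [mem_closedBall, dist_zero_right]
      exact (le_max_left _ _).trans (le_max_right _ _)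
    · simp only [mem_closedBall, dist_zero_right]
      exact (le_max_right _ _).trans (le_max_right _ _)
  -- continuity of `Ψ` on `D'`
  have hgc : ContinuousOn g (Ici t₁ ×ˢ univ) := hg.continuousOn.mono hsub
  have hΨc : ContinuousOn Ψ D' := by
    have h1 : ContinuousOn (fun q : ℝ × E × E => g (q.1, q.2.1)) D' := by
      refine hgc.comp (by fun_prop) ?_
      intro q hq
      exact ⟨mem_Ici.2 hq.1.1.1, mem_univ _⟩
    have h2 : ContinuousOn (fun q : ℝ × E × E => g (q.1, q.2.2)) D' := by
      refine hgc.comp (by fun_prop) ?_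
      intro q hq
      exact ⟨mem_Ici.2 hq.1.1.1, mem_univ _⟩
    have h3 : Continuous fun q : ℝ × E × E => φ ‖q.2.1 - q.2.2‖ := by
      simp only [hφ]
      fun_prop
    exact (h1.sub h2).sub h3.continuousOn
  obtain ⟨zm, hzmD, hmax⟩ := hD'c.exists_isMaxOn ⟨_, hmem'⟩ hΨc
  have hΨpos : 0 < Ψ zm := hΨ'.trans_le (hmax hmem')
  -- `Ψ ≤ Ψ zm` on all of `{t ≥ t₁, ‖x - y‖ ≤ δ}`
  have hglob : ∀ t x y, t₁ ≤ t → ‖x - y‖ ≤ δ → Ψ (t, x, y) ≤ Ψ zm := by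
    intro t x y ht hxy
    by_cases hq : (t, x, y) ∈ D'
    · exact hmax hq
    · suffices h : Ψ (t, x, y) ≤ 0 from h.trans hΨpos.le
      have hφ' : 0 ≤ φ ‖x - y‖ := hφnn _ (norm_nonneg _) hxy
      -- off `D'`: `t > T'` or `‖x‖ > R₁` or `‖y‖ > R₁`; in each case both values of `g` vanish
      have hcases : T' < t ∨ R₁ < ‖x‖ ∨ R₁ < ‖y‖ := by
        by_contra h'
        push Not at h'
        exact hq ⟨⟨⟨ht, h'.1⟩, by simpa using h'.2.1, by simpa using h'.2.2⟩, hxy⟩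
      have hzero : g (t, x) = 0 ∧ g (t, y) = 0 := by
        rcases hcases with h1 | h1 | h1
        · have hTt : T ≤ t := (le_max_left _ _).trans h1.le
          exact ⟨hT t x hTt, hT t y hTt⟩
        · have hx0 : R₀ + δ ≤ ‖x‖ := (le_max_left _ _).trans h1.le
          have hy0 : R₀ ≤ ‖y‖ := by
            have := norm_sub_norm_le x y
            linarith
          exact ⟨hR t x (by linarith), hR t y hy0⟩
        · have hy0 : R₀ + δ ≤ ‖y‖ := (le_max_left _ _).trans h1.le
          have hx0 : R₀ ≤ ‖x‖ := by
            have := norm_sub_norm_le y x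
            rw [norm_sub_rev] at this
            linarith
          exact ⟨hR t x hx0, hR t y (by linarith)⟩
      simp only [hΨ, hzero.1, hzero.2]
      linarith
  -- coordinates of the maximum point
  obtain ⟨t₀, x₀, y₀⟩ := zm
  have ht₀ : t₁ ≤ t₀ := hzmD.1.1.1
  have hxy₀ : ‖x₀ - y₀‖ ≤ δ := hzmD.2
  have hΨ₀ : Ψ (t₀, x₀, y₀) = g (t₀, x₀) - g (t₀, y₀) - φ ‖x₀ - y₀‖ := rfl
  -- `0 < ‖x₀ - y₀‖ < δ`
  set r₀ := ‖x₀ - y₀‖ with hr₀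
  have hr₀pos : 0 < r₀ := by
    rcases (norm_nonneg (x₀ - y₀)).lt_or_eq with h | h
    · exact h
    · exfalso
      have hφr : φ r₀ = 0 := by rw [hr₀, ← h, hφ0]
      have hxy : x₀ = y₀ := sub_eq_zero.1 (norm_eq_zero.1 h.symm)
      have : Ψ (t₀, x₀, y₀) = 0 := by
        rw [hΨ₀, hφr, hxy, sub_self, sub_zero]
      exact hΨpos.ne' this
  have hr₀δ : r₀ < δ := by
    rcases hxy₀.lt_or_eq with h | h
    · exact h
    · exfalso
      have : Ψ (t₀, x₀, y₀) ≤ 0 := by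
        rw [hΨ₀, h, hφδ]
        linarith [hgW t₀ x₀ ht₀, hgW' t₀ y₀ ht₀]
      exact absurd hΨpos (not_lt.2 this)
  -- the unit vector `p`
  set p : E := r₀⁻¹ • (x₀ - y₀) with hp
  have hp1 : ‖p‖ = 1 := by
    rw [hp, norm_smul, norm_inv, Real.norm_eq_abs, abs_of_pos hr₀pos, ← hr₀,
      inv_mul_cancel₀ hr₀pos.ne']
  have hxy_eq : x₀ - y₀ = r₀ • p := by
    rw [hp, smul_smul, mul_inv_cancel₀ hr₀pos.ne', one_smul]
  -- the slice `g (t₀, ·)` is `C²`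
  have hgs2 : ContDiff ℝ 2 (fun y => g (t₀, y)) := contDiff_two_slice_c12_of_subset hU hsub hg hgx ht₀
  -- (1) parallel translations
  have hpar : ∀ ξ : E, iteratedFDeriv ℝ 2 (fun y => g (t₀, y)) x₀ ![ξ, ξ] -
      iteratedFDeriv ℝ 2 (fun y => g (t₀, y)) y₀ ![ξ, ξ] ≤ 0 := by
    intro ξ
    refine iteratedFDeriv_sub_nonpos_of_isLocalMax hgs2 x₀ y₀ ξ ?_
    refine Filter.Eventually.of_forall fun σ => ?_
    have h := hglob t₀ (x₀ + σ • ξ) (y₀ + σ • ξ) ht₀ (by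
      rw [show x₀ + σ • ξ - (y₀ + σ • ξ) = x₀ - y₀ by abel]; exact hxy₀)
    have e : Ψ (t₀, x₀ + σ • ξ, y₀ + σ • ξ) =
        g (t₀, x₀ + σ • ξ) - g (t₀, y₀ + σ • ξ) - φ ‖x₀ - y₀‖ := by
      simp only [hΨ]
      rw [show x₀ + σ • ξ - (y₀ + σ • ξ) = x₀ - y₀ by abel]
    rw [e, ← hr₀, hΨ₀] at h
    simpa using h
  -- (2) opposite translations along `p`
  have hopp : iteratedFDeriv ℝ 2 (fun y => g (t₀, y)) x₀ ![p, p] -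
      iteratedFDeriv ℝ 2 (fun y => g (t₀, y)) y₀ ![p, p] + 8 * K ≤ 0 := by
    refine iteratedFDeriv_sub_add_le_of_isLocalMax hgs2 x₀ y₀ p L K r₀ ?_
    -- for `|σ|` small the perturbed pair stays in the domain
    have hε : 0 < min r₀ (δ - r₀) / 2 := by
      have : 0 < min r₀ (δ - r₀) := lt_min hr₀pos (by linarith)
      linarith
    have hev : ∀ᶠ σ : ℝ in 𝓝 0, |σ| < min r₀ (δ - r₀) / 2 := by
      have := Metric.ball_mem_nhds (0 : ℝ) hε
      filter_upwards [this] with σ hσ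
      simpa [Real.dist_eq] using hσ
    filter_upwards [hev] with σ hσ
    have hσ1 : |σ| < r₀ / 2 := hσ.trans_le (by
      have := min_le_left r₀ (δ - r₀); linarith)
    have hσ2 : |σ| < (δ - r₀) / 2 := hσ.trans_le (by
      have := min_le_right r₀ (δ - r₀); linarith)
    have habs := abs_lt.1 hσ1
    have habs' := abs_lt.1 hσ2
    have hpos : 0 < r₀ + 2 * σ := by linarith
    have hle : r₀ + 2 * σ ≤ δ := by linarith
    have hdiff : x₀ + σ • p - (y₀ + σ • (-p)) = (r₀ + 2 * σ) • p := by
      rw [show x₀ + σ • p - (y₀ + σ • (-p)) = (x₀ - y₀) + (2 * σ) • p by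
        rw [smul_neg, mul_smul, two_smul]; abel, hxy_eq, ← add_smul]
    have hnorm : ‖x₀ + σ • p - (y₀ + σ • (-p))‖ = r₀ + 2 * σ := by
      rw [hdiff, norm_smul, hp1, mul_one, Real.norm_eq_abs, abs_of_pos hpos]
    have h := hglob t₀ (x₀ + σ • p) (y₀ + σ • (-p)) ht₀ (by rw [hnorm]; exact hle)
    have eσ : g (t₀, x₀ + σ • p) - g (t₀, y₀ + σ • (-p)) -
        (L * (r₀ + 2 * σ) - K * (r₀ + 2 * σ) ^ 2) = Ψ (t₀, x₀ + σ • p, y₀ + σ • (-p)) := by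
      simp only [hΨ, hφ]
      rw [hnorm]
    have e0 : g (t₀, x₀ + (0 : ℝ) • p) - g (t₀, y₀ + (0 : ℝ) • (-p)) -
        (L * (r₀ + 2 * 0) - K * (r₀ + 2 * 0) ^ 2) = Ψ (t₀, x₀, y₀) := by
      rw [hΨ₀]
      simp [hφ]
    rw [eσ, e0]
    exact h
  -- (3) the Laplacians: `Δgs(x₀) - Δgs(y₀) ≤ -8K`
  obtain ⟨b, i₀, hb⟩ := exists_orthonormalBasis_apply_eq hp1
  have hΔ : (Δ fun y => g (t₀, y)) x₀ - (Δ fun y => g (t₀, y)) y₀ ≤ -(8 * K) := by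
    rw [laplacian_eq_iteratedFDeriv_orthonormalBasis (fun y => g (t₀, y)) b]
    simp only
    rw [← Finset.sum_sub_distrib, ← Finset.add_sum_erase _ _ (Finset.mem_univ i₀), hb]
    have hrest : ∑ i ∈ Finset.univ.erase i₀,
        (iteratedFDeriv ℝ 2 (fun y => g (t₀, y)) x₀ ![b i, b i] -
          iteratedFDeriv ℝ 2 (fun y => g (t₀, y)) y₀ ![b i, b i]) ≤ 0 :=
      Finset.sum_nonpos fun i _ => hpar (b i)
    linarith
  -- (4) the time derivatives: `∂ₜg(t₀,x₀) - ∂ₜg(t₀,y₀) ≤ 0` (one-sided at `t₀ = t₁`)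
  have hmemU : ∀ y : E, (t₀, y) ∈ U := fun y => hsub ⟨mem_Ici.2 ht₀, mem_univ y⟩
  have hdiff : ∀ y : E, DifferentiableAt ℝ g (t₀, y) := fun y =>
    (hg.differentiableOn one_ne_zero).differentiableAt (hU.mem_nhds (hmemU y))
  have htime : dt g (t₀, x₀) - dt g (t₀, y₀) ≤ 0 := by
    have hθ : HasDerivAt (fun s => g (s, x₀) - g (s, y₀)) (dt g (t₀, x₀) - dt g (t₀, y₀)) t₀ :=
      (hasDerivAt_slice_dt (hdiff x₀)).sub (hasDerivAt_slice_dt (hdiff y₀))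
    refine hasDerivAt_nonpos_of_forall_gt_le hθ ?_
    filter_upwards [self_mem_nhdsWithin] with s hs
    have hs' : t₁ ≤ s := ht₀.trans (le_of_lt hs)
    have h := hglob s x₀ y₀ hs' hxy₀
    rw [hΨ₀] at h
    simp only [hΨ] at h
    linarith
  -- (5) the operator at the two points
  have hlapx : lap g (t₀, x₀) = (Δ fun y => g (t₀, y)) x₀ := by
    exact lap_eq_laplacian_slice_c12 hU hg hgx (hmemU x₀)
  have hlapy : lap g (t₀, y₀) = (Δ fun y => g (t₀, y)) y₀ := by
    exact lap_eq_laplacian_slice_c12 hU hg hgx (hmemU y₀)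
  have hx := hN t₀ x₀ ht₀
  have hy := hN t₀ y₀ ht₀
  rw [abs_le] at hx hy
  rw [hlapx] at hx
  rw [hlapy] at hy
  linarith [hx.1, hy.2]


/-- **Lipschitz bound by doubling of variables.** Let `g : ℝ × E → ℝ` be of the class `C¹ ∩ {∂ₓg ∈ C¹}` on an open set
containing `[t₁, ∞) × E`, vanish for `t ≥ T` and for `‖x‖ ≥ R₀`, and satisfy `|g| ≤ W` and
`|∂ₜg + Δg| ≤ N` for `t ≥ t₁`. Then `‖∇ₓ g(t, x)‖ ≤ √(2NW)` for all `t ≥ t₁`, `x ∈ E`. [folklore] -/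
theorem norm_fderiv_slice_le_sqrt_c12 {g : ℝ × E → ℝ} {U : Set (ℝ × E)} {t₁ T R₀ N W : ℝ}
    (hU : IsOpen U) (hsub : Ici t₁ ×ˢ univ ⊆ U) (hg : ContDiffOn ℝ 1 g U)
    (hgx : ∀ e : E, ContDiffOn ℝ 1 (dx e g) U)
    (hT : ∀ t x, T ≤ t → g (t, x) = 0) (hR : ∀ t x, R₀ ≤ ‖x‖ → g (t, x) = 0)
    (hW : ∀ t x, t₁ ≤ t → |g (t, x)| ≤ W)
    (hN : ∀ t x, t₁ ≤ t → |dt g (t, x) + lap g (t, x)| ≤ N) :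
    ∀ t x, t₁ ≤ t → ‖fderiv ℝ (fun y => g (t, y)) x‖ ≤ Real.sqrt (2 * N * W) := by
  intro t x ht
  have hN0 : 0 ≤ N := (abs_nonneg _).trans (hN t₁ 0 le_rfl)
  have hW0 : 0 ≤ W := (abs_nonneg _).trans (hW t₁ 0 le_rfl)
  rcases hW0.lt_or_eq with hWpos | hW0'
  swap
  · -- `W = 0`: the slice vanishes identically
    have hzero : (fun y => g (t, y)) = fun _ => 0 := by
      funext y
      have := hW t y ht
      rw [← hW0'] at this
      exact abs_nonpos_iff.1 this
    rw [hzero, fderiv_fun_const]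
    simp
  -- `W > 0`: the bound `√(8KW)` for every `K > N/4`
  have hgs2 : ContDiff ℝ 2 fun y => g (t, y) := contDiff_two_slice_c12_of_subset hU hsub hg hgx ht
  have hmain : ∀ K : ℝ, N < 4 * K → ‖fderiv ℝ (fun y => g (t, y)) x‖ ≤ Real.sqrt (8 * K * W) := by
    intro K hK
    have hK0 : 0 < K := by linarith
    set L := Real.sqrt (8 * K * W) with hL
    have hL0 : 0 < L := Real.sqrt_pos.2 (by positivity)
    have hδ0 : 0 < L / (2 * K) := by positivity
    have hsub_le := doubling_sub_le_c12 hU hsub hg hgx hT hR hW hWpos hN hK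
    have hf : HasFDerivAt (fun y => g (t, y)) (fderiv ℝ (fun y => g (t, y)) x) x :=
      ((hgs2.differentiable (by norm_num)) x).hasFDerivAt
    refine hf.le_of_lip' hL0.le ?_
    filter_upwards [Metric.ball_mem_nhds x hδ0] with y hy
    rw [mem_ball, dist_eq_norm] at hy
    have h1 := hsub_le t y x ht hy.le
    have h2 := hsub_le t x y ht (by rw [norm_sub_rev]; exact hy.le)
    rw [norm_sub_rev] at h2
    have hK' : 0 ≤ K * ‖y - x‖ ^ 2 := by positivity
    rw [Real.norm_eq_abs, abs_le]
    constructor <;> linarith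
  -- let `K ↓ N/4`
  set D₀ := ‖fderiv ℝ (fun y => g (t, y)) x‖ with hD₀
  have hD0 : 0 ≤ D₀ := norm_nonneg _
  have hsq : D₀ ^ 2 ≤ 2 * N * W := by
    refine le_of_forall_gt_imp_ge_of_dense fun c hc => ?_
    have hK : N < 4 * (c / (8 * W)) := by
      rw [show 4 * (c / (8 * W)) = c / (2 * W) by ring]
      rw [lt_div_iff₀ (by positivity)]
      linarith
    have h := hmain _ hK
    rw [show 8 * (c / (8 * W)) * W = c by field_simp] at h
    have hc0 : 0 ≤ c := by nlinarith
    calc D₀ ^ 2 ≤ Real.sqrt c ^ 2 := pow_le_pow_left₀ hD0 h 2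
      _ = c := Real.sq_sqrt hc0
  calc D₀ = Real.sqrt (D₀ ^ 2) := (Real.sqrt_sq hD0).symm
    _ ≤ Real.sqrt (2 * N * W) := Real.sqrt_le_sqrt hsq


end DoublingC12

/-! ### Vector-valued functions -/

section VectorC12

variable {E : Type*} [NormedAddCommGroup E] [InnerProductSpace ℝ E] [FiniteDimensional ℝ E]
variable {F : Type*} [NormedAddCommGroup F] [InnerProductSpace ℝ F]

/-- **Gradient bound by doubling of variables, vector-valued form.** Let `w : ℝ × E → F` be of the class `C¹ ∩ {∂ₓw ∈ C¹}`
on an open set containing `[t₁, ∞) × E`, vanish for `t ≥ T` and for `‖x‖ ≥ R₀`, and satisfy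
`‖w‖ ≤ W` and `‖∂ₜw + Δw‖ ≤ N` for `t ≥ t₁`. Then `|∇ₓw(t, x)|² ≤ (dim E) · 2NW` for all
`t ≥ t₁`, `x ∈ E`. [folklore] -/
theorem gradSq_le_of_sub_le_c12 {w : ℝ × E → F} {U : Set (ℝ × E)} {t₁ T R₀ N W : ℝ}
    (hU : IsOpen U) (hsub : Ici t₁ ×ˢ univ ⊆ U) (hw : ContDiffOn ℝ 1 w U)
    (hwx : ∀ e : E, ContDiffOn ℝ 1 (dx e w) U)
    (hT : ∀ t x, T ≤ t → w (t, x) = 0) (hR : ∀ t x, R₀ ≤ ‖x‖ → w (t, x) = 0)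
    (hW : ∀ t x, t₁ ≤ t → ‖w (t, x)‖ ≤ W)
    (hN : ∀ t x, t₁ ≤ t → ‖dt w (t, x) + lap w (t, x)‖ ≤ N) :
    ∀ t x, t₁ ≤ t → gradSq w (t, x) ≤ Module.finrank ℝ E * (2 * N * W) := by
  intro t x ht
  have hN0 : 0 ≤ N := (norm_nonneg _).trans (hN t₁ 0 le_rfl)
  have hW0 : 0 ≤ W := (norm_nonneg _).trans (hW t₁ 0 le_rfl)
  -- the scalar functions `⟪w, v⟫`
  have hscalar : ∀ v : F, ‖fderiv ℝ (fun y => ⟪w (t, y), v⟫) x‖ ≤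
      Real.sqrt (2 * (N * ‖v‖) * (W * ‖v‖)) := by
    intro v
    have hg : ContDiffOn ℝ 1 (fun z => ⟪w z, v⟫) U := contDiffOn_one_inner_const_c12 hw v
    have hgx : ∀ e : E, ContDiffOn ℝ 1 (dx e fun z => ⟪w z, v⟫) U := fun e =>
      contDiffOn_one_dx_inner_const_c12 hU hw hwx v e
    refine norm_fderiv_slice_le_sqrt_c12 (g := fun z => ⟪w z, v⟫) (T := T) (R₀ := R₀) hU hsub hg hgx
      (fun t x htx => by simp [hT t x htx]) (fun t x htx => by simp [hR t x htx])
      (fun t x htx => ?_) (fun t x htx => ?_) t x ht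
    · exact (abs_real_inner_le_norm _ _).trans (mul_le_mul_of_nonneg_right (hW t x htx) (norm_nonneg _))
    · have hz : (t, x) ∈ U := hsub ⟨mem_Ici.2 htx, mem_univ x⟩
      rw [dt_add_lap_inner_const_c12 hU hw hwx v hz]
      exact (abs_real_inner_le_norm _ _).trans (mul_le_mul_of_nonneg_right (hN t x htx) (norm_nonneg _))
  -- each frame derivative is bounded by `√(2NW)`
  have hz : (t, x) ∈ U := hsub ⟨mem_Ici.2 ht, mem_univ x⟩
  have hd : DifferentiableAt ℝ w (t, x) :=
    (hw.differentiableOn one_ne_zero).differentiableAt (hU.mem_nhds hz)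
  have hds : DifferentiableAt ℝ (fun y => w (t, y)) x :=
    hd.comp x ((differentiableAt_const _).prodMk differentiableAt_id)
  have hcomp : ∀ e : E, ‖e‖ = 1 → ‖dx e w (t, x)‖ ≤ Real.sqrt (2 * N * W) := by
    intro e he
    set Y := dx e w (t, x) with hY
    have hYs : Y = fderiv ℝ (fun y => w (t, y)) x e := dx_eq_fderiv_slice hd e
    -- test against `v = Y`
    have h1 : fderiv ℝ (fun y => ⟪w (t, y), Y⟫) x e = ‖Y‖ ^ 2 := by
      rw [fderiv_inner_apply ℝ hds (differentiableAt_const Y)]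
      simp [← hYs]
    have h2 : ‖Y‖ ^ 2 ≤ ‖Y‖ * Real.sqrt (2 * N * W) := by
      calc ‖Y‖ ^ 2 = fderiv ℝ (fun y => ⟪w (t, y), Y⟫) x e := h1.symm
        _ ≤ ‖fderiv ℝ (fun y => ⟪w (t, y), Y⟫) x e‖ := Real.le_norm_self _
        _ ≤ ‖fderiv ℝ (fun y => ⟪w (t, y), Y⟫) x‖ * ‖e‖ := ContinuousLinearMap.le_opNorm _ _
        _ ≤ Real.sqrt (2 * (N * ‖Y‖) * (W * ‖Y‖)) * 1 := by
            rw [he]; exact mul_le_mul_of_nonneg_right (hscalar Y) zero_le_one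
        _ = ‖Y‖ * Real.sqrt (2 * N * W) := by
            rw [mul_one, show 2 * (N * ‖Y‖) * (W * ‖Y‖) = ‖Y‖ ^ 2 * (2 * N * W) by ring,
              Real.sqrt_mul (sq_nonneg _), Real.sqrt_sq (norm_nonneg _)]
    rcases (norm_nonneg Y).lt_or_eq with hpos | h0
    · exact le_of_mul_le_mul_left (by nlinarith [h2]) hpos
    · rw [← h0]; exact Real.sqrt_nonneg _
  -- sum over the frame
  have hcard : (Finset.univ : Finset (Fin (Module.finrank ℝ E))).card = Module.finrank ℝ E := by
    simp
  calc gradSq w (t, x) = ∑ i, ‖dx (stdOrthonormalBasis ℝ E i) w (t, x)‖ ^ 2 := rfl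
    _ ≤ ∑ _i : Fin (Module.finrank ℝ E), (2 * N * W) := by
        refine Finset.sum_le_sum fun i _ => ?_
        have h := hcomp _ ((stdOrthonormalBasis ℝ E).orthonormal.1 i)
        calc ‖dx (stdOrthonormalBasis ℝ E i) w (t, x)‖ ^ 2 ≤ Real.sqrt (2 * N * W) ^ 2 :=
              pow_le_pow_left₀ (norm_nonneg _) h 2
          _ = 2 * N * W := Real.sq_sqrt (by positivity)
    _ = Module.finrank ℝ E * (2 * N * W) := by
        rw [Finset.sum_const, hcard, nsmul_eq_mul]


end VectorC12

/-! ### Localisation and the interior gradient estimate, in the class -/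

section LocalisationC12

variable (E : Type*) [NormedAddCommGroup E] [InnerProductSpace ℝ E] [FiniteDimensional ℝ E]
variable (F : Type*) [NormedAddCommGroup F] [InnerProductSpace ℝ F]

/-- **Localised gradient bound.** There is `C₀ = C₀(E) > 0` such that: if `u : ℝ × E → F` is
of the class `C¹ ∩ {∂ₓu ∈ C¹}` on an open set containing `[t₁ - δ, t₁ + r²] × B̄(x₁, r)` (`0 < r ≤ 1`, `δ > 0`), and on the
future cylinder `Q_r = [t₁, t₁ + r²] × B̄(x₁, r)` one has `|∂ₜu + Δu| ≤ c₁(|u| + |∇u|)`,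
`|u| ≤ M` and `|∇u| ≤ G`, then `|∇u(t₁, x₁)|² ≤ C₀ M (c₁(M + G) + M/r² + G/r)`. [folklore] -/
theorem exists_gradSq_le_cylinder_c12 : ∃ C₀ : ℝ, 0 < C₀ ∧
    ∀ ⦃u : ℝ × E → F⦄ ⦃U : Set (ℝ × E)⦄ ⦃c₁ t₁ : ℝ⦄ ⦃x₁ : E⦄ ⦃r δ M G : ℝ⦄,
      IsOpen U → 0 < r → r ≤ 1 → 0 < δ → 0 ≤ c₁ → 0 ≤ M → 0 ≤ G →
      Icc (t₁ - δ) (t₁ + r ^ 2) ×ˢ closedBall x₁ r ⊆ U → ContDiffOn ℝ 1 u U →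
      (∀ e : E, ContDiffOn ℝ 1 (dx e u) U) →
      (∀ z ∈ Icc t₁ (t₁ + r ^ 2) ×ˢ closedBall x₁ r,
        ‖dt u z + lap u z‖ ≤ c₁ * (‖u z‖ + Real.sqrt (gradSq u z))) →
      (∀ z ∈ Icc t₁ (t₁ + r ^ 2) ×ˢ closedBall x₁ r, ‖u z‖ ≤ M) →
      (∀ z ∈ Icc t₁ (t₁ + r ^ 2) ×ˢ closedBall x₁ r, Real.sqrt (gradSq u z) ≤ G) →
      gradSq u (t₁, x₁) ≤ C₀ * M * (c₁ * (M + G) + M / r ^ 2 + G / r) := by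
  obtain ⟨Ct, hCt0, hχ⟩ := exists_time_cutoff
  obtain ⟨Cs, hCs0, hζ⟩ := exists_space_cutoff (E := E)
  set n : ℕ := Module.finrank ℝ E with hn
  set b := stdOrthonormalBasis ℝ E with hb
  -- a constant dominating all coefficients
  set K₁ : ℝ := 1 + Ct + n * Cs + 2 * n * Cs with hK₁
  have hK₁1 : 1 ≤ K₁ := by
    have : (0 : ℝ) ≤ n := Nat.cast_nonneg _
    rw [hK₁]; nlinarith
  refine ⟨2 * n * K₁ + 1, by positivity, ?_⟩
  intro u U c₁ t₁ x₁ r δ M G hU hr hr1 hδ hc₁ hM hG hsubU hu hux hineq hMb hGb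
  obtain ⟨χ, hχs, hχ1, hχ0, hχb, hχd⟩ := hχ t₁ r hr
  obtain ⟨ζ, hζs, hζ1, hζ0, hζb, hζd1, hζd2⟩ := hζ x₁ r hr
  have hχdiff : Differentiable ℝ χ := hχs.differentiable (by norm_num)
  have hζdiff : Differentiable ℝ ζ := hζs.differentiable (by norm_num)
  have hζ' : ∀ e, Differentiable ℝ fun y => fderiv ℝ ζ y e := fun e =>
    ((hζs.fderiv_right (m := 1) le_rfl).differentiable one_ne_zero).clm_apply
      (differentiable_const e)
  -- the cutoff `η = χ(t) ζ(x)` and `w = η u`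
  set η : ℝ × E → ℝ := fun z => χ z.1 * ζ z.2 with hη
  set w : ℝ × E → F := fun z => η z • u z with hw
  have hηs : ContDiff ℝ 2 η := (hχs.comp contDiff_fst).mul (hζs.comp contDiff_snd)
  have hη_le : ∀ z, |η z| ≤ 1 := fun z => by
    rw [hη, abs_mul]
    exact mul_le_one₀ (hχb _) (abs_nonneg _) (hζb _)
  -- frame derivatives of `η`
  have hdtη : ∀ t y, dt η (t, y) = deriv χ t * ζ y := by
    intro t y
    rw [dt_apply, hη, fderiv_mul_fst_snd_apply hχdiff hζdiff]
    simp
  have hdxη : ∀ (e : E) (z : ℝ × E), dx e η z = χ z.1 * fderiv ℝ ζ z.2 e := by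
    intro e z
    obtain ⟨t, y⟩ := z
    rw [dx_apply, hη, fderiv_mul_fst_snd_apply hχdiff hζdiff]
    simp
  have hdxdxη : ∀ (e : E) (t : ℝ) (y : E),
      dx e (dx e η) (t, y) = χ t * fderiv ℝ (fun y => fderiv ℝ ζ y e) y e := by
    intro e t y
    have hfun : dx e η = fun z => χ z.1 * (fun y => fderiv ℝ ζ y e) z.2 := funext (hdxη e)
    rw [dx_apply, hfun, fderiv_mul_fst_snd_apply hχdiff (hζ' e)]
    simp
  -- bounds on them
  have hdtη_le : ∀ z, |dt η z| ≤ Ct / r ^ 2 := by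
    rintro ⟨t, y⟩
    rw [hdtη, abs_mul]
    calc |deriv χ t| * |ζ y| ≤ Ct / r ^ 2 * 1 :=
          mul_le_mul (hχd t) (hζb y) (abs_nonneg _) (by positivity)
      _ = Ct / r ^ 2 := mul_one _
  have hdxη_le : ∀ i z, |dx (b i) η z| ≤ Cs / r := by
    intro i z
    rw [hdxη, abs_mul]
    calc |χ z.1| * |fderiv ℝ ζ z.2 (b i)| ≤ 1 * (Cs / r * ‖b i‖) :=
          mul_le_mul (hχb _) (hζd1 _ _) (abs_nonneg _) zero_le_one
      _ = Cs / r := by rw [b.orthonormal.1 i]; ring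
  have hlapη_le : ∀ z, |lap η z| ≤ n * (Cs / r ^ 2) := by
    rintro ⟨t, y⟩
    simp only [lap]
    calc |∑ i, dx (b i) (dx (b i) η) (t, y)| ≤ ∑ i, |dx (b i) (dx (b i) η) (t, y)| :=
          Finset.abs_sum_le_sum_abs _ _
      _ ≤ ∑ _i : Fin (Module.finrank ℝ E), Cs / r ^ 2 := by
          refine Finset.sum_le_sum fun i _ => ?_
          rw [hdxdxη, abs_mul]
          calc |χ t| * |fderiv ℝ (fun y => fderiv ℝ ζ y (b i)) y (b i)|
              ≤ 1 * (Cs / r ^ 2 * ‖b i‖ ^ 2) :=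
                mul_le_mul (hχb _) (hζd2 _ _) (abs_nonneg _) zero_le_one
            _ = Cs / r ^ 2 := by rw [b.orthonormal.1 i]; ring
      _ = n * (Cs / r ^ 2) := by simp [hn]
  -- support of `η`
  have hηsupp : tsupport η ⊆ Iic (t₁ + r ^ 2 / 2) ×ˢ closedBall x₁ r := by
    refine closure_minimal (fun z hz => ?_) (isClosed_Iic.prod isClosed_closedBall)
    rw [mem_support] at hz
    refine ⟨?_, ?_⟩
    · by_contra h
      refine hz ?_
      simp only [mem_Iic, not_le] at h
      simp [hη, hχ0 z.1 h.le]
    · by_contra h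
      refine hz ?_
      simp only [mem_closedBall, dist_eq_norm, not_le] at h
      simp [hη, hζ0 z.2 h.le]
  have hQU : Icc t₁ (t₁ + r ^ 2) ×ˢ closedBall x₁ r ⊆ U := fun z hz =>
    hsubU ⟨⟨by linarith [hz.1.1], hz.1.2⟩, hz.2⟩
  have hsuppQ : ∀ z ∈ tsupport η, t₁ ≤ z.1 → z ∈ Icc t₁ (t₁ + r ^ 2) ×ˢ closedBall x₁ r := by
    intro z hz ht
    have h := hηsupp hz
    exact ⟨⟨ht, (mem_Iic.1 h.1).trans (by nlinarith)⟩, h.2⟩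
  -- `w` is `C²` on `V = (t₁ - δ, ∞) × E`
  set V : Set (ℝ × E) := Ioi (t₁ - δ) ×ˢ univ with hV
  have hVo : IsOpen V := isOpen_Ioi.prod isOpen_univ
  have hVsub : Ici t₁ ×ˢ (univ : Set E) ⊆ V := fun z hz =>
    ⟨lt_of_lt_of_le (by linarith) (mem_Ici.1 hz.1), mem_univ _⟩
  have hsuppU : ∀ z ∈ V, z ∈ tsupport η → z ∈ U := fun z hz hzs => by
    have h := hηsupp hzs
    exact hsubU ⟨⟨le_of_lt hz.1, (mem_Iic.1 h.1).trans (by nlinarith)⟩, h.2⟩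
  have hwV : ContDiffOn ℝ 1 w V := contDiffOn_one_cutoff_smul_of_c12 hU hηs hu hsuppU
  have hwVx : ∀ e : E, ContDiffOn ℝ 1 (dx e w) V := fun e =>
    contDiffOn_one_dx_cutoff_smul_of_c12 hU hηs hu hux hsuppU e
  -- vanishing of `w`
  have hwT : ∀ t x, t₁ + r ^ 2 / 2 ≤ t → w (t, x) = 0 := fun t x ht => by
    simp [hw, hη, hχ0 t ht]
  have hwR : ∀ t x, ‖x₁‖ + r ≤ ‖x‖ → w (t, x) = 0 := fun t x hx => by
    have : r ≤ ‖x - x₁‖ := by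
      have := norm_sub_norm_le x x₁
      linarith
    simp [hw, hη, hζ0 x this]
  -- `‖w‖ ≤ M` for `t ≥ t₁`
  have hwM : ∀ t x, t₁ ≤ t → ‖w (t, x)‖ ≤ M := by
    intro t x ht
    by_cases hzs : (t, x) ∈ tsupport η
    · have hzQ := hsuppQ _ hzs ht
      simp only [hw, norm_smul, Real.norm_eq_abs]
      calc |η (t, x)| * ‖u (t, x)‖ ≤ 1 * M :=
            mul_le_mul (hη_le _) (hMb _ hzQ) (norm_nonneg _) zero_le_one
        _ = M := one_mul M
    · have : w (t, x) = 0 :=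
        image_eq_zero_of_notMem_tsupport fun h => hzs (tsupport_smul_subset_left η u h)
      rw [this, norm_zero]
      exact hM
  -- `‖∂ₜw + Δw‖ ≤ N` for `t ≥ t₁`
  set N : ℝ := c₁ * (M + G) + (Ct / r ^ 2 + n * (Cs / r ^ 2)) * M + 2 * (n * (Cs / r) * G)
    with hN
  have hN0 : 0 ≤ N := by positivity
  have hwN : ∀ t x, t₁ ≤ t → ‖dt w (t, x) + lap w (t, x)‖ ≤ N := by
    intro t x ht
    by_cases hzs : (t, x) ∈ tsupport η
    · have hzQ := hsuppQ _ hzs ht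
      have hzU := hQU hzQ
      rw [hw, dt_add_lap_smul_apply_c12 hU hηs hu hux hzU]
      have e1 : ‖η (t, x) • (dt u (t, x) + lap u (t, x))‖ ≤ c₁ * (M + G) := by
        rw [norm_smul, Real.norm_eq_abs]
        calc |η (t, x)| * ‖dt u (t, x) + lap u (t, x)‖
            ≤ 1 * (c₁ * (‖u (t, x)‖ + Real.sqrt (gradSq u (t, x)))) :=
              mul_le_mul (hη_le _) (hineq _ hzQ) (norm_nonneg _) zero_le_one
          _ ≤ c₁ * (M + G) := by
              rw [one_mul]
              exact mul_le_mul_of_nonneg_left (add_le_add (hMb _ hzQ) (hGb _ hzQ)) hc₁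
      have e2 : ‖(dt η (t, x) + lap η (t, x)) • u (t, x)‖ ≤ (Ct / r ^ 2 + n * (Cs / r ^ 2)) * M := by
        rw [norm_smul, Real.norm_eq_abs]
        exact mul_le_mul ((abs_add_le _ _).trans (add_le_add (hdtη_le _) (hlapη_le _))) (hMb _ hzQ)
          (norm_nonneg _) (by positivity)
      have e3 : ‖(2 : ℝ) • ∑ i, dx (b i) η (t, x) • dx (b i) u (t, x)‖ ≤ 2 * (n * (Cs / r) * G) := by
        rw [norm_smul, Real.norm_eq_abs, abs_two]
        refine mul_le_mul_of_nonneg_left ?_ zero_le_two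
        calc ‖∑ i, dx (b i) η (t, x) • dx (b i) u (t, x)‖
            ≤ ∑ i, ‖dx (b i) η (t, x) • dx (b i) u (t, x)‖ := norm_sum_le _ _
          _ ≤ ∑ _i : Fin (Module.finrank ℝ E), Cs / r * G := by
              refine Finset.sum_le_sum fun i _ => ?_
              rw [norm_smul, Real.norm_eq_abs]
              refine mul_le_mul (hdxη_le i _) ?_ (norm_nonneg _) (by positivity)
              -- a single frame derivative is bounded by `√(gradSq)`
              have hi : ‖dx (b i) u (t, x)‖ ^ 2 ≤ gradSq u (t, x) := by
                rw [gradSq]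
                exact Finset.single_le_sum (f := fun j => ‖dx (b j) u (t, x)‖ ^ 2)
                  (fun j _ => sq_nonneg _) (Finset.mem_univ i)
              calc ‖dx (b i) u (t, x)‖ = Real.sqrt (‖dx (b i) u (t, x)‖ ^ 2) :=
                    (Real.sqrt_sq (norm_nonneg _)).symm
                _ ≤ Real.sqrt (gradSq u (t, x)) := Real.sqrt_le_sqrt hi
                _ ≤ G := hGb _ hzQ
          _ = n * (Cs / r) * G := by simp [hn]; ring
      calc _ ≤ ‖η (t, x) • (dt u (t, x) + lap u (t, x))‖ + ‖(dt η (t, x) + lap η (t, x)) • u (t, x)‖ +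
            ‖(2 : ℝ) • ∑ i, dx (b i) η (t, x) • dx (b i) u (t, x)‖ := norm_add₃_le
        _ ≤ N := by rw [hN]; exact add_le_add (add_le_add e1 e2) e3
    · have hzw : (t, x) ∉ tsupport w := fun h => hzs (tsupport_smul_subset_left η u h)
      have h1 : dt w (t, x) = 0 :=
        image_eq_zero_of_notMem_tsupport fun h => hzw (tsupport_dt_subset w h)
      have h2 : lap w (t, x) = 0 :=
        image_eq_zero_of_notMem_tsupport fun h => hzw (tsupport_lap_subset w h)
      rw [h1, h2, add_zero, norm_zero]
      exact hN0
  -- the doubling bound for `w`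
  have hgrad := gradSq_le_of_sub_le_c12 hVo hVsub hwV hwVx hwT hwR hwM hwN t₁ x₁ le_rfl
  -- `w = u` near `(t₁, x₁)`
  have heq : gradSq w (t₁, x₁) = gradSq u (t₁, x₁) := by
    have hev : w =ᶠ[𝓝 (t₁, x₁)] u := by
      have ho : IsOpen (Iio (t₁ + r ^ 2 / 4) ×ˢ ball x₁ (r / 2)) := isOpen_Iio.prod isOpen_ball
      have hmem : (t₁, x₁) ∈ Iio (t₁ + r ^ 2 / 4) ×ˢ ball x₁ (r / 2) :=
        ⟨by simp only [mem_Iio]; nlinarith, mem_ball_self (by positivity)⟩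
      filter_upwards [ho.mem_nhds hmem] with z hz
      have h1 : χ z.1 = 1 := hχ1 z.1 (le_of_lt hz.1)
      have h2 : ζ z.2 = 1 := hζ1 z.2 (by
        have := hz.2; rw [mem_ball, dist_eq_norm] at this; exact this.le)
      simp [hw, hη, h1, h2]
    simp only [gradSq, dx_apply, hev.fderiv_eq]
  rw [← heq]
  refine hgrad.trans ?_
  -- `n · 2NM ≤ (2nK₁ + 1) M (c₁(M + G) + M/r² + G/r)`
  have hS0 : 0 ≤ c₁ * (M + G) + M / r ^ 2 + G / r := by positivity
  have hNle : N ≤ K₁ * (c₁ * (M + G) + M / r ^ 2 + G / r) := by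
    rw [hN]
    have h1 : c₁ * (M + G) ≤ K₁ * (c₁ * (M + G)) :=
      le_mul_of_one_le_left (by positivity) hK₁1
    have h2 : (Ct / r ^ 2 + n * (Cs / r ^ 2)) * M ≤ K₁ * (M / r ^ 2) := by
      rw [show (Ct / r ^ 2 + n * (Cs / r ^ 2)) * M = (Ct + n * Cs) * (M / r ^ 2) by ring]
      refine mul_le_mul_of_nonneg_right ?_ (by positivity)
      rw [hK₁]
      have : (0 : ℝ) ≤ n * Cs := by positivity
      linarith
    have h3 : 2 * (n * (Cs / r) * G) ≤ K₁ * (G / r) := by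
      rw [show 2 * (n * (Cs / r) * G) = (2 * n * Cs) * (G / r) by ring]
      refine mul_le_mul_of_nonneg_right ?_ (by positivity)
      rw [hK₁]
      have : (0 : ℝ) ≤ n * Cs := by positivity
      linarith
    nlinarith
  have hn0 : (0 : ℝ) ≤ n := Nat.cast_nonneg _
  calc (n : ℝ) * (2 * N * M) = 2 * n * M * N := by ring
    _ ≤ 2 * n * M * (K₁ * (c₁ * (M + G) + M / r ^ 2 + G / r)) :=
        mul_le_mul_of_nonneg_left hNle (by positivity)
    _ = 2 * n * K₁ * M * (c₁ * (M + G) + M / r ^ 2 + G / r) := by ring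
    _ ≤ (2 * n * K₁ + 1) * M * (c₁ * (M + G) + M / r ^ 2 + G / r) := by
        have : 0 ≤ M * (c₁ * (M + G) + M / r ^ 2 + G / r) := mul_nonneg hM hS0
        nlinarith


/-- **Interior gradient estimate for the backward heat inequality** (the `C²` case of the
estimate Seregin 2014 takes from the regularity theory of parabolic equations in Remark A.2 and
(A.3.7)). There is `C = C(E) > 0` such that: if `u : ℝ × E → F` is of the class `C¹ ∩ {∂ₓu ∈ C¹}` on an open set
containing `[t₀ - δ, t₀ + R²] × B̄(x₀, R)` (`0 < R ≤ 1`, `δ > 0`) and on the future cylinder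
`Q_R = [t₀, t₀ + R²] × B̄(x₀, R)` one has `|∂ₜu + Δu| ≤ c₁(|u| + |∇u|)` (`c₁ ≥ 0`) and
`|u| ≤ M`, then `|∇u(t₀, x₀)| ≤ C (1 + c₁) M / R`. [cite: Seregin2014, App. A.2 Remark A.2 and App. A.3 (A.3.7)] -/
theorem exists_sqrt_gradSq_le_of_backwardHeat_c12 : ∃ C : ℝ, 0 < C ∧
    ∀ ⦃u : ℝ × E → F⦄ ⦃U : Set (ℝ × E)⦄ ⦃c₁ t₀ : ℝ⦄ ⦃x₀ : E⦄ ⦃R δ M : ℝ⦄,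
      IsOpen U → 0 < R → R ≤ 1 → 0 < δ → 0 ≤ c₁ → 0 ≤ M →
      Icc (t₀ - δ) (t₀ + R ^ 2) ×ˢ closedBall x₀ R ⊆ U → ContDiffOn ℝ 1 u U →
      (∀ e : E, ContDiffOn ℝ 1 (dx e u) U) →
      (∀ z ∈ Icc t₀ (t₀ + R ^ 2) ×ˢ closedBall x₀ R,
        ‖dt u z + lap u z‖ ≤ c₁ * (‖u z‖ + Real.sqrt (gradSq u z))) →
      (∀ z ∈ Icc t₀ (t₀ + R ^ 2) ×ˢ closedBall x₀ R, ‖u z‖ ≤ M) →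
      Real.sqrt (gradSq u (t₀, x₀)) ≤ C * (1 + c₁) * M / R := by
  obtain ⟨C₀, hC₀, hB⟩ := exists_gradSq_le_cylinder_c12 E F
  set s : ℝ := Real.sqrt C₀ with hs
  have hs0 : 0 ≤ s := Real.sqrt_nonneg _
  have hs2 : s ^ 2 = C₀ := Real.sq_sqrt hC₀.le
  set K₀ : ℝ := 2 * s ^ 2 + s with hK₀
  have hK₀0 : 0 < K₀ := by rw [hK₀, hs2]; positivity
  refine ⟨2 * K₀, by positivity, ?_⟩
  intro u U c₁ t₀ x₀ R δ M hU hR hR1 hδ hc₁ hM hsubU hu hux hineq hMb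
  set Q : Set (ℝ × E) := Icc t₀ (t₀ + R ^ 2) ×ˢ closedBall x₀ R with hQ
  have hQU : Q ⊆ U := fun z hz => hsubU ⟨⟨by linarith [hz.1.1], hz.1.2⟩, hz.2⟩
  -- the weight `d` and the weighted gradient `Φ`
  set d : ℝ × E → ℝ := fun z => min (R - ‖z.2 - x₀‖) (Real.sqrt (t₀ + R ^ 2 - z.1)) with hd
  set Φ : ℝ × E → ℝ := fun z => d z * Real.sqrt (gradSq u z) with hΦ
  have hQc : IsCompact Q := isCompact_Icc.prod (isCompact_closedBall _ _)
  have hz₀Q : (t₀, x₀) ∈ Q := ⟨⟨le_rfl, by nlinarith⟩, mem_closedBall_self hR.le⟩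
  have hdc : Continuous d := by
    rw [hd]
    fun_prop
  have hgradc : ContinuousOn (fun z => gradSq u z) U := by
    have hf : ContinuousOn (fderiv ℝ u) U := hu.continuousOn_fderiv_of_isOpen hU le_rfl
    have : (fun z => gradSq u z) = fun z => ∑ i, ‖fderiv ℝ u z (0, stdOrthonormalBasis ℝ E i)‖ ^ 2 := by
      funext z; simp [gradSq]
    rw [this]
    exact continuousOn_finsetSum _ fun i _ => ((hf.clm_apply continuousOn_const).norm.pow 2)
  have hΦc : ContinuousOn Φ Q := hdc.continuousOn.mul ((hgradc.mono hQU).sqrt)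
  obtain ⟨z₁, hz₁Q, hmax⟩ := hQc.exists_isMaxOn ⟨_, hz₀Q⟩ hΦc
  -- `Φ` at the centre
  have hdz₀ : d (t₀, x₀) = R := by
    simp only [hd, sub_self, norm_zero, sub_zero, add_sub_cancel_left]
    rw [Real.sqrt_sq hR.le, min_self]
  have hΦz₀ : Φ (t₀, x₀) = R * Real.sqrt (gradSq u (t₀, x₀)) := by
    simp only [hΦ]
    rw [hdz₀]
  have hΦle : R * Real.sqrt (gradSq u (t₀, x₀)) ≤ Φ z₁ := hΦz₀ ▸ hmax hz₀Q
  have hRHS0 : 0 ≤ 2 * K₀ * (1 + c₁) * M / R := by positivity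
  -- trivial case: the maximum is `≤ 0`
  rcases le_or_gt (Φ z₁) 0 with hle0 | hpos
  · have h1 : R * Real.sqrt (gradSq u (t₀, x₀)) ≤ 0 := hΦle.trans hle0
    have h2 : Real.sqrt (gradSq u (t₀, x₀)) ≤ 0 := by
      by_contra h
      push Not at h
      exact absurd h1 (not_le.2 (mul_pos hR h))
    exact h2.trans hRHS0
  -- the maximum point `z₁ = (t₁, x₁)` and the scale `ρ = d(z₁)/2`
  obtain ⟨t₁, x₁⟩ := z₁
  set d₁ : ℝ := d (t₁, x₁) with hd₁
  set g₁ : ℝ := Real.sqrt (gradSq u (t₁, x₁)) with hg₁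
  have hg₁0 : 0 ≤ g₁ := Real.sqrt_nonneg _
  have hΦ₁ : Φ (t₁, x₁) = d₁ * g₁ := rfl
  have hd₁pos : 0 < d₁ := by
    by_contra h
    push Not at h
    have : Φ (t₁, x₁) ≤ 0 := by rw [hΦ₁]; exact mul_nonpos_of_nonpos_of_nonneg h hg₁0
    exact absurd hpos (not_lt.2 this)
  have ht₁ : t₀ ≤ t₁ ∧ t₁ ≤ t₀ + R ^ 2 := hz₁Q.1
  have hx₁ : ‖x₁ - x₀‖ ≤ R := by
    have := hz₁Q.2; rwa [mem_closedBall, dist_eq_norm] at this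
  have hd₁x : d₁ ≤ R - ‖x₁ - x₀‖ := min_le_left _ _
  have hd₁t : d₁ ≤ Real.sqrt (t₀ + R ^ 2 - t₁) := min_le_right _ _
  have hd₁t' : d₁ ^ 2 ≤ t₀ + R ^ 2 - t₁ := by
    calc d₁ ^ 2 ≤ Real.sqrt (t₀ + R ^ 2 - t₁) ^ 2 := pow_le_pow_left₀ hd₁pos.le hd₁t 2
      _ = t₀ + R ^ 2 - t₁ := Real.sq_sqrt (by linarith)
  have hd₁R : d₁ ≤ R := hd₁x.trans (by linarith [norm_nonneg (x₁ - x₀)])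
  set ρ : ℝ := d₁ / 2 with hρ
  have hρ0 : 0 < ρ := by positivity
  have hρ1 : ρ ≤ 1 := by rw [hρ]; linarith
  -- the sub-cylinder at `z₁` of radius `ρ`
  have hsub₁ : Icc (t₁ - δ) (t₁ + ρ ^ 2) ×ˢ closedBall x₁ ρ ⊆ U := by
    refine fun z hz => hsubU ⟨⟨by linarith [hz.1.1], ?_⟩, ?_⟩
    · have : ρ ^ 2 ≤ d₁ ^ 2 := by rw [hρ]; nlinarith
      linarith [hz.1.2]
    · have h2 := hz.2
      rw [mem_closedBall, dist_eq_norm] at h2 ⊢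
      calc ‖z.2 - x₀‖ ≤ ‖z.2 - x₁‖ + ‖x₁ - x₀‖ := norm_sub_le_norm_sub_add_norm_sub _ _ _
        _ ≤ R := by linarith
  have hQ₁ : Icc t₁ (t₁ + ρ ^ 2) ×ˢ closedBall x₁ ρ ⊆ Q := by
    refine fun z hz => ⟨⟨ht₁.1.trans hz.1.1, ?_⟩, ?_⟩
    · have : ρ ^ 2 ≤ d₁ ^ 2 := by rw [hρ]; nlinarith
      linarith [hz.1.2]
    · have h2 := hz.2
      rw [mem_closedBall, dist_eq_norm] at h2 ⊢
      calc ‖z.2 - x₀‖ ≤ ‖z.2 - x₁‖ + ‖x₁ - x₀‖ := norm_sub_le_norm_sub_add_norm_sub _ _ _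
        _ ≤ R := by linarith
  -- on it, `|∇u| ≤ 2 g₁`
  have hG : ∀ z ∈ Icc t₁ (t₁ + ρ ^ 2) ×ˢ closedBall x₁ ρ, Real.sqrt (gradSq u z) ≤ 2 * g₁ := by
    intro z hz
    have hzQ := hQ₁ hz
    have h2 := hz.2
    rw [mem_closedBall, dist_eq_norm] at h2
    -- `d z ≥ d₁ / 2`
    have hdz : d₁ / 2 ≤ d z := by
      simp only [hd]
      refine le_min ?_ ?_
      · have : ‖z.2 - x₀‖ ≤ ‖z.2 - x₁‖ + ‖x₁ - x₀‖ := norm_sub_le_norm_sub_add_norm_sub _ _ _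
        linarith
      · have h3 : (d₁ / 2) ^ 2 ≤ t₀ + R ^ 2 - z.1 := by nlinarith [hz.1.2]
        calc d₁ / 2 = Real.sqrt ((d₁ / 2) ^ 2) := (Real.sqrt_sq (by positivity)).symm
          _ ≤ Real.sqrt (t₀ + R ^ 2 - z.1) := Real.sqrt_le_sqrt h3
    have hdzpos : 0 < d z := lt_of_lt_of_le (by positivity) hdz
    have hΦz : d z * Real.sqrt (gradSq u z) ≤ d₁ * g₁ := hmax hzQ
    -- divide by `d z`
    rw [← le_div_iff₀' hdzpos] at hΦz
    refine hΦz.trans ?_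
    rw [div_le_iff₀ hdzpos]
    nlinarith
  -- the localised bound at `z₁`
  have hloc := hB hU hρ0 hρ1 hδ hc₁ hM (by positivity : (0 : ℝ) ≤ 2 * g₁) hsub₁ hu hux
    (fun z hz => hineq z (hQ₁ hz)) (fun z hz => hMb z (hQ₁ hz)) hG
  -- `g₁² ≤ 2 s² X g₁ + s² X²` with `X = (1 + c₁) M / ρ`
  set X : ℝ := (1 + c₁) * M / ρ with hX
  have hX0 : 0 ≤ X := by positivity
  have hsq : g₁ ^ 2 ≤ 2 * s ^ 2 * X * g₁ + s ^ 2 * X ^ 2 := by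
    have hg₁sq : g₁ ^ 2 = gradSq u (t₁, x₁) := Real.sq_sqrt (gradSq_nonneg _ _)
    rw [hg₁sq, hs2]
    refine hloc.trans ?_
    -- compare the two right-hand sides after clearing `ρ`
    set q : ℝ := ρ⁻¹ with hq
    have hq1 : 1 ≤ q := by rw [hq]; exact one_le_inv_iff₀.2 ⟨hρ0, hρ1⟩
    have hq0 : 0 ≤ q := zero_le_one.trans hq1
    have e1 : M / ρ ^ 2 = M * q ^ 2 := by rw [hq, div_eq_mul_inv, inv_pow]
    have e2 : 2 * g₁ / ρ = 2 * g₁ * q := by rw [hq, div_eq_mul_inv]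
    have e3 : X = (1 + c₁) * M * q := by rw [hX, hq, div_eq_mul_inv]
    rw [e1, e2, e3]
    have hin := localisation_arith hc₁ hM hg₁0 hq1
    calc C₀ * M * (c₁ * (M + 2 * g₁) + M * q ^ 2 + 2 * g₁ * q)
        = C₀ * (M * (c₁ * (M + 2 * g₁) + M * q ^ 2 + 2 * g₁ * q)) := by ring
      _ ≤ C₀ * (2 * ((1 + c₁) * M * q) * g₁ + ((1 + c₁) * M * q) ^ 2) :=
          mul_le_mul_of_nonneg_left hin hC₀.le
      _ = 2 * C₀ * ((1 + c₁) * M * q) * g₁ + C₀ * ((1 + c₁) * M * q) ^ 2 := by ring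
  have hg₁le : g₁ ≤ K₀ * X := le_of_sq_le_two_mul_add hX0 hs0 hsq
  -- conclusion
  have hΦ₁le : Φ (t₁, x₁) ≤ 2 * K₀ * (1 + c₁) * M := by
    rw [hΦ₁]
    calc d₁ * g₁ ≤ d₁ * (K₀ * X) := mul_le_mul_of_nonneg_left hg₁le hd₁pos.le
      _ = 2 * K₀ * (1 + c₁) * M := by rw [hX, hρ]; field_simp
  have hfin : R * Real.sqrt (gradSq u (t₀, x₀)) ≤ 2 * K₀ * (1 + c₁) * M := hΦle.trans hΦ₁le
  rw [le_div_iff₀ hR]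
  linarith



end LocalisationC12

end Carleman

end

/-! ## Part: BackwardHeatSupL2C12 -/

section
open MeasureTheory Filter Topology Set InnerProductSpace Metric Function
open scoped Real NNReal RealInnerProductSpace ContDiff InnerProductSpace Manifold

open UnboundedOperators Scheffer Literature.Analysis.Calculus

namespace Carleman

section DualityC12

variable {E : Type*} [NormedAddCommGroup E] [InnerProductSpace ℝ E] [FiniteDimensional ℝ E]
  [MeasurableSpace E] [BorelSpace E]
variable {F : Type*} [NormedAddCommGroup F] [InnerProductSpace ℝ F]

omit [MeasurableSpace E] [BorelSpace E] in
/-- `Δₓ` is continuous when every `∂ₑW ∈ C¹`. [folklore] -/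
theorem continuous_lap_c12 {W : ℝ × E → F} (hWx : ∀ e : E, ContDiff ℝ 1 (dx e W)) :
    Continuous (lap W) := by
  unfold lap
  refine continuous_finsetSum _ fun i _ => ?_
  exact ((hWx _).continuous_fderiv one_ne_zero).clm_apply continuous_const

/-- **Green's formula followed by the square rule**, one coordinate:
`∫ G ⟪W, ∂ₑ∂ₑW⟫ = ½ ∫ ∂ₑ∂ₑG ‖W‖² - ∫ G ‖∂ₑW‖²` for compactly supported `W ∈ C¹` with every `∂ₑW ∈ C¹`, `G ∈ C²`. [folklore] -/
theorem integral_mul_inner_dx_dx_c12 {W : ℝ × E → F} (hW1 : ContDiff ℝ 1 W)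
    (hWx : ∀ e : E, ContDiff ℝ 1 (dx e W))
    (hWc : HasCompactSupport W) {G : ℝ × E → ℝ} (hG : ContDiff ℝ 2 G) (e : E) :
    ∫ z, G z * ⟪W z, dx e (dx e W) z⟫ =
      (1 / 2) * (∫ z, fderiv ℝ (fun y => fderiv ℝ G y (0, e)) z (0, e) * ‖W z‖ ^ 2)
        - ∫ z, G z * ‖dx e W z‖ ^ 2 := by
  have hG1 : ContDiffOn ℝ 1 G univ := (hG.of_le one_le_two).contDiffOn
  have hdG1 : ContDiffOn ℝ 1 (fun y => fderiv ℝ G y (0, e)) univ :=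
    ((hG.fderiv_right (m := 1) le_rfl).clm_apply contDiff_const).contDiffOn
  have h1 := integral_mul_inner_fderiv_eq_of_open isOpen_univ (w := G) (Φ := W)
    (Ψ := dx e W) hG1 hW1 (hWx e) hWc (hasCompactSupport_dx hWc _)
    (subset_univ _) (0, e)
  have h2 := two_mul_integral_mul_inner_fderiv_self_of_open isOpen_univ
    (w := fun y => fderiv ℝ G y (0, e)) (W := W) hdG1 hW1 hWc (subset_univ _) (0, e)
  have e1 : ∫ z, G z * ⟪fderiv ℝ W z (0, e), dx e W z⟫ = ∫ z, G z * ‖dx e W z‖ ^ 2 :=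
    integral_congr_ae (Eventually.of_forall fun z => by
      show G z * ⟪fderiv ℝ W z (0, e), dx e W z⟫ = G z * ‖dx e W z‖ ^ 2
      rw [← dx_apply, real_inner_self_eq_norm_sq])
  have e2 : ∫ z, fderiv ℝ G z (0, e) * ⟪W z, dx e W z⟫ =
      ∫ z, fderiv ℝ G z (0, e) * ⟪W z, fderiv ℝ W z (0, e)⟫ := rfl
  have e3 : ∫ z, G z * ⟪W z, fderiv ℝ (dx e W) z (0, e)⟫ = ∫ z, G z * ⟪W z, dx e (dx e W) z⟫ :=
    rfl
  rw [e1, e2] at h1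
  rw [← e3, h1]
  linarith

/-- **The duality identity.** For a `C²` compactly supported field `W : ℝ × E → F` and a `C²`
weight `G`,
`∫ G ⟪W, ∂ₜW + ΔₓW⟫ = -½ ∫ ∂ₜG ‖W‖² + ½ ∫ ΔₓG ‖W‖² - ∫ G |∇ₓW|²`
(all derivatives moved onto the weight; no boundary terms). This is the integration by parts
behind every duality proof of local estimates for the heat operator (LSU 1968, Ch. III §8). [folklore] -/
theorem integral_mul_inner_dt_add_lap_c12 {W : ℝ × E → F} (hW1 : ContDiff ℝ 1 W)
    (hWx : ∀ e : E, ContDiff ℝ 1 (dx e W))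
    (hWc : HasCompactSupport W) {G : ℝ × E → ℝ} (hG : ContDiff ℝ 2 G) :
    ∫ z, G z * ⟪W z, dt W z + lap W z⟫ =
      -(1 / 2) * (∫ z, dt G z * ‖W z‖ ^ 2) + (1 / 2) * (∫ z, lap G z * ‖W z‖ ^ 2)
        - ∫ z, G z * gradSq W z := by
  set b := stdOrthonormalBasis ℝ E with hb
  have hG1 : ContDiffOn ℝ 1 G univ := (hG.of_le one_le_two).contDiffOn
  have cG : Continuous G := hG.continuous
  have cW : Continuous W := hW1.continuous
  have cdtW : Continuous (dt W) := continuous_fderiv_apply_c1 hW1 (1, 0)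
  have cdxW : ∀ e, Continuous (dx e W) := fun e => (hWx e).continuous
  have cdxdxW : ∀ e, Continuous (dx e (dx e W)) := fun e =>
    ((hWx e).continuous_fderiv one_ne_zero).clm_apply continuous_const
  have cddG : ∀ e : E, Continuous fun z => fderiv ℝ (fun y => fderiv ℝ G y (0, e)) z (0, e) :=
    fun e => (((hG.fderiv_right (m := 1) le_rfl).clm_apply contDiff_const).continuous_fderiv
      one_ne_zero).clm_apply continuous_const
  -- time part
  have ht := two_mul_integral_mul_inner_fderiv_self_of_open isOpen_univ (w := G) (W := W) hG1
    hW1 hWc (subset_univ _) ((1 : ℝ), (0 : E))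
  have ht' : ∫ z, G z * ⟪W z, dt W z⟫ = -(1 / 2) * ∫ z, dt G z * ‖W z‖ ^ 2 := by
    have e1 : ∫ z, G z * ⟪W z, dt W z⟫ = ∫ z, G z * ⟪W z, fderiv ℝ W z (1, 0)⟫ := rfl
    have e2 : ∫ z, dt G z * ‖W z‖ ^ 2 = ∫ z, fderiv ℝ G z (1, 0) * ‖W z‖ ^ 2 := rfl
    rw [e1, e2]
    linarith
  -- space part
  have hsp : ∫ z, G z * ⟪W z, lap W z⟫ =
      (1 / 2) * (∫ z, lap G z * ‖W z‖ ^ 2) - ∫ z, G z * gradSq W z := by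
    have hint1 : ∀ i, Integrable fun z => G z * ⟪W z, dx (b i) (dx (b i) W) z⟫ := fun i =>
      integrable_mul_inner_of_continuous cG cW (cdxdxW _) hWc
    have hint2 : ∀ i, Integrable fun z =>
        fderiv ℝ (fun y => fderiv ℝ G y (0, b i)) z (0, b i) * ‖W z‖ ^ 2 := fun i =>
      integrable_mul_norm_sq_of_continuous (cddG _) cW hWc
    have hint3 : ∀ i, Integrable fun z => G z * ‖dx (b i) W z‖ ^ 2 := fun i =>
      integrable_mul_norm_sq_of_continuous cG (cdxW _) (hasCompactSupport_dx hWc _)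
    calc ∫ z, G z * ⟪W z, lap W z⟫
        = ∫ z, ∑ i, G z * ⟪W z, dx (b i) (dx (b i) W) z⟫ := by
          refine integral_congr_ae (Eventually.of_forall fun z => ?_)
          show G z * ⟪W z, lap W z⟫ = ∑ i, G z * ⟪W z, dx (b i) (dx (b i) W) z⟫
          rw [lap, ← Finset.mul_sum, ← inner_sum]
      _ = ∑ i, ∫ z, G z * ⟪W z, dx (b i) (dx (b i) W) z⟫ :=
          integral_finsetSum _ fun i _ => hint1 i
      _ = ∑ i, ((1 / 2) * (∫ z, fderiv ℝ (fun y => fderiv ℝ G y (0, b i)) z (0, b i) * ‖W z‖ ^ 2)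
            - ∫ z, G z * ‖dx (b i) W z‖ ^ 2) :=
          Finset.sum_congr rfl fun i _ => integral_mul_inner_dx_dx_c12 hW1 hWx hWc hG (b i)
      _ = (1 / 2) * (∑ i, ∫ z, fderiv ℝ (fun y => fderiv ℝ G y (0, b i)) z (0, b i) * ‖W z‖ ^ 2)
            - ∑ i, ∫ z, G z * ‖dx (b i) W z‖ ^ 2 := by
          rw [Finset.sum_sub_distrib, Finset.mul_sum]
      _ = (1 / 2) * (∫ z, lap G z * ‖W z‖ ^ 2) - ∫ z, G z * gradSq W z := by
          congr 2
          · rw [← integral_finsetSum _ fun i _ => hint2 i]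
            refine integral_congr_ae (Eventually.of_forall fun z => ?_)
            show ∑ i, fderiv ℝ (fun y => fderiv ℝ G y (0, b i)) z (0, b i) * ‖W z‖ ^ 2 =
              lap G z * ‖W z‖ ^ 2
            rw [lap, Finset.sum_mul]
            rfl
          · rw [← integral_finsetSum _ fun i _ => hint3 i]
            refine integral_congr_ae (Eventually.of_forall fun z => ?_)
            show ∑ i, G z * ‖dx (b i) W z‖ ^ 2 = G z * gradSq W z
            rw [gradSq, Finset.mul_sum]
  -- assemble
  have hadd : ∫ z, G z * ⟪W z, dt W z + lap W z⟫ =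
      (∫ z, G z * ⟪W z, dt W z⟫) + ∫ z, G z * ⟪W z, lap W z⟫ := by
    rw [← integral_add (integrable_mul_inner_of_continuous cG cW cdtW hWc)
      (integrable_mul_inner_of_continuous cG cW (continuous_lap_c12 hWx) hWc)]
    refine integral_congr_ae (Eventually.of_forall fun z => ?_)
    show G z * ⟪W z, dt W z + lap W z⟫ = G z * ⟪W z, dt W z⟫ + G z * ⟪W z, lap W z⟫
    rw [inner_add_right, mul_add]
  rw [hadd, ht', hsp]
  ring

/-! ### The weak subsolution inequality -/

/-- **Weak subsolution inequality, global form.** Let `W : ℝ × E → F` be `C¹` with every `∂ₑW ∈ C¹`, with compact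
support, `G ≥ 0` a `C²` weight, `c` real, and suppose `|∂ₜW + ΔW| ≤ c (|∇W| + |W|)` wherever
`G ≠ 0`. Then `∫ (∂ₜG - ΔG - (2c + c²/2) G) ‖W‖² ≤ 0`: by the duality identity and the Young
step the `|∇W|²` terms cancel exactly. [folklore] -/
theorem integral_heatOp_mul_norm_sq_nonpos_of_global_c12 {W : ℝ × E → F} (hW1 : ContDiff ℝ 1 W)
    (hWx : ∀ e : E, ContDiff ℝ 1 (dx e W))
    (hWc : HasCompactSupport W) {G : ℝ × E → ℝ} (hG : ContDiff ℝ 2 G) (hG0 : ∀ z, 0 ≤ G z)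
    {c : ℝ}
    (hineq : ∀ z, G z ≠ 0 → ‖dt W z + lap W z‖ ≤ c * (Real.sqrt (gradSq W z) + ‖W z‖)) :
    ∫ z, (dt G z - lap G z - (2 * c + c ^ 2 / 2) * G z) * ‖W z‖ ^ 2 ≤ 0 := by
  have cG : Continuous G := hG.continuous
  have cW : Continuous W := hW1.continuous
  have cdtG : Continuous (dt G) := (contDiff_one_dt_of_two hG).continuous
  have clapG : Continuous (lap G) := continuous_lap_of_two hG
  have cdtW : Continuous (dt W) := continuous_fderiv_apply_c1 hW1 (1, 0)
  have clapW : Continuous (lap W) := continuous_lap_c12 hWx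
  have cgW : Continuous (gradSq W) := continuous_gradSq_of_one hW1
  -- pointwise Young step, weighted by `G ≥ 0`
  have hpt : ∀ z, -(c + c ^ 2 / 4) * (G z * ‖W z‖ ^ 2) ≤
      G z * ⟪W z, dt W z + lap W z⟫ + G z * gradSq W z := by
    intro z
    by_cases hz : G z = 0
    · simp [hz]
    · have h := inner_dt_add_lap_add_gradSq_ge (hineq z hz)
      have := mul_le_mul_of_nonneg_left h (hG0 z)
      nlinarith
  -- integrability
  have i1 : Integrable fun z => G z * ⟪W z, dt W z + lap W z⟫ :=
    integrable_mul_inner_of_continuous cG cW (cdtW.add clapW) hWc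
  have i2 : Integrable fun z => G z * gradSq W z :=
    integrable_of_continuous_hasCompactSupport (cG.mul cgW)
      (HasCompactSupport.intro hWc fun z hz => by
        simp [gradSq_eq_zero_of_notMem_tsupport hz])
  have i3 : Integrable fun z => G z * ‖W z‖ ^ 2 := integrable_mul_norm_sq_of_continuous cG cW hWc
  have i4 : Integrable fun z => dt G z * ‖W z‖ ^ 2 :=
    integrable_mul_norm_sq_of_continuous cdtG cW hWc
  have i5 : Integrable fun z => lap G z * ‖W z‖ ^ 2 :=
    integrable_mul_norm_sq_of_continuous clapG cW hWc
  -- integrate the pointwise inequality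
  have hI : -(c + c ^ 2 / 4) * ∫ z, G z * ‖W z‖ ^ 2 ≤
      (∫ z, G z * ⟪W z, dt W z + lap W z⟫) + ∫ z, G z * gradSq W z := by
    rw [← integral_const_mul, ← integral_add i1 i2]
    exact integral_mono (i3.const_mul _) (i1.add i2) hpt
  rw [integral_mul_inner_dt_add_lap_c12 hW1 hWx hWc hG] at hI
  -- split the goal integral
  have hsplit : ∫ z, (dt G z - lap G z - (2 * c + c ^ 2 / 2) * G z) * ‖W z‖ ^ 2 =
      (∫ z, dt G z * ‖W z‖ ^ 2) - (∫ z, lap G z * ‖W z‖ ^ 2)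
        - (2 * c + c ^ 2 / 2) * ∫ z, G z * ‖W z‖ ^ 2 := by
    have i45 : Integrable fun z => dt G z * ‖W z‖ ^ 2 - lap G z * ‖W z‖ ^ 2 := i4.sub i5
    have i3' : Integrable fun z => (2 * c + c ^ 2 / 2) * (G z * ‖W z‖ ^ 2) := i3.const_mul _
    rw [← integral_sub i4 i5, ← integral_const_mul, ← integral_sub i45 i3']
    refine integral_congr_ae (Eventually.of_forall fun z => ?_)
    show _ = dt G z * ‖W z‖ ^ 2 - lap G z * ‖W z‖ ^ 2 - (2 * c + c ^ 2 / 2) * (G z * ‖W z‖ ^ 2)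
    ring
  rw [hsplit]
  linarith [hI]

/-! ### Localisation: fields of class `C²` on an open set -/

/-- **Weak subsolution inequality** for the backward heat inequality. Let `U ⊆ ℝ × E` be open,
`v ∈ C²(U; F)` with `|∂ₜv + Δₓv| ≤ c₁ (|∇ₓv| + |v|)` on `U`, and let `G ≥ 0` be `C²` with compact
support, `tsupport G ⊆ U`. Then

  `∫ (∂ₜG - ΔₓG - (2c₁ + c₁²/2) G) |v|² ≤ 0`,

i.e. `|v|²` is a weak subsolution of `∂ₜw + Δw + (2c₁ + c₁²/2) w ≥ 0` (for `c₁ ≥ 0`; the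
statement holds for every real `c₁`). Proof: multiply `v` by a smooth cut-off `χ ∈ C_c^∞(U)`
equal to `1` near `tsupport G` (`exists_smooth_cutoff_nhdsSet`) and apply the global form to
`W = χ • v`, which is `C²` on `ℝ × E` and agrees with `v`, together with all frame derivatives,
wherever `G`, `∂ₜG` or `ΔG` is non-zero. [folklore] -/
theorem integral_heatOp_mul_norm_sq_nonpos_c12 {U : Set (ℝ × E)} (hU : IsOpen U) {v : ℝ × E → F}
    (hv : ContDiffOn ℝ 1 v U) (hvx : ∀ e : E, ContDiffOn ℝ 1 (dx e v) U) {c₁ : ℝ}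
    (hineq : ∀ z ∈ U, ‖dt v z + lap v z‖ ≤ c₁ * (Real.sqrt (gradSq v z) + ‖v z‖))
    {G : ℝ × E → ℝ} (hG : ContDiff ℝ 2 G) (hGc : HasCompactSupport G) (hGU : tsupport G ⊆ U)
    (hG0 : ∀ z, 0 ≤ G z) :
    ∫ z, (dt G z - lap G z - (2 * c₁ + c₁ ^ 2 / 2) * G z) * ‖v z‖ ^ 2 ≤ 0 := by
  -- the cut-off and the open set where it equals `1`
  obtain ⟨χ, hχ, hχc, hχU, hχ1⟩ :=
    exists_smooth_cutoff_nhdsSet (X := ℝ × E) hGc hU hGU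
  obtain ⟨O, hO, hKO, hO1⟩ := mem_nhdsSet_iff_exists.1 hχ1
  have hχ2 : ContDiff ℝ 2 χ := hχ.of_le (WithTop.coe_le_coe.2 le_top)
  -- the globalised field
  set W : ℝ × E → F := fun z => χ z • v z with hWdef
  have hW : ContDiff ℝ 1 W := contDiff_one_cutoff_smul_c12 hU hχ2 hχU hv
  have hWx' : ∀ e : E, ContDiff ℝ 1 (dx e W) := fun e =>
    contDiff_one_dx_cutoff_smul_c12 hU hχ2 hχU hv hvx e
  have hWc : HasCompactSupport W := hχc.mono fun z hz => by
    contrapose! hz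
    simp [hWdef, notMem_support.1 hz]
  have hWv : ∀ y ∈ O, W y = v y := fun y hy => by
    have : χ y = 1 := hO1 hy
    simp [hWdef, this]
  -- off `O` the weight and its derivatives vanish
  have hGO : ∀ z, z ∉ O → G z = 0 ∧ dt G z = 0 ∧ lap G z = 0 := by
    intro z hz
    have hzK : z ∉ tsupport G := fun h => hz (hKO h)
    refine ⟨image_eq_zero_of_notMem_tsupport hzK, ?_, ?_⟩
    · rw [dt_apply, fderiv_of_notMem_tsupport (𝕜 := ℝ) hzK]
      rfl
    · exact image_eq_zero_of_notMem_tsupport fun h => hzK (tsupport_lap_subset G h)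
  -- the inequality for `W` where `G ≠ 0`
  have hineqW : ∀ z, G z ≠ 0 → ‖dt W z + lap W z‖ ≤ c₁ * (Real.sqrt (gradSq W z) + ‖W z‖) := by
    intro z hz
    have hzO : z ∈ O := by
      by_contra h
      exact hz (hGO z h).1
    obtain ⟨h1, -, -, h4, h5⟩ := frame_eq_of_eventuallyEq hO hzO hWv
    rw [h1, h4, h5, hWv z hzO]
    exact hineq z (hGU (subset_tsupport G (mem_support.2 hz)))
  -- the global inequality for `W`, and back to `v`
  have key := integral_heatOp_mul_norm_sq_nonpos_of_global_c12 hW hWx' hWc hG hG0 hineqW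
  have heq : ∫ z, (dt G z - lap G z - (2 * c₁ + c₁ ^ 2 / 2) * G z) * ‖v z‖ ^ 2 =
      ∫ z, (dt G z - lap G z - (2 * c₁ + c₁ ^ 2 / 2) * G z) * ‖W z‖ ^ 2 := by
    refine integral_congr_ae (Eventually.of_forall fun z => ?_)
    by_cases hzO : z ∈ O
    · simp only [hWv z hzO]
    · obtain ⟨h0, h1, h2⟩ := hGO z hzO
      simp only [h0, h1, h2, mul_zero, sub_zero, zero_mul]
  rw [heq]
  exact key


end DualityC12

section EstimateC12

variable {E : Type*} [NormedAddCommGroup E] [InnerProductSpace ℝ E] [FiniteDimensional ℝ E]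
  [MeasurableSpace E] [BorelSpace E]
variable {F : Type*} [NormedAddCommGroup F] [InnerProductSpace ℝ F]

/-- **The `L∞–L²` estimate for the backward heat inequality** on a finite-dimensional inner
product space `E` (values in any real inner product space `F`): for every `c₁` there is
`c₉ = c₉(c₁, dim E) > 0` such that for every `x₀`, every open `U ⊇ [1/2, 1] × B̄(x₀, 1)` and
every `v ∈ C²(U; F)` with `|∂ₜv + Δₓv| ≤ c₁(|∇ₓv| + |v|)` on `U`,
`|v(1/2, x₀)|² ≤ c₉ ∫_{]1/2,1[×B(x₀,1)} |v|²` (duality proof, see the file header).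
[cite: Seregin2014, App. A.2 (A.2.18)] -/
theorem norm_sq_le_integral_of_backwardHeat_c12 (c₁ : ℝ) :
    ∃ c₉ : ℝ, 0 < c₉ ∧ ∀ (x₀ : E) (v : ℝ × E → F) (U : Set (ℝ × E)), IsOpen U →
      Icc (1 / 2 : ℝ) 1 ×ˢ closedBall x₀ 1 ⊆ U → ContDiffOn ℝ 1 v U →
      (∀ e : E, ContDiffOn ℝ 1 (dx e v) U) →
      (∀ z ∈ U, ‖dt v z + lap v z‖ ≤ c₁ * (Real.sqrt (gradSq v z) + ‖v z‖)) →
      ‖v ((1 / 2 : ℝ), x₀)‖ ^ 2 ≤ c₉ * ∫ z in Ioo (1 / 2 : ℝ) 1 ×ˢ ball x₀ 1, ‖v z‖ ^ 2 := by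
  obtain ⟨K, hK0, hK⟩ := exists_abs_heatTestRem_le (E := E)
  set c := |c₁| with hc
  set C₀ : ℝ := 2 * c + c ^ 2 / 2 with hC₀
  have hC₀0 : 0 ≤ C₀ := by positivity
  set M := Real.exp C₀ * K with hM
  have hM0 : 0 ≤ M := by positivity
  refine ⟨M + 1, by positivity, fun x₀ v U hU hsub hv hvx hineq => ?_⟩
  set I := ∫ z in Ioo (1 / 2 : ℝ) 1 ×ˢ ball x₀ 1, ‖v z‖ ^ 2 with hI
  set w₀ := ‖v ((1 / 2 : ℝ), x₀)‖ ^ 2 with hw₀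
  have hcont : ContinuousOn v U := hv.continuousOn
  have hineq' : ∀ z ∈ U, ‖dt v z + lap v z‖ ≤ c * (Real.sqrt (gradSq v z) + ‖v z‖) :=
    fun z hz => (hineq z hz).trans (mul_le_mul_of_nonneg_right (le_abs_self c₁)
      (add_nonneg (Real.sqrt_nonneg _) (norm_nonneg _)))
  have hcyl : Ioo (1 / 2 : ℝ) 1 ×ˢ ball x₀ 1 ⊆ Icc (1 / 2 : ℝ) 1 ×ˢ closedBall x₀ 1 :=
    prod_mono Ioo_subset_Icc_self ball_subset_closedBall
  have hKc : IsCompact (Icc (1 / 2 : ℝ) 1 ×ˢ closedBall x₀ 1) :=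
    isCompact_Icc.prod (isCompact_closedBall _ _)
  have hmeas : MeasurableSet (Ioo (1 / 2 : ℝ) 1 ×ˢ ball x₀ 1) :=
    measurableSet_Ioo.prod measurableSet_ball
  have hI0 : 0 ≤ I := setIntegral_nonneg hmeas fun z _ => sq_nonneg _
  have hvI : IntegrableOn (fun z => ‖v z‖ ^ 2) (Ioo (1 / 2 : ℝ) 1 ×ˢ ball x₀ 1) :=
    (((hcont.mono hsub).norm.pow 2).integrableOn_compact hKc).mono_set hcyl
  -- the estimate up to `γ`
  have key : ∀ γ : ℝ, 0 < γ → γ < 1 → (w₀ - γ) * (1 - γ) ≤ M * I := by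
    intro γ hγ0 hγ1
    rcases le_or_gt w₀ γ with hwγ | hwγ
    · nlinarith
    -- continuity of `|v|²` at the pole
    have hz₀U : ((1 / 2 : ℝ), x₀) ∈ U :=
      hsub ⟨⟨le_rfl, by norm_num⟩, mem_closedBall_self zero_le_one⟩
    have hca : ContinuousAt (fun z => ‖v z‖ ^ 2) ((1 / 2 : ℝ), x₀) :=
      ((hcont.continuousAt (hU.mem_nhds hz₀U)).norm.pow 2)
    have hev : ∀ᶠ z in 𝓝 ((1 / 2 : ℝ), x₀), w₀ - γ < ‖v z‖ ^ 2 :=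
      hca.eventually (lt_mem_nhds (by linarith))
    obtain ⟨ρ, hρ, hball⟩ := Metric.eventually_nhds_iff_ball.1 hev
    set r := min (ρ / 2) (1 / 2) with hr
    have hr0 : 0 < r := by positivity
    have hrρ : r < ρ := (min_le_left _ _).trans_lt (by linarith)
    have hr2 : r ≤ 1 / 2 := min_le_right _ _
    have hlow : ∀ z : ℝ × E, z.1 ∈ Icc (1 / 2 : ℝ) (1 / 2 + r) → z.2 ∈ ball x₀ r →
        w₀ - γ < ‖v z‖ ^ 2 := by
      intro z ht hx
      apply hball
      rw [mem_ball, Prod.dist_eq, max_lt_iff]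
      refine ⟨?_, (mem_ball.1 hx).trans hrρ⟩
      rw [Real.dist_eq, abs_lt]
      constructor <;> linarith [ht.1, ht.2]
    -- the variance
    obtain ⟨δ, hδ0, hδr, hδ4, hτ⟩ := exists_delta_tail_le (Module.finrank ℝ E : ℝ) hr0 hγ0
    -- the test function with `ε = δ`
    have hG2 : ContDiff ℝ 2 (heatTest C₀ δ δ x₀) := contDiff_two_heatTest hδ0 hδ0
    have hGc : HasCompactSupport (heatTest C₀ δ δ x₀) := hasCompactSupport_heatTest hδ0
    have hGU : tsupport (heatTest C₀ δ δ x₀) ⊆ U :=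
      (tsupport_heatTest_subset hδ0).trans ((prod_mono Subset.rfl
        (closedBall_subset_closedBall (by norm_num))).trans hsub)
    have hG0 : ∀ z, 0 ≤ heatTest C₀ δ δ x₀ z := heatTest_nonneg hδ0 hδ0
    have hweak := integral_heatOp_mul_norm_sq_nonpos_c12 hU hv hvx hineq' hG2 hGc hGU hG0
    -- `∂ₜG - ΔG - C₀G = P + Q`
    set P := heatTestPos C₀ δ δ x₀ with hP
    set Q := heatTestRem C₀ δ δ x₀ with hQ
    have hPQ : ∀ z, (dt (heatTest C₀ δ δ x₀) z - lap (heatTest C₀ δ δ x₀) z -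
        (2 * c + c ^ 2 / 2) * heatTest C₀ δ δ x₀ z) * ‖v z‖ ^ 2 =
          P z * ‖v z‖ ^ 2 + Q z * ‖v z‖ ^ 2 := fun z => by
      rw [dt_sub_lap_heatTest hδ0 hδ0 hδ4 z]
      ring
    have hKb := fun z => hK C₀ δ δ x₀ hC₀0 hδ0 hδ0 hδ4 z
    -- integrability
    have hPi : Integrable fun z => P z * ‖v z‖ ^ 2 := by
      refine integrable_mul_norm_sq_of_support hU hKc hsub (continuous_heatTestPos hδ0 hδ0)
        (fun z hz => ?_) hcont
      obtain ⟨⟨h1, h2⟩, h3⟩ := heatTestPos_ne_zero_imp hδ0 hz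
      refine ⟨⟨h1.le, by linarith⟩, ?_⟩
      rw [mem_closedBall, dist_eq_norm, ← norm_sub_rev]
      linarith
    have hQi : Integrable fun z => Q z * ‖v z‖ ^ 2 :=
      integrable_mul_norm_sq_of_support hU hKc hsub (continuous_heatTestRem hδ0 hδ0)
        (fun z hz => hcyl ((hKb z).2 hz)) hcont
    have hQai : Integrable fun z => |Q z| * ‖v z‖ ^ 2 := by
      have : (fun z => |Q z| * ‖v z‖ ^ 2) = fun z => |Q z * ‖v z‖ ^ 2| := by
        funext z
        rw [abs_mul, abs_of_nonneg (sq_nonneg ‖v z‖)]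
      rw [this]
      exact hQi.abs
    -- split the weak inequality
    have hsum : (∫ z, P z * ‖v z‖ ^ 2) + ∫ z, Q z * ‖v z‖ ^ 2 ≤ 0 := by
      rw [← integral_add hPi hQi]
      calc ∫ z, P z * ‖v z‖ ^ 2 + Q z * ‖v z‖ ^ 2
          = ∫ z, (dt (heatTest C₀ δ δ x₀) z - lap (heatTest C₀ δ δ x₀) z -
              (2 * c + c ^ 2 / 2) * heatTest C₀ δ δ x₀ z) * ‖v z‖ ^ 2 :=
            integral_congr_ae (Eventually.of_forall fun z => (hPQ z).symm)
        _ ≤ 0 := hweak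
    -- the bounded part
    have hQb : -(∫ z, Q z * ‖v z‖ ^ 2) ≤ M * I := by
      rw [← integral_neg]
      have h1 : ∫ z, -(Q z * ‖v z‖ ^ 2) ≤ ∫ z, |Q z| * ‖v z‖ ^ 2 :=
        integral_mono hQi.neg hQai fun z => by
          have := neg_abs_le (Q z)
          nlinarith [sq_nonneg ‖v z‖]
      have h2 : ∫ z, |Q z| * ‖v z‖ ^ 2 = ∫ z in Ioo (1 / 2 : ℝ) 1 ×ˢ ball x₀ 1, |Q z| * ‖v z‖ ^ 2 := by
        refine (setIntegral_eq_integral_of_forall_compl_eq_zero fun z hz => ?_).symm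
        have : Q z = 0 := not_not.1 fun h => hz ((hKb z).2 h)
        simp [this]
      have h3 : ∫ z in Ioo (1 / 2 : ℝ) 1 ×ˢ ball x₀ 1, |Q z| * ‖v z‖ ^ 2 ≤
          ∫ z in Ioo (1 / 2 : ℝ) 1 ×ˢ ball x₀ 1, M * ‖v z‖ ^ 2 :=
        setIntegral_mono_on hQai.integrableOn (hvI.const_mul M) hmeas fun z _ =>
          mul_le_mul_of_nonneg_right ((hKb z).1) (sq_nonneg _)
      have h4 : ∫ z in Ioo (1 / 2 : ℝ) 1 ×ˢ ball x₀ 1, M * ‖v z‖ ^ 2 = M * I :=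
        integral_const_mul _ _
      linarith
    -- the positive part near the pole
    have hPb : (w₀ - γ) * (1 - γ) ≤ ∫ z, P z * ‖v z‖ ^ 2 := by
      set S := Icc (1 / 2 : ℝ) (1 / 2 + δ) ×ˢ ball x₀ r with hS
      have hSm : MeasurableSet S := measurableSet_Icc.prod measurableSet_ball
      have h1 : ∫ z in S, P z * ‖v z‖ ^ 2 ≤ ∫ z, P z * ‖v z‖ ^ 2 :=
        setIntegral_le_integral hPi (Eventually.of_forall fun z =>
          mul_nonneg (heatTestPos_nonneg hδ0 hδ0 z) (sq_nonneg _))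
      set g : ℝ × E → ℝ := fun z => deriv (rise δ) z.1 * heatKernel (z.1 - 1 / 2 + δ) (x₀ - z.2)
        with hg
      have hgc : ContinuousOn g (Icc (1 / 2 : ℝ) (1 / 2 + δ) ×ˢ closedBall x₀ r) := by
        refine ((((contDiff_rise (m := 1) δ).continuous_deriv le_rfl).comp
          continuous_fst).continuousOn).mul ((continuousOn_heatKernel_comp x₀).mono ?_)
        rintro z ⟨⟨hz1, -⟩, -⟩
        show 1 / 2 - δ < z.1
        linarith
      have hgi : IntegrableOn g S :=
        (hgc.integrableOn_compact (isCompact_Icc.prod (isCompact_closedBall _ _))).mono_set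
          (prod_mono Subset.rfl ball_subset_closedBall)
      have h2 : ∫ z in S, (w₀ - γ) * g z ≤ ∫ z in S, P z * ‖v z‖ ^ 2 := by
        refine setIntegral_mono_on (hgi.const_mul _) hPi.integrableOn hSm fun z hz => ?_
        obtain ⟨ht, hx⟩ := hz
        have hxn : ‖x₀ - z.2‖ ≤ 1 / 2 := by
          have hx' := mem_ball.1 hx
          rw [dist_eq_norm, ← norm_sub_rev] at hx'
          linarith
        have hgP : g z ≤ P z := by
          have := deriv_rise_mul_heatKernel_le_heatTestPos hC₀0 hδ0 hδ0 ht.1 hxn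
          simpa only [hg, hP] using this
        have hvz : w₀ - γ ≤ ‖v z‖ ^ 2 := (hlow z ⟨ht.1, ht.2.trans (by linarith)⟩ hx).le
        calc (w₀ - γ) * g z ≤ (w₀ - γ) * P z := mul_le_mul_of_nonneg_left hgP (by linarith)
          _ ≤ ‖v z‖ ^ 2 * P z := mul_le_mul_of_nonneg_right hvz (heatTestPos_nonneg hδ0 hδ0 z)
          _ = P z * ‖v z‖ ^ 2 := mul_comm _ _
      have h3 : (w₀ - γ) * (1 - γ) ≤ ∫ z in S, (w₀ - γ) * g z := by
        rw [integral_const_mul]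
        refine mul_le_mul_of_nonneg_left ?_ (by linarith)
        calc 1 - γ ≤ 1 - 2 ^ ((Module.finrank ℝ E : ℝ) / 2) * Real.exp (-r ^ 2 / (8 * (δ + δ))) := by
              linarith
          _ ≤ ∫ z in S, g z := integral_deriv_rise_mul_heatKernel_ge hδ0 hδ0 hr0 x₀
      linarith
    linarith
  -- `γ → 0`
  have hfin : w₀ ≤ M * I := by
    have ht : Tendsto (fun γ : ℝ => (w₀ - γ) * (1 - γ)) (𝓝[>] 0) (𝓝 ((w₀ - 0) * (1 - 0))) :=
      (((continuous_const.sub continuous_id).mul (continuous_const.sub continuous_id)).tendsto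
        0).mono_left nhdsWithin_le_nhds
    rw [sub_zero, sub_zero, mul_one] at ht
    refine le_of_tendsto ht ?_
    filter_upwards [Ioo_mem_nhdsGT one_pos] with γ hγ
    exact key γ hγ.1 hγ.2
  nlinarith


/-! ### The discharge -/


end EstimateC12

end Carleman

end

/-! ## Part: UniqueContinuationC12 -/

section
open MeasureTheory Set Function Filter Metric InnerProductSpace Laplacian
open _root_.Topology
open scoped InnerProductSpace RealInnerProductSpace Nat

namespace Carleman

/-! ### Cut-off and rescaling lemmas in the class -/

section PointwiseC12

variable {E : Type*} [NormedAddCommGroup E] [InnerProductSpace ℝ E] [FiniteDimensional ℝ E]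
variable {F : Type*} [NormedAddCommGroup F] [InnerProductSpace ℝ F]
variable {U : Set (ℝ × E)} {Φ : ℝ × E → ℝ} {u : ℝ × E → F}

/-- **(A.2.7) squared** (Seregin 2014, proof of Lemma A.1): if `u ∈ C¹(U)` with every `∂ₑu ∈ C¹(U)`, `Φ ∈ C²`,
`z ∈ U` and `|∂ₛu + Δu| ≤ c(|u| + |∇u|)` at `z` (`c ≥ 0`), then
`|∂ₛ(Φu) + Δ(Φu)|²(z) ≤ 4c²Φ²(|u|² + |∇u|²) + 4|∂ₛΦ + ΔΦ|²|u|² + 16|∇Φ|²|∇u|²`. [cite: Seregin2014, App. A.2 (A.2.7)] -/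
theorem norm_sq_dt_add_lap_cutoff_smul_le_c12 (hU : IsOpen U) (hΦ : ContDiff ℝ 2 Φ)
    (hu : ContDiffOn ℝ 1 u U) (hux : ∀ e : E, ContDiffOn ℝ 1 (dx e u) U) {z : ℝ × E} (hz : z ∈ U) {c : ℝ} (hc : 0 ≤ c)
    (hineq : ‖dt u z + lap u z‖ ≤ c * (‖u z‖ + Real.sqrt (gradSq u z))) :
    ‖dt (fun y => Φ y • u y) z + lap (fun y => Φ y • u y) z‖ ^ 2 ≤
      4 * c ^ 2 * Φ z ^ 2 * (‖u z‖ ^ 2 + gradSq u z) + 4 * (dt Φ z + lap Φ z) ^ 2 * ‖u z‖ ^ 2 +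
        16 * (gradSq Φ z * gradSq u z) := by
  set b := stdOrthonormalBasis ℝ E with hb
  rw [dt_add_lap_smul_apply_c12 hU hΦ hu hux hz]
  set A : F := Φ z • (dt u z + lap u z) with hA
  set B : F := (dt Φ z + lap Φ z) • u z with hB
  set S : F := ∑ i, dx (b i) Φ z • dx (b i) u z with hS
  have hg : 0 ≤ gradSq u z := gradSq_nonneg _ _
  have hsq : Real.sqrt (gradSq u z) ^ 2 = gradSq u z := Real.sq_sqrt hg
  -- the three pieces
  have hA2 : ‖A‖ ^ 2 ≤ 2 * c ^ 2 * Φ z ^ 2 * (‖u z‖ ^ 2 + gradSq u z) := by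
    have h1 : ‖A‖ = |Φ z| * ‖dt u z + lap u z‖ := by rw [hA, norm_smul, Real.norm_eq_abs]
    have h2 : ‖A‖ ≤ |Φ z| * (c * (‖u z‖ + Real.sqrt (gradSq u z))) := by
      rw [h1]; exact mul_le_mul_of_nonneg_left hineq (abs_nonneg _)
    have h3 : 0 ≤ |Φ z| * (c * (‖u z‖ + Real.sqrt (gradSq u z))) := by positivity
    have h4 := pow_le_pow_left₀ (norm_nonneg _) h2 2
    have h5 : (‖u z‖ + Real.sqrt (gradSq u z)) ^ 2 ≤ 2 * (‖u z‖ ^ 2 + gradSq u z) := by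
      nlinarith [sq_nonneg (‖u z‖ - Real.sqrt (gradSq u z))]
    calc ‖A‖ ^ 2 ≤ (|Φ z| * (c * (‖u z‖ + Real.sqrt (gradSq u z)))) ^ 2 := h4
      _ = c ^ 2 * Φ z ^ 2 * (‖u z‖ + Real.sqrt (gradSq u z)) ^ 2 := by
          rw [mul_pow, mul_pow, sq_abs]; ring
      _ ≤ c ^ 2 * Φ z ^ 2 * (2 * (‖u z‖ ^ 2 + gradSq u z)) := by gcongr
      _ = 2 * c ^ 2 * Φ z ^ 2 * (‖u z‖ ^ 2 + gradSq u z) := by ring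
  have hB2 : ‖B‖ ^ 2 = (dt Φ z + lap Φ z) ^ 2 * ‖u z‖ ^ 2 := by
    rw [hB, norm_smul, Real.norm_eq_abs, mul_pow, sq_abs]
  have hS2 : ‖(2 : ℝ) • S‖ ^ 2 ≤ 4 * (gradSq Φ z * gradSq u z) := by
    rw [norm_smul, mul_pow, Real.norm_eq_abs, abs_of_pos two_pos]
    have h := norm_sum_dx_smul_dx_sq_le (Φ := Φ) (u := u) z
    norm_num
    linarith
  -- `‖A + B + 2S‖² ≤ 2‖A‖² + 4‖B‖² + 4‖2S‖²`
  have htri : ‖A + B + (2 : ℝ) • S‖ ^ 2 ≤ 2 * ‖A‖ ^ 2 + 4 * ‖B‖ ^ 2 + 4 * ‖(2 : ℝ) • S‖ ^ 2 := by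
    have h1 : ‖A + B + (2 : ℝ) • S‖ ≤ ‖A‖ + ‖B‖ + ‖(2 : ℝ) • S‖ := norm_add₃_le
    have h2 := pow_le_pow_left₀ (norm_nonneg _) h1 2
    nlinarith [sq_nonneg (‖A‖ - ‖B‖ - ‖(2 : ℝ) • S‖), sq_nonneg (‖B‖ - ‖(2 : ℝ) • S‖),
      norm_nonneg A, norm_nonneg B, norm_nonneg ((2 : ℝ) • S)]
  calc ‖A + B + (2 : ℝ) • S‖ ^ 2 ≤ 2 * ‖A‖ ^ 2 + 4 * ‖B‖ ^ 2 + 4 * ‖(2 : ℝ) • S‖ ^ 2 := htri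
    _ ≤ 2 * (2 * c ^ 2 * Φ z ^ 2 * (‖u z‖ ^ 2 + gradSq u z)) +
          4 * ((dt Φ z + lap Φ z) ^ 2 * ‖u z‖ ^ 2) + 4 * (4 * (gradSq Φ z * gradSq u z)) := by
        rw [hB2]; gcongr
    _ = _ := by ring


end PointwiseC12

section DilationC12

variable {E : Type*} [NormedAddCommGroup E] [InnerProductSpace ℝ E]
variable {F : Type*} [NormedAddCommGroup F] [InnerProductSpace ℝ F]
variable {V : ℝ × E → F} {lam : ℝ} {x₁ : E}

/-- `∂ₑ∂ₑ'(U ∘ A)(w) = λ² ∂ₑ∂ₑ'U(Aw)` for `U` of the class `C¹ ∩ {∂ₓU ∈ C¹}` on an open set containing `Aw`.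
[cite: Seregin2014, App. A.2 (A.2.5)] -/
theorem dx_dx_comp_parabolicDilation_c12 {O : Set (ℝ × E)} (hO : IsOpen O) (hV : ContDiffOn ℝ 1 V O)
    (hVx : ∀ e : E, ContDiffOn ℝ 1 (dx e V) O)
    {w : ℝ × E} (hw : (lam ^ 2 * w.1, x₁ + lam • w.2) ∈ O) (e e' : E) :
    dx e (dx e' (fun w : ℝ × E => V (lam ^ 2 * w.1, x₁ + lam • w.2))) w =
      lam ^ 2 • dx e (dx e' V) (lam ^ 2 * w.1, x₁ + lam • w.2) := by
  have hpre : IsOpen ((fun w : ℝ × E => (lam ^ 2 * w.1, x₁ + lam • w.2)) ⁻¹' O) :=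
    hO.preimage (continuous_parabolicDilation lam x₁)
  have hVd : ∀ z ∈ O, DifferentiableAt ℝ V z := fun z hz =>
    (hV.differentiableOn one_ne_zero).differentiableAt (hO.mem_nhds hz)
  have hev : dx e' (fun w : ℝ × E => V (lam ^ 2 * w.1, x₁ + lam • w.2)) =ᶠ[𝓝 w]
      fun w' : ℝ × E => lam • dx e' V (lam ^ 2 * w'.1, x₁ + lam • w'.2) := by
    filter_upwards [hpre.mem_nhds hw] with w' hw'
    exact dx_comp_parabolicDilation (hVd _ hw') e'
  rw [dx_apply, hev.fderiv_eq]
  have hd1 : DifferentiableAt ℝ (dx e' V) (lam ^ 2 * w.1, x₁ + lam • w.2) :=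
    differentiableAt_dx_c12 hO hVx e' hw
  have hd2 : DifferentiableAt ℝ
      (fun w' : ℝ × E => dx e' V (lam ^ 2 * w'.1, x₁ + lam • w'.2)) w :=
    DifferentiableAt.comp (g := dx e' V) w hd1
      (hasFDerivAt_parabolicDilation lam x₁ w).differentiableAt
  rw [fderiv_fun_const_smul hd2 lam, FunLike.coe_smul, Pi.smul_apply, ← dx_apply,
    dx_comp_parabolicDilation hd1 e, smul_smul, ← sq]

/-- `Δₓ(U ∘ A)(w) = λ² ΔₓU(Aw)` for `U ∈ C²` near `Aw`. [cite: Seregin2014, App. A.2 (A.2.5)] -/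
theorem lap_comp_parabolicDilation_c12 [FiniteDimensional ℝ E] {O : Set (ℝ × E)} (hO : IsOpen O)
    (hV : ContDiffOn ℝ 1 V O) (hVx : ∀ e : E, ContDiffOn ℝ 1 (dx e V) O) {w : ℝ × E} (hw : (lam ^ 2 * w.1, x₁ + lam • w.2) ∈ O) :
    lap (fun w : ℝ × E => V (lam ^ 2 * w.1, x₁ + lam • w.2)) w =
      lam ^ 2 • lap V (lam ^ 2 * w.1, x₁ + lam • w.2) := by
  simp only [lap, dx_dx_comp_parabolicDilation_c12 hO hV hVx hw, Finset.smul_sum]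

/-- `∂ₑ(U ∘ A)` is `C¹` on the preimage of an open set on which `U ∈ C¹` and `∂ₑU ∈ C¹`
(`∂ₑ(U ∘ A) = λ (∂ₑU) ∘ A` there). [folklore] -/
theorem contDiffOn_one_dx_comp_parabolicDilation_c12 {O : Set (ℝ × E)} (hO : IsOpen O)
    (hV : ContDiffOn ℝ 1 V O) (hVx : ∀ e : E, ContDiffOn ℝ 1 (dx e V) O) (e : E) :
    ContDiffOn ℝ 1 (dx e fun w : ℝ × E => V (lam ^ 2 * w.1, x₁ + lam • w.2))
      ((fun w : ℝ × E => (lam ^ 2 * w.1, x₁ + lam • w.2)) ⁻¹' O) := by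
  have h : ContDiffOn ℝ 1 (fun w : ℝ × E => lam • dx e V (lam ^ 2 * w.1, x₁ + lam • w.2))
      ((fun w : ℝ × E => (lam ^ 2 * w.1, x₁ + lam • w.2)) ⁻¹' O) :=
    contDiffOn_const.smul ((hVx e).comp (contDiff_parabolicDilation lam x₁).contDiffOn
      (mapsTo_preimage _ _))
  refine h.congr fun w hw => ?_
  have hVd : DifferentiableAt ℝ V (lam ^ 2 * w.1, x₁ + lam • w.2) :=
    (hV.differentiableOn one_ne_zero).differentiableAt (hO.mem_nhds hw)
  exact dx_comp_parabolicDilation hVd e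

/-- **Scaling of the backward heat inequality** (Seregin 2014, (A.2.5)): if
`|∂ₜU + ΔU| ≤ c (|U| + |∇U|)` at `Aw` (`c ≥ 0`, `U ∈ C²` near `Aw`) and `0 < λ ≤ 1`, then
`v = U ∘ A` satisfies `|∂ₛv + Δv| ≤ cλ (|v| + |∇v|)` at `w`. [cite: Seregin2014, App. A.2 (A.2.5)] -/
theorem norm_dt_add_lap_comp_parabolicDilation_le_c12 [FiniteDimensional ℝ E] {O : Set (ℝ × E)}
    (hO : IsOpen O) (hV : ContDiffOn ℝ 1 V O) (hVx : ∀ e : E, ContDiffOn ℝ 1 (dx e V) O) {c : ℝ} (hc : 0 ≤ c) (hlam : 0 < lam)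
    (hlam1 : lam ≤ 1) {w : ℝ × E} (hw : (lam ^ 2 * w.1, x₁ + lam • w.2) ∈ O)
    (hineq : ‖dt V (lam ^ 2 * w.1, x₁ + lam • w.2) + lap V (lam ^ 2 * w.1, x₁ + lam • w.2)‖ ≤
      c * (‖V (lam ^ 2 * w.1, x₁ + lam • w.2)‖ +
        Real.sqrt (gradSq V (lam ^ 2 * w.1, x₁ + lam • w.2)))) :
    ‖dt (fun w : ℝ × E => V (lam ^ 2 * w.1, x₁ + lam • w.2)) w +
        lap (fun w : ℝ × E => V (lam ^ 2 * w.1, x₁ + lam • w.2)) w‖ ≤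
      c * lam * (‖V (lam ^ 2 * w.1, x₁ + lam • w.2)‖ +
        Real.sqrt (gradSq (fun w : ℝ × E => V (lam ^ 2 * w.1, x₁ + lam • w.2)) w)) := by
  have hVd : DifferentiableAt ℝ V (lam ^ 2 * w.1, x₁ + lam • w.2) :=
    (hV.differentiableOn one_ne_zero).differentiableAt (hO.mem_nhds hw)
  set z : ℝ × E := (lam ^ 2 * w.1, x₁ + lam • w.2) with hz
  rw [dt_comp_parabolicDilation hVd, lap_comp_parabolicDilation_c12 hO hV hVx hw,
    gradSq_comp_parabolicDilation hVd, ← smul_add, norm_smul, Real.norm_of_nonneg (sq_nonneg _),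
    Real.sqrt_mul (sq_nonneg _), Real.sqrt_sq hlam.le]
  have hg : 0 ≤ Real.sqrt (gradSq V z) := Real.sqrt_nonneg _
  have hVn : 0 ≤ ‖V z‖ := norm_nonneg _
  have hlam2 : lam ^ 2 ≤ lam := by nlinarith
  calc lam ^ 2 * ‖dt V z + lap V z‖ ≤ lam ^ 2 * (c * (‖V z‖ + Real.sqrt (gradSq V z))) := by
        gcongr
    _ = c * (lam ^ 2 * ‖V z‖) + c * lam * (lam * Real.sqrt (gradSq V z)) := by ring
    _ ≤ c * (lam * ‖V z‖) + c * lam * (lam * Real.sqrt (gradSq V z)) := by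
        gcongr
    _ = c * lam * (‖V z‖ + lam * Real.sqrt (gradSq V z)) := by ring


end DilationC12

/-! ### The Carleman step and the decay estimate (Seregin 2014, Lemma A.1) in the class -/

section CarlemanC12

variable {E : Type*} [NormedAddCommGroup E] [InnerProductSpace ℝ E] [FiniteDimensional ℝ E]
  [MeasurableSpace E] [BorelSpace E]
variable {F : Type*} [NormedAddCommGroup F] [InnerProductSpace ℝ F] [CompleteSpace F]

set_option maxHeartbeats 1600000 in
/-- **Lemma A.1, the Carleman step for fixed `ε`** (Seregin 2014, (A.2.8)–(A.2.11) and
(A.2.16)). Let `v ∈ C¹(O)` with every `∂ₑv ∈ C¹(O)`, `O ⊇ ]0, 7/4] × B̄(0, ρ)` (`ρ ≥ 4`), satisfy on this cylinder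
`|∂ₛv + Δv| ≤ δ(|v| + |∇v|)` with `16 c₀ δ² ≤ 1` (`c₀ = 11e^{4/3}` the constant of the first
Carleman inequality), `|v| ≤ A`, `|∇v|² ≤ A²`; let `a ≥ 2`, and suppose the Carleman weight
`W = h^{-2a}(s) e^{-|y|²/4s}` satisfies `W ≤ ω` on the part of the cylinder where `s ≥ 3/2` or
`|y| ≥ ρ/2`, and `W |v|² ≤ Λ s²` where `s ≤ 1/2`. Then for `0 < ε ≤ 1/4` and `|y₀| + 1 ≤ ρ/2`,
`∫_{]1/2,1[ × B(y₀,1)} W |v|² ≤ 2 |B̄(0,ρ)| ((7/4)(C + 16c₀C² + 16c₀C) A² ω +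
ε (4(C + 16c₀C²) Λ + 16 c₀ C A² ω))`, `C` the constant of the cut-off family
(apply (A.1.1) to `w = η_{ρ,ε} v`, bound `|∂ₛw + Δw|²` by (A.2.7)², absorb the `δ`-terms, and
estimate the error terms on the layer `[ε, 2ε]` and on the cut-off region separately). [cite: Seregin2014, App. A.2 (A.2.8)–(A.2.11)] -/
theorem carleman_step_c12 {v : ℝ × E → F} {O : Set (ℝ × E)} {ρ δ A a ω Λ C ε : ℝ} {y₀ : E}
    (hO : IsOpen O) (hρ : 4 ≤ ρ) (hδ : 0 ≤ δ)
    (hδc : 16 * (11 * Real.exp (4 / 3)) * δ ^ 2 ≤ 1) (ha : 2 ≤ a) (hω : 0 ≤ ω)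
    (hΛ : 0 ≤ Λ) (hC : 1 ≤ C) (hε : 0 < ε) (hε4 : ε ≤ 1 / 4) (hy₀ : ‖y₀‖ + 1 ≤ ρ / 2)
    (hcut : ∀ (ρ' ε' : ℝ), 1 ≤ ρ' → 0 < ε' → ε' ≤ 1 →
      ∃ η : ℝ × E → ℝ, ContDiff ℝ 2 η ∧ HasCompactSupport η ∧
        tsupport η ⊆ Icc ε' (7 / 4) ×ˢ closedBall (0 : E) ρ' ∧
        EqOn η (fun _ => 1) (Ioo (2 * ε') (3 / 2) ×ˢ ball (0 : E) (ρ' / 2)) ∧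
        (∀ z, gradSq η z ≤ C ∧ |lap η z| ≤ C ∧ |dt η z| ≤ C / ε') ∧
        (∀ z : ℝ × E, 2 * ε' ≤ z.1 → |dt η z| ≤ C) ∧
        (∀ z : ℝ × E, ‖z.2‖ < ρ' / 2 → gradSq η z = 0))
    (hsub : Ioc (0 : ℝ) (7 / 4) ×ˢ closedBall (0 : E) ρ ⊆ O) (hv : ContDiffOn ℝ 1 v O)
    (hvx : ∀ e : E, ContDiffOn ℝ 1 (dx e v) O)
    (hineq : ∀ z ∈ Ioc (0 : ℝ) (7 / 4) ×ˢ closedBall (0 : E) ρ,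
      ‖dt v z + lap v z‖ ≤ δ * (‖v z‖ + Real.sqrt (gradSq v z)))
    (hvA : ∀ z ∈ Ioc (0 : ℝ) (7 / 4) ×ˢ closedBall (0 : E) ρ, ‖v z‖ ≤ A)
    (hgA : ∀ z ∈ Ioc (0 : ℝ) (7 / 4) ×ˢ closedBall (0 : E) ρ, gradSq v z ≤ A ^ 2)
    (hWω : ∀ z ∈ Ioc (0 : ℝ) (7 / 4) ×ˢ closedBall (0 : E) ρ,
      (3 / 2 ≤ z.1 ∨ ρ / 2 ≤ ‖z.2‖) → carlemanWeight a z ≤ ω)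
    (hWΛ : ∀ z ∈ Ioc (0 : ℝ) (7 / 4) ×ˢ closedBall (0 : E) ρ, z.1 ≤ 1 / 2 →
      carlemanWeight a z * ‖v z‖ ^ 2 ≤ Λ * z.1 ^ 2) :
    ∫ z in Ioo (1 / 2 : ℝ) 1 ×ˢ ball y₀ 1, carlemanWeight a z * ‖v z‖ ^ 2 ≤
      2 * ((volume (closedBall (0 : E) ρ)).toReal *
        (7 / 4 * ((C + 16 * (11 * Real.exp (4 / 3)) * C ^ 2 + 16 * (11 * Real.exp (4 / 3)) * C) *
            A ^ 2 * ω) +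
          ε * (4 * (C + 16 * (11 * Real.exp (4 / 3)) * C ^ 2) * Λ +
            16 * (11 * Real.exp (4 / 3)) * C * A ^ 2 * ω))) := by
  set c₀ : ℝ := 11 * Real.exp (4 / 3) with hc₀
  have hc₀0 : 0 < c₀ := by positivity
  have hC0 : 0 ≤ C := zero_le_one.trans hC
  have hρ1 : 1 ≤ ρ := by linarith
  have hρ0 : 0 < ρ := by linarith
  have hε1 : ε ≤ 1 := by linarith
  set b := stdOrthonormalBasis ℝ E with hb
  -- ## the sets
  set Cyl : Set (ℝ × E) := Ioc (0 : ℝ) (7 / 4) ×ˢ closedBall (0 : E) ρ with hCyl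
  set K : Set (ℝ × E) := Icc ε (7 / 4) ×ˢ closedBall (0 : E) ρ with hK
  set K₁ : Set (ℝ × E) := Icc ε (2 * ε) ×ˢ closedBall (0 : E) ρ with hK₁
  set K₂ : Set (ℝ × E) := Ioc (2 * ε) (7 / 4) ×ˢ closedBall (0 : E) ρ with hK₂
  set Bx : Set (ℝ × E) := Ioo (2 * ε) (3 / 2) ×ˢ ball (0 : E) (ρ / 2) with hBx
  set Q : Set (ℝ × E) := Ioo (1 / 2 : ℝ) 1 ×ˢ ball y₀ 1 with hQ
  have hKCyl : K ⊆ Cyl := prod_mono (fun s hs => ⟨by linarith [hs.1], hs.2⟩) subset_rfl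
  have hKO : K ⊆ O := hKCyl.trans hsub
  have hKc : IsCompact K := isCompact_Icc.prod (isCompact_closedBall _ _)
  have hKm : MeasurableSet K := measurableSet_Icc.prod measurableSet_closedBall
  have hK₁m : MeasurableSet K₁ := measurableSet_Icc.prod measurableSet_closedBall
  have hK₂m : MeasurableSet K₂ := measurableSet_Ioc.prod measurableSet_closedBall
  have hQm : MeasurableSet Q := measurableSet_Ioo.prod measurableSet_ball
  have hK₁K : K₁ ⊆ K := prod_mono (Icc_subset_Icc le_rfl (by linarith)) subset_rfl
  have hK₂K : K₂ ⊆ K := prod_mono (fun s hs => ⟨by linarith [hs.1], hs.2⟩) subset_rfl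
  have hKsplit : K = K₁ ∪ K₂ := by
    rw [hK, hK₁, hK₂, ← union_prod, Icc_union_Ioc_eq_Icc (by linarith) (by linarith)]
  have hKdisj : Disjoint K₁ K₂ := by
    rw [hK₁, hK₂, disjoint_left]
    rintro z ⟨⟨-, h1⟩, -⟩ ⟨⟨h2, -⟩, -⟩
    linarith
  have hBxo : IsOpen Bx := isOpen_Ioo.prod isOpen_ball
  have hQBx : Q ⊆ Bx := by
    refine prod_mono (fun s hs => ⟨by linarith [hs.1], by linarith [hs.2]⟩) fun y hy => ?_
    rw [mem_ball, dist_zero_right]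
    rw [mem_ball, dist_eq_norm] at hy
    have : ‖y‖ ≤ ‖y - y₀‖ + ‖y₀‖ := norm_le_norm_sub_add y y₀
    linarith
  have hBxK : Bx ⊆ K := by
    refine prod_mono (fun s hs => ⟨by linarith [hs.1], by linarith [hs.2]⟩) fun y hy => ?_
    rw [mem_ball, dist_zero_right] at hy
    rw [mem_closedBall, dist_zero_right]
    linarith
  have hQK : Q ⊆ K := hQBx.trans hBxK
  -- ## the cut-off and `w = η v`
  obtain ⟨η, hηs, hηc, hηsupp, hη1, hηb, hηdt, hηg0⟩ := hcut ρ ε hρ1 hε hε1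
  have hηK : tsupport η ⊆ K := hηsupp
  have hηO : tsupport η ⊆ O := hηK.trans hKO
  have hη1s : ContDiff ℝ 1 η := hηs.of_le (by norm_num)
  have hvd : DifferentiableOn ℝ v O := hv.differentiableOn one_ne_zero
  set w : ℝ × E → F := fun z => η z • v z with hw
  have hws : ContDiff ℝ 1 w := contDiff_one_cutoff_smul_c12 hO hηs hηO hv
  have hwsx : ∀ e : E, ContDiff ℝ 1 (dx e w) := fun e =>
    contDiff_one_dx_cutoff_smul_c12 hO hηs hηO hv hvx e
  have hwc : HasCompactSupport w := hasCompactSupport_cutoff_smul hηc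
  have hwsupp : tsupport w ⊆ Ioo (0 : ℝ) 2 ×ˢ (univ : Set E) :=
    ((tsupport_smul_subset_left η v).trans hηK).trans
      (prod_mono (fun s hs => ⟨by linarith [hs.1], by linarith [hs.2]⟩) (subset_univ _))
  have ha0 : 0 < a := by linarith
  -- ## the Carleman inequality for `w`
  have hcarl := carleman_inequality_first_of_c12 ha0 hws hwsx hwc hwsupp
  rw [← hc₀] at hcarl
  -- ## vanishing off `K`
  have hw0 : EqOn w (fun _ => (0 : F)) (tsupport η)ᶜ := fun z hz => by
    show η z • v z = 0
    rw [image_eq_zero_of_notMem_tsupport hz, zero_smul]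
  have hoff : ∀ z, z ∉ K → w z = 0 ∧ dt w z = 0 ∧ lap w z = 0 ∧ gradSq w z = 0 := by
    intro z hz
    have hz' : z ∈ (tsupport η)ᶜ := fun h => hz (hηK h)
    exact ⟨hw0 hz', dt_lap_gradSq_eq_zero_of_eqOn_const (isClosed_tsupport η).isOpen_compl hw0 hz'⟩
  -- ## the integrands
  set W : ℝ × E → ℝ := carlemanWeight a with hWdef
  set fL : ℝ × E → ℝ := fun z => W z * (a / z.1 * ‖w z‖ ^ 2 + gradSq w z) with hfL
  set fR : ℝ × E → ℝ := fun z => W z * ‖dt w z + lap w z‖ ^ 2 with hfR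
  set Gd : ℝ × E → ℝ := fun z => W z * (η z ^ 2 * ‖v z‖ ^ 2 + η z ^ 2 * gradSq v z / 2)
    with hGd
  set Bd : ℝ × E → ℝ := fun z => W z * (gradSq η z * ‖v z‖ ^ 2) with hBd
  set R : ℝ × E → ℝ := fun z => W z * ((gradSq η z + 4 * c₀ * (dt η z + lap η z) ^ 2) *
    ‖v z‖ ^ 2 + 16 * c₀ * (gradSq η z * gradSq v z)) with hR
  have hfL0 : ∀ z, z ∉ K → fL z = 0 := fun z hz => by
    obtain ⟨h1, -, -, h4⟩ := hoff z hz
    show W z * (a / z.1 * ‖w z‖ ^ 2 + gradSq w z) = 0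
    rw [h1, h4, norm_zero, zero_pow two_ne_zero, mul_zero, zero_add, mul_zero]
  have hfR0 : ∀ z, z ∉ K → fR z = 0 := fun z hz => by
    obtain ⟨-, h2, h3, -⟩ := hoff z hz
    show W z * ‖dt w z + lap w z‖ ^ 2 = 0
    rw [h2, h3, add_zero, norm_zero, zero_pow two_ne_zero, mul_zero]
  -- ## positivity on `K`
  have hKpos : ∀ z ∈ K, 0 < z.1 := fun z hz => lt_of_lt_of_le hε hz.1.1
  have hW0 : ∀ z ∈ K, 0 ≤ W z := fun z hz => carlemanWeight_nonneg a (hKpos z hz)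
  -- ## pointwise inequalities on `K`
  have hnw : ∀ z, ‖w z‖ ^ 2 = η z ^ 2 * ‖v z‖ ^ 2 := fun z => by
    rw [hw]; dsimp only; rw [norm_smul, Real.norm_eq_abs, mul_pow, sq_abs]
  have hlow : ∀ z ∈ K, Gd z - Bd z ≤ fL z := by
    intro z hz
    have hg := sq_mul_gradSq_div_two_sub_le hO hη1s hηO hvd z
    have h1 : 1 ≤ a / z.1 := by
      rw [le_div_iff₀ (hKpos z hz)]; linarith [hz.1.2]
    have h2 : ‖w z‖ ^ 2 ≤ a / z.1 * ‖w z‖ ^ 2 := le_mul_of_one_le_left (sq_nonneg _) h1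
    have h3 : Gd z - Bd z = W z * (‖w z‖ ^ 2 + (η z ^ 2 * gradSq v z / 2 - gradSq η z * ‖v z‖ ^ 2)) := by
      simp only [hGd, hBd, hnw]; ring
    rw [h3, hfL]
    exact mul_le_mul_of_nonneg_left (add_le_add h2 hg) (hW0 z hz)
  have hup : ∀ z ∈ K, c₀ * fR z ≤ Gd z / 2 + (R z - Bd z) := by
    intro z hz
    have hzO : z ∈ O := hKO hz
    have hP := norm_sq_dt_add_lap_cutoff_smul_le_c12 hO hηs hv hvx hzO hδ (hineq z (hKCyl hz))
    have hWz := hW0 z hz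
    have hgv : 0 ≤ gradSq v z := gradSq_nonneg _ _
    have hgη : 0 ≤ gradSq η z := gradSq_nonneg _ _
    have hδ' : 4 * c₀ * δ ^ 2 ≤ 1 / 4 := by rw [hc₀]; linarith
    -- `c₀ W |Pw|² ≤ c₀ W (4δ²η²(|v|²+g) + 4(Pη)²|v|² + 16 gη g)`
    have h1 : c₀ * fR z ≤ c₀ * (W z * (4 * δ ^ 2 * η z ^ 2 * (‖v z‖ ^ 2 + gradSq v z) +
        4 * (dt η z + lap η z) ^ 2 * ‖v z‖ ^ 2 + 16 * (gradSq η z * gradSq v z))) := by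
      rw [hfR]
      exact mul_le_mul_of_nonneg_left (mul_le_mul_of_nonneg_left hP hWz) hc₀0.le
    have h2 : c₀ * (W z * (4 * δ ^ 2 * η z ^ 2 * (‖v z‖ ^ 2 + gradSq v z))) ≤
        W z * (η z ^ 2 * (‖v z‖ ^ 2 + gradSq v z)) / 4 := by
      have hX : 0 ≤ W z * (η z ^ 2 * (‖v z‖ ^ 2 + gradSq v z)) := by positivity
      calc c₀ * (W z * (4 * δ ^ 2 * η z ^ 2 * (‖v z‖ ^ 2 + gradSq v z)))
          = 4 * c₀ * δ ^ 2 * (W z * (η z ^ 2 * (‖v z‖ ^ 2 + gradSq v z))) := by ring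
        _ ≤ 1 / 4 * (W z * (η z ^ 2 * (‖v z‖ ^ 2 + gradSq v z))) :=
            mul_le_mul_of_nonneg_right hδ' hX
        _ = _ := by ring
    have h3 : W z * (η z ^ 2 * (‖v z‖ ^ 2 + gradSq v z)) / 4 ≤ Gd z / 2 := by
      have h0 : 0 ≤ W z * (η z ^ 2 * ‖v z‖ ^ 2) := by positivity
      have e : Gd z / 2 - W z * (η z ^ 2 * (‖v z‖ ^ 2 + gradSq v z)) / 4 =
          W z * (η z ^ 2 * ‖v z‖ ^ 2) / 4 := by
        simp only [hGd]; ring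
      linarith
    have h4 : c₀ * (W z * (4 * (dt η z + lap η z) ^ 2 * ‖v z‖ ^ 2 +
        16 * (gradSq η z * gradSq v z))) = R z - Bd z := by
      simp only [hR, hBd]; ring
    calc c₀ * fR z ≤ _ := h1
      _ = c₀ * (W z * (4 * δ ^ 2 * η z ^ 2 * (‖v z‖ ^ 2 + gradSq v z))) +
            c₀ * (W z * (4 * (dt η z + lap η z) ^ 2 * ‖v z‖ ^ 2 +
              16 * (gradSq η z * gradSq v z))) := by ring
      _ ≤ Gd z / 2 + (R z - Bd z) := by rw [← h4]; linarith
  -- ## continuity and integrability on `K`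
  have hWc : ContinuousOn W K := (continuousOn_carlemanWeight a hε).mono fun z hz => by
    show ε / 2 < z.1; linarith [hz.1.1]
  obtain ⟨hvc, -, -, -⟩ := continuousOn_derivatives_c12 hO hv hvx
  obtain ⟨-, hgvc⟩ := continuousOn_lap_gradSq_c12 hO hv hvx
  obtain ⟨hηc0, hηdtc, -, -⟩ := continuousOn_derivatives isOpen_univ hηs.contDiffOn
  obtain ⟨hηlapc, hηgc⟩ := continuousOn_lap_gradSq isOpen_univ hηs.contDiffOn
  obtain ⟨hwc0, hwdtc, -, -⟩ := continuousOn_derivatives_c12 isOpen_univ hws.contDiffOn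
    fun e => (hwsx e).contDiffOn
  obtain ⟨hwlapc, hwgc⟩ := continuousOn_lap_gradSq_c12 isOpen_univ hws.contDiffOn
    fun e => (hwsx e).contDiffOn
  have cv : ContinuousOn (fun z => ‖v z‖ ^ 2) K := ((hvc.mono hKO).norm).pow 2
  have cg : ContinuousOn (gradSq v) K := hgvc.mono hKO
  have cη : ContinuousOn η K := hηc0.mono (subset_univ _)
  have cηdt : ContinuousOn (dt η) K := hηdtc.mono (subset_univ _)
  have cηlap : ContinuousOn (lap η) K := hηlapc.mono (subset_univ _)
  have cηg : ContinuousOn (gradSq η) K := hηgc.mono (subset_univ _)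
  have cw : ContinuousOn (fun z => ‖w z‖ ^ 2) K := ((hwc0.mono (subset_univ _)).norm).pow 2
  have cwg : ContinuousOn (gradSq w) K := hwgc.mono (subset_univ _)
  have cwP : ContinuousOn (fun z => ‖dt w z + lap w z‖ ^ 2) K :=
    (((hwdtc.mono (subset_univ _)).add (hwlapc.mono (subset_univ _))).norm).pow 2
  have cinv : ContinuousOn (fun z : ℝ × E => a / z.1) K :=
    continuousOn_const.div continuous_fst.continuousOn fun z hz => (hKpos z hz).ne'
  have iK : ∀ {f : ℝ × E → ℝ}, ContinuousOn f K → IntegrableOn f K volume := fun hf =>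
    hf.integrableOn_compact hKc
  have ifL : IntegrableOn fL K volume := iK (hWc.mul ((cinv.mul cw).add cwg))
  have ifR : IntegrableOn fR K volume := iK (hWc.mul cwP)
  have iGd : IntegrableOn Gd K volume :=
    iK (hWc.mul (((cη.pow 2).mul cv).add (((cη.pow 2).mul cg).div_const _)))
  have iBd : IntegrableOn Bd K volume := iK (hWc.mul (cηg.mul cv))
  have iR : IntegrableOn R K volume :=
    iK (hWc.mul (((cηg.add (continuousOn_const.mul ((cηdt.add cηlap).pow 2))).mul cv).add
      (continuousOn_const.mul (cηg.mul cg))))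
  -- ## `(1/2) ∫_K Gd ≤ ∫_K R`
  have hmain : (1 / 2) * ∫ z in K, Gd z ≤ ∫ z in K, R z := by
    have e1 : ∫ z in K, (Gd z - Bd z) ≤ ∫ z in K, fL z :=
      setIntegral_mono_on (iGd.sub iBd) ifL hKm hlow
    have e2 : ∫ z in K, fL z = ∫ z, fL z := setIntegral_eq_integral_of_forall_compl_eq_zero hfL0
    have e3 : ∫ z in K, fR z = ∫ z, fR z := setIntegral_eq_integral_of_forall_compl_eq_zero hfR0
    have e4 : ∫ z in K, c₀ * fR z ≤ ∫ z in K, (Gd z / 2 + (R z - Bd z)) :=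
      setIntegral_mono_on (ifR.const_mul c₀) ((iGd.div_const 2).add (iR.sub iBd)) hKm hup
    have e5 : ∫ z in K, c₀ * fR z = c₀ * ∫ z in K, fR z := integral_const_mul c₀ fR
    have e6 : ∫ z in K, (Gd z - Bd z) = (∫ z in K, Gd z) - ∫ z in K, Bd z := integral_sub iGd iBd
    have iRB : Integrable (fun z => R z - Bd z) (volume.restrict K) := iR.sub iBd
    have iG2 : Integrable (fun z => Gd z / 2) (volume.restrict K) := iGd.div_const 2
    have e7 : ∫ z in K, (Gd z / 2 + (R z - Bd z)) =
        (∫ z in K, Gd z / 2) + ((∫ z in K, R z) - ∫ z in K, Bd z) := by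
      rw [integral_add iG2 iRB, integral_sub iR iBd]
    have e8 : ∫ z in K, Gd z / 2 = (∫ z in K, Gd z) / 2 := by
      have := integral_div (2 : ℝ) Gd (μ := volume.restrict K)
      exact this
    have hch : ∫ z, fL z ≤ c₀ * ∫ z, fR z := hcarl
    rw [← e2, ← e3, ← e5] at hch
    linarith [e1.trans (hch.trans e4)]
  -- ## `∫_Q W |v|² ≤ ∫_K Gd`
  have hQle : ∫ z in Q, W z * ‖v z‖ ^ 2 ≤ ∫ z in K, Gd z := by
    have e1 : ∫ z in Q, W z * ‖v z‖ ^ 2 ≤ ∫ z in Q, Gd z := by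
      refine setIntegral_mono_on ((iK (hWc.mul cv)).mono_set hQK) (iGd.mono_set hQK) hQm
        fun z hz => ?_
      have h1 : η z = 1 := hη1 (hQBx hz)
      have h0 : 0 ≤ W z * (gradSq v z / 2) :=
        mul_nonneg (hW0 z (hQK hz)) (div_nonneg (gradSq_nonneg _ _) (by norm_num))
      have e : Gd z - W z * ‖v z‖ ^ 2 = W z * (gradSq v z / 2) := by
        simp only [hGd, h1]; ring
      linarith
    have e2 : ∫ z in Q, Gd z ≤ ∫ z in K, Gd z := by
      refine setIntegral_mono_set iGd ?_ (Eventually.of_forall hQK)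
      refine (ae_restrict_iff' hKm).2 (Eventually.of_forall fun z hz => ?_)
      simp only [hGd, Pi.zero_apply]
      have := hW0 z hz
      have : 0 ≤ gradSq v z := gradSq_nonneg _ _
      positivity
    exact e1.trans e2
  -- ## the error integral: `∫_K R ≤ |B̄ρ| (7/4 M₂ + ε M₁)`
  set Vρ : ℝ := (volume (closedBall (0 : E) ρ)).toReal with hVρ
  have hVρ0 : 0 ≤ Vρ := ENNReal.toReal_nonneg
  set M₂ : ℝ := (C + 16 * c₀ * C ^ 2 + 16 * c₀ * C) * A ^ 2 * ω with hM₂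
  set M₁ : ℝ := 4 * (C + 16 * c₀ * C ^ 2) * Λ + 16 * c₀ * C * A ^ 2 * ω with hM₁
  have hM₂0 : 0 ≤ M₂ := by positivity
  have hM₁0 : 0 ≤ M₁ := by positivity
  -- pointwise on `K₂`
  have hRK₂ : ∀ z ∈ K₂, R z ≤ M₂ := by
    intro z hz
    have hzK : z ∈ K := hK₂K hz
    have hzC : z ∈ Cyl := hKCyl hzK
    have hWz := hW0 z hzK
    by_cases hbx : z.1 < 3 / 2 ∧ ‖z.2‖ < ρ / 2
    · have hzBx : z ∈ Bx := ⟨⟨hz.1.1, hbx.1⟩, by rw [mem_ball, dist_zero_right]; exact hbx.2⟩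
      obtain ⟨h1, h2, h3⟩ := dt_lap_gradSq_eq_zero_of_eqOn_const hBxo hη1 hzBx
      simp only [hR, h1, h2, h3]
      norm_num
      exact hM₂0
    · have hWle : W z ≤ ω := hWω z hzC (by
        by_contra h
        push Not at h
        exact hbx ⟨h.1, h.2⟩)
      obtain ⟨hg1, hl1, -⟩ := hηb z
      have hd1 : |dt η z| ≤ C := hηdt z hz.1.1.le
      have hv1 : ‖v z‖ ^ 2 ≤ A ^ 2 := pow_le_pow_left₀ (norm_nonneg _) (hvA z hzC) 2
      have hgv1 : gradSq v z ≤ A ^ 2 := hgA z hzC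
      have hgv0 : 0 ≤ gradSq v z := gradSq_nonneg _ _
      have hgη0 : 0 ≤ gradSq η z := gradSq_nonneg _ _
      have hP : (dt η z + lap η z) ^ 2 ≤ 4 * C ^ 2 := by
        have h1 : |dt η z + lap η z| ≤ 2 * C :=
          (abs_add_le _ _).trans (by linarith [add_le_add hd1 hl1])
        calc (dt η z + lap η z) ^ 2 = |dt η z + lap η z| ^ 2 := (sq_abs _).symm
          _ ≤ (2 * C) ^ 2 := pow_le_pow_left₀ (abs_nonneg _) h1 2
          _ = 4 * C ^ 2 := by ring
      have hX : (gradSq η z + 4 * c₀ * (dt η z + lap η z) ^ 2) * ‖v z‖ ^ 2 +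
          16 * c₀ * (gradSq η z * gradSq v z) ≤
          (C + 16 * c₀ * C ^ 2 + 16 * c₀ * C) * A ^ 2 := by
        have e0 : gradSq η z + 4 * c₀ * (dt η z + lap η z) ^ 2 ≤ C + 4 * c₀ * (4 * C ^ 2) :=
          add_le_add hg1 (mul_le_mul_of_nonneg_left hP (by positivity))
        have e1 : (gradSq η z + 4 * c₀ * (dt η z + lap η z) ^ 2) * ‖v z‖ ^ 2 ≤
            (C + 4 * c₀ * (4 * C ^ 2)) * A ^ 2 :=
          mul_le_mul e0 hv1 (sq_nonneg _) (by positivity)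
        have e2 : 16 * c₀ * (gradSq η z * gradSq v z) ≤ 16 * c₀ * (C * A ^ 2) :=
          mul_le_mul_of_nonneg_left (mul_le_mul hg1 hgv1 hgv0 hC0) (by positivity)
        calc _ ≤ (C + 4 * c₀ * (4 * C ^ 2)) * A ^ 2 + 16 * c₀ * (C * A ^ 2) := add_le_add e1 e2
          _ = (C + 16 * c₀ * C ^ 2 + 16 * c₀ * C) * A ^ 2 := by ring
      have hX0 : 0 ≤ (gradSq η z + 4 * c₀ * (dt η z + lap η z) ^ 2) * ‖v z‖ ^ 2 +
          16 * c₀ * (gradSq η z * gradSq v z) := by positivity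
      calc R z = W z * ((gradSq η z + 4 * c₀ * (dt η z + lap η z) ^ 2) * ‖v z‖ ^ 2 +
            16 * c₀ * (gradSq η z * gradSq v z)) := rfl
        _ ≤ ω * ((C + 16 * c₀ * C ^ 2 + 16 * c₀ * C) * A ^ 2) := mul_le_mul hWle hX hX0 hω
        _ = M₂ := by rw [hM₂]; ring
  -- pointwise on `K₁`
  have hRK₁ : ∀ z ∈ K₁, R z ≤ M₁ := by
    intro z hz
    have hzK : z ∈ K := hK₁K hz
    have hzC : z ∈ Cyl := hKCyl hzK
    have hWz := hW0 z hzK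
    have hs0 : 0 < z.1 := hKpos z hzK
    have hs2 : z.1 ≤ 2 * ε := hz.1.2
    have hs1 : z.1 ≤ 1 / 2 := by linarith
    obtain ⟨hg1, hl1, hd1⟩ := hηb z
    have hgη0 : 0 ≤ gradSq η z := gradSq_nonneg _ _
    have hgv0 : 0 ≤ gradSq v z := gradSq_nonneg _ _
    have hgv1 : gradSq v z ≤ A ^ 2 := hgA z hzC
    -- the `|v|²` term, through `W |v|² ≤ Λ s²`
    have hε2 : 0 < ε ^ 2 := by positivity
    have hcoef : gradSq η z + 4 * c₀ * (dt η z + lap η z) ^ 2 ≤ (C + 16 * c₀ * C ^ 2) / ε ^ 2 := by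
      have e1 : gradSq η z ≤ C / ε ^ 2 := hg1.trans (le_div_self hC0 hε2 (pow_le_one₀ hε.le hε1))
      have e2 : |dt η z + lap η z| ≤ 2 * C / ε := by
        have : C ≤ C / ε := le_div_self hC0 hε hε1
        calc |dt η z + lap η z| ≤ |dt η z| + |lap η z| := abs_add_le _ _
          _ ≤ C / ε + C / ε := add_le_add hd1 (hl1.trans this)
          _ = 2 * C / ε := by ring
      have e3 : (dt η z + lap η z) ^ 2 ≤ (2 * C / ε) ^ 2 := by
        rw [← sq_abs]; exact pow_le_pow_left₀ (abs_nonneg _) e2 2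
      calc gradSq η z + 4 * c₀ * (dt η z + lap η z) ^ 2 ≤ C / ε ^ 2 + 4 * c₀ * (2 * C / ε) ^ 2 := by
            gcongr
        _ = (C + 16 * c₀ * C ^ 2) / ε ^ 2 := by field_simp; ring
    have hterm1 : W z * ((gradSq η z + 4 * c₀ * (dt η z + lap η z) ^ 2) * ‖v z‖ ^ 2) ≤
        4 * (C + 16 * c₀ * C ^ 2) * Λ := by
      have e1 : W z * ((gradSq η z + 4 * c₀ * (dt η z + lap η z) ^ 2) * ‖v z‖ ^ 2) =
          (gradSq η z + 4 * c₀ * (dt η z + lap η z) ^ 2) * (W z * ‖v z‖ ^ 2) := by ring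
      rw [e1]
      have e2 := hWΛ z hzC hs1
      have e3 : 0 ≤ W z * ‖v z‖ ^ 2 := by positivity
      calc (gradSq η z + 4 * c₀ * (dt η z + lap η z) ^ 2) * (W z * ‖v z‖ ^ 2)
          ≤ (C + 16 * c₀ * C ^ 2) / ε ^ 2 * (Λ * z.1 ^ 2) := mul_le_mul hcoef e2 e3 (by positivity)
        _ ≤ (C + 16 * c₀ * C ^ 2) / ε ^ 2 * (Λ * (2 * ε) ^ 2) := by
            gcongr
        _ = 4 * (C + 16 * c₀ * C ^ 2) * Λ := by field_simp; ring
    -- the gradient term, through `W ≤ ω` on the annulus and `∇η = 0` inside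
    have hterm2 : W z * (16 * c₀ * (gradSq η z * gradSq v z)) ≤ 16 * c₀ * C * A ^ 2 * ω := by
      by_cases hy : ‖z.2‖ < ρ / 2
      · rw [hηg0 z hy]
        norm_num
        positivity
      · have hWle : W z ≤ ω := hWω z hzC (Or.inr (not_lt.1 hy))
        calc W z * (16 * c₀ * (gradSq η z * gradSq v z)) ≤ ω * (16 * c₀ * (C * A ^ 2)) :=
              mul_le_mul hWle (mul_le_mul_of_nonneg_left (mul_le_mul hg1 hgv1 hgv0 hC0)
                (by positivity)) (by positivity) hω
          _ = 16 * c₀ * C * A ^ 2 * ω := by ring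
    calc R z = W z * ((gradSq η z + 4 * c₀ * (dt η z + lap η z) ^ 2) * ‖v z‖ ^ 2) +
          W z * (16 * c₀ * (gradSq η z * gradSq v z)) := by simp only [hR]; ring
      _ ≤ 4 * (C + 16 * c₀ * C ^ 2) * Λ + 16 * c₀ * C * A ^ 2 * ω := add_le_add hterm1 hterm2
      _ = M₁ := by rw [hM₁]
  -- volumes
  have hvol : (volume : Measure (ℝ × E)) = (volume : Measure ℝ).prod (volume : Measure E) := rfl
  have hVK₂ : (volume K₂).toReal ≤ 7 / 4 * Vρ := by
    rw [hK₂, hvol, Measure.prod_prod, ENNReal.toReal_mul, Real.volume_Ioc,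
      ENNReal.toReal_ofReal (by linarith)]
    exact mul_le_mul_of_nonneg_right (by linarith) hVρ0
  have hVK₁ : (volume K₁).toReal = ε * Vρ := by
    rw [hK₁, hvol, Measure.prod_prod, ENNReal.toReal_mul, Real.volume_Icc,
      ENNReal.toReal_ofReal (by linarith)]
    ring
  have hK₂fin : volume K₂ < ⊤ := (hKc.measure_lt_top.trans_le' (measure_mono hK₂K))
  have hK₁fin : volume K₁ < ⊤ := (hKc.measure_lt_top.trans_le' (measure_mono hK₁K))
  have hRle : ∫ z in K, R z ≤ Vρ * (7 / 4 * M₂ + ε * M₁) := by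
    rw [hKsplit, setIntegral_union hKdisj hK₂m (iR.mono_set hK₁K) (iR.mono_set hK₂K)]
    have e1 : ∫ z in K₁, R z ≤ ∫ _ in K₁, M₁ :=
      setIntegral_mono_on (iR.mono_set hK₁K) (integrableOn_const hK₁fin.ne) hK₁m hRK₁
    have e2 : ∫ z in K₂, R z ≤ ∫ _ in K₂, M₂ :=
      setIntegral_mono_on (iR.mono_set hK₂K) (integrableOn_const hK₂fin.ne) hK₂m hRK₂
    rw [setIntegral_const, measureReal_def, hVK₁, smul_eq_mul] at e1
    rw [setIntegral_const, measureReal_def, smul_eq_mul] at e2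
    have e3 : (volume K₂).toReal * M₂ ≤ 7 / 4 * Vρ * M₂ := mul_le_mul_of_nonneg_right hVK₂ hM₂0
    have e4 : ε * Vρ * M₁ + 7 / 4 * Vρ * M₂ = Vρ * (7 / 4 * M₂ + ε * M₁) := by ring
    linarith
  -- ## conclusion
  have hfin : ∫ z in Q, W z * ‖v z‖ ^ 2 ≤ 2 * (Vρ * (7 / 4 * M₂ + ε * M₁)) := by
    linarith [hQle, hmain, hRle]
  simpa only [hM₂, hM₁, hc₀] using hfin

/-! ### The choice of the parameters and the limit `ε → 0` -/


set_option maxHeartbeats 800000 in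
/-- **Lemma A.1 in rescaled variables** (Seregin 2014, App. A.2, (A.2.5)–(A.2.17)). There are
constants `β ∈ (0, 1/28]`, `δ₀ > 0`, `ρ₀ ≥ 4`, `K > 0`, depending only on `E`, such that: if
`v ∈ C²(O)`, `O ⊇ ]0, 7/4] × B̄(0, ρ)` with `ρ ≥ ρ₀`, satisfies on this cylinder the backward
heat inequality `|∂ₛv + Δv| ≤ δ(|v| + |∇v|)` with `0 ≤ δ ≤ δ₀` ((A.2.5) with (A.2.9)), the
bounds `|v| ≤ A`, `|∇v|² ≤ A²` (the constant `A` of (A.2.10)), and vanishes to infinite order at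
the origin, `|v(y, s)| ≤ C_k (|y| + √s)^k` for all `k` ((A.2.6)), then for every centre `y₀`
with `|y₀| ≤ √(2β) ρ/2` (`= μρ/2`, `μ = √(2β)`, (A.2.16)–(A.2.17)),
`∫_{]1/2,1[ × B(y₀,1)} |v|² ≤ K A² e^{-βρ²/4}`.
Proof: the first Carleman inequality with `a = βρ²/(2 log h(3/2))` ((A.2.13)) applied to
`η_{ρ,ε} v` (`carleman_step_c12`), the weight bounds of `UniqueContinuationRescale.lean` on the
cut-off region (`≤ e^{-βρ²}`, (A.2.11)–(A.2.15)) and on the initial layer (where the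
infinite-order vanishing gives `h^{-2a} e^{-|y|²/4s}|v|² ≤ Λ s²`, so that the layer term is
`O(ε)`), the limit `ε → 0`, the lower bound `h^{-2a} e^{-|y|²/4s} ≥ e^{-1} e^{-μ²ρ²/4}` on the
inner cylinder ((A.2.16)), and `|B̄(0,ρ)| = ρⁿ |B̄(0,1)|`, `ρⁿ e^{-βρ²/4} ≤ n!(4/β)ⁿ`. [cite: Seregin2014, App. A.2 Lemma A.1 (A.2.15)–(A.2.17)] -/
theorem exists_carleman_decay_c12 :
    ∃ β δ₀ ρ₀ K : ℝ, 0 < β ∧ β ≤ 1 / 28 ∧ 0 < δ₀ ∧ 4 ≤ ρ₀ ∧ 0 < K ∧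
    ∀ (v : ℝ × E → F) (O : Set (ℝ × E)) (ρ δ A : ℝ) (y₀ : E),
      IsOpen O → ρ₀ ≤ ρ → 0 ≤ δ → δ ≤ δ₀ → ‖y₀‖ ≤ Real.sqrt (2 * β) * ρ / 2 →
      Ioc (0 : ℝ) (7 / 4) ×ˢ closedBall (0 : E) ρ ⊆ O → ContDiffOn ℝ 1 v O →
      (∀ e : E, ContDiffOn ℝ 1 (dx e v) O) →
      (∀ z ∈ Ioc (0 : ℝ) (7 / 4) ×ˢ closedBall (0 : E) ρ,
        ‖dt v z + lap v z‖ ≤ δ * (‖v z‖ + Real.sqrt (gradSq v z))) →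
      (∀ z ∈ Ioc (0 : ℝ) (7 / 4) ×ˢ closedBall (0 : E) ρ, ‖v z‖ ≤ A) →
      (∀ z ∈ Ioc (0 : ℝ) (7 / 4) ×ˢ closedBall (0 : E) ρ, gradSq v z ≤ A ^ 2) →
      (∀ k : ℕ, ∃ Ck : ℝ, ∀ z ∈ Ioc (0 : ℝ) (7 / 4) ×ˢ closedBall (0 : E) ρ,
        ‖v z‖ ≤ Ck * (‖z.2‖ + Real.sqrt z.1) ^ k) →
      ∫ z in Ioo (1 / 2 : ℝ) 1 ×ˢ ball y₀ 1, ‖v z‖ ^ 2 ≤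
        K * A ^ 2 * Real.exp (-(β / 4 * ρ ^ 2)) := by
  obtain ⟨C, hC1, hcut⟩ := exists_ucCutoff (E := E)
  have hC0 : 0 ≤ C := zero_le_one.trans hC1
  set c₀ : ℝ := 11 * Real.exp (4 / 3) with hc₀
  have hc₀0 : 0 < c₀ := by positivity
  -- ## the parameters
  set L : ℝ := Real.log (hW (3 / 2)) with hL
  have hL0 : 0 < L := log_hW_three_halves_pos
  have hL1 : L < 1 := log_hW_three_halves_lt_one
  set β : ℝ := min (L / 16) (1 / 28) with hβ
  have hβL : β ≤ L / 16 := min_le_left _ _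
  have hβ28 : β ≤ 1 / 28 := min_le_right _ _
  have hβ0 : 0 < β := lt_min (by linarith) (by norm_num)
  set κ : ℝ := β / (2 * L) with hκ
  have hκ0 : 0 < κ := by positivity
  have hκ32 : κ ≤ 1 / 32 := by
    rw [hκ, div_le_iff₀ (by positivity)]; linarith
  have hκL : 2 * κ * L = β := by rw [hκ]; field_simp
  set μ : ℝ := Real.sqrt (2 * β) with hμ
  have hμ0 : 0 ≤ μ := Real.sqrt_nonneg _
  have hμ2 : μ ^ 2 = 2 * β := Real.sq_sqrt (by linarith)
  have hμhalf : μ ≤ 1 / 2 := by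
    rw [hμ, show (1 / 2 : ℝ) = Real.sqrt (1 / 4) by
      rw [show (1 / 4 : ℝ) = (1 / 2) ^ 2 by norm_num, Real.sqrt_sq (by norm_num)]]
    exact Real.sqrt_le_sqrt (by linarith)
  set δ₀ : ℝ := 1 / (4 * Real.sqrt c₀) with hδ₀
  have hsc₀ : 0 < Real.sqrt c₀ := Real.sqrt_pos.2 hc₀0
  have hδ₀0 : 0 < δ₀ := by positivity
  set ρ₀ : ℝ := max 4 (Real.sqrt (2 / κ)) with hρ₀
  set n : ℕ := Module.finrank ℝ E with hn
  set V₁ : ℝ := (volume (closedBall (0 : E) 1)).toReal with hV₁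
  have hV₁0 : 0 ≤ V₁ := ENNReal.toReal_nonneg
  set Kc : ℝ := C + 16 * c₀ * C ^ 2 + 16 * c₀ * C with hKc
  have hKc0 : 0 ≤ Kc := by positivity
  set K : ℝ := Real.exp 1 * (7 / 2) * Kc * V₁ * (n ! / (β / 4) ^ n) + 1 with hK
  have hKpos : 0 < K := by positivity
  refine ⟨β, δ₀, ρ₀, K, hβ0, hβ28, hδ₀0, le_max_left _ _, hKpos, ?_⟩
  intro v O ρ δ A y₀ hO hρ hδ hδδ₀ hy₀ hsub hv hvx hineq hvA hgA hvan
  -- ## derived quantities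
  have hρ4 : 4 ≤ ρ := (le_max_left _ _).trans hρ
  have hρ0 : 0 < ρ := by linarith
  have hρ1 : 1 ≤ ρ := by linarith
  set a : ℝ := κ * ρ ^ 2 with ha
  have ha0 : 0 ≤ a := by positivity
  have ha2 : 2 ≤ a := by
    have h1 : Real.sqrt (2 / κ) ≤ ρ := (le_max_right _ _).trans hρ
    have h2 : 2 / κ ≤ ρ ^ 2 := by
      calc 2 / κ = Real.sqrt (2 / κ) ^ 2 := (Real.sq_sqrt (by positivity)).symm
        _ ≤ ρ ^ 2 := pow_le_pow_left₀ (Real.sqrt_nonneg _) h1 2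
    rw [ha]
    rw [div_le_iff₀ hκ0] at h2
    linarith
  have hδc : 16 * (11 * Real.exp (4 / 3)) * δ ^ 2 ≤ 1 := by
    rw [← hc₀]
    have h1 : δ * (4 * Real.sqrt c₀) ≤ 1 := by
      rw [← le_div_iff₀ (by positivity)]; exact hδδ₀
    have h2 : 0 ≤ δ * (4 * Real.sqrt c₀) := by positivity
    have h3 : (δ * (4 * Real.sqrt c₀)) ^ 2 ≤ 1 := pow_le_one₀ h2 h1
    have h4 : Real.sqrt c₀ ^ 2 = c₀ := Real.sq_sqrt hc₀0.le
    have e : (δ * (4 * Real.sqrt c₀)) ^ 2 = 16 * Real.sqrt c₀ ^ 2 * δ ^ 2 := by ring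
    rw [e, h4] at h3
    exact h3
  have hy₀' : ‖y₀‖ + 1 ≤ ρ / 2 := by
    have : Real.sqrt (2 * β) * ρ / 2 ≤ (1 / 2) * ρ / 2 := by
      rw [← hμ]; gcongr
    linarith
  -- ## the weight bound on the cut-off region: `ω = e^{-βρ²}`
  set ω : ℝ := Real.exp (-(β * ρ ^ 2)) with hω
  have hω0 : 0 ≤ ω := (Real.exp_pos _).le
  set Cyl : Set (ℝ × E) := Ioc (0 : ℝ) (7 / 4) ×ˢ closedBall (0 : E) ρ with hCyl
  have hWω : ∀ z ∈ Cyl, (3 / 2 ≤ z.1 ∨ ρ / 2 ≤ ‖z.2‖) → carlemanWeight a z ≤ ω := by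
    intro z hz h
    have hz0 : 0 < z.1 := hz.1.1
    have hz74 : z.1 ≤ 7 / 4 := hz.1.2
    rcases h with h | h
    · refine (carlemanWeight_le_exp_of_three_halves_le ha0 h (by linarith)).trans (le_of_eq ?_)
      rw [hω, ← hL, ha]
      congr 1
      rw [← hκL]
      ring
    · rcases le_total z.1 1 with h1 | h1
      · have haρ : 2 * a ≤ ρ ^ 2 / 16 := by
          rw [ha]
          calc 2 * (κ * ρ ^ 2) = 2 * κ * ρ ^ 2 := by ring
            _ ≤ 2 * (1 / 32) * ρ ^ 2 := by gcongr
            _ = ρ ^ 2 / 16 := by ring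
        refine (carlemanWeight_le_exp_neg_of_le_one ha0 hρ0.le haρ hz0 h1 h).trans ?_
        rw [hω, Real.exp_le_exp, neg_le_neg_iff, ha]
        have h2κ : 2 * κ = β / L := by rw [hκ]; field_simp
        have hβκ : β ≤ 2 * κ := by
          rw [h2κ, le_div_iff₀ hL0]
          have : β * L ≤ β * 1 := mul_le_mul_of_nonneg_left hL1.le hβ0.le
          linarith
        calc β * ρ ^ 2 ≤ 2 * κ * ρ ^ 2 := mul_le_mul_of_nonneg_right hβκ (sq_nonneg _)
          _ = 2 * (κ * ρ ^ 2) := by ring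
      · refine (carlemanWeight_le_exp_neg_of_one_le ha0 hρ0.le h1 hz74 h).trans ?_
        rw [hω, Real.exp_le_exp, neg_le_neg_iff]
        calc β * ρ ^ 2 ≤ 1 / 28 * ρ ^ 2 := mul_le_mul_of_nonneg_right hβ28 (sq_nonneg _)
          _ = ρ ^ 2 / 28 := by ring
  -- ## the initial layer: `W |v|² ≤ Λ s²` from the infinite-order vanishing (A.2.6)
  set k : ℕ := ⌈2 * a⌉₊ + 2 with hk
  have hk2a : 2 * a + 2 ≤ (k : ℝ) := by
    rw [hk]; push_cast; linarith [Nat.le_ceil (2 * a)]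
  obtain ⟨Ck, hCk⟩ := hvan k
  set Ck' : ℝ := max Ck 0 with hCk'
  have hCk'0 : 0 ≤ Ck' := le_max_right _ _
  set Dk : ℝ := 4 ^ k * (4 ^ k * k ! + 1) with hDk
  have hDk0 : 0 ≤ Dk := by positivity
  set Λ : ℝ := Ck' ^ 2 * Dk with hΛ
  have hΛ0 : 0 ≤ Λ := by positivity
  have hWΛ : ∀ z ∈ Cyl, z.1 ≤ 1 / 2 → carlemanWeight a z * ‖v z‖ ^ 2 ≤ Λ * z.1 ^ 2 := by
    intro z hz hz2
    have hs0 : 0 < z.1 := hz.1.1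
    have hs1 : z.1 ≤ 1 := by linarith
    have hW1 := carlemanWeight_le_rpow_mul_exp (E := E) ha0 hs0 hs1
    have hv1 : ‖v z‖ ≤ Ck' * (‖z.2‖ + Real.sqrt z.1) ^ k :=
      (hCk z hz).trans (mul_le_mul_of_nonneg_right (le_max_left _ _) (by positivity))
    have hv2 : ‖v z‖ ^ 2 ≤ Ck' ^ 2 * (‖z.2‖ + Real.sqrt z.1) ^ (2 * k) := by
      have := pow_le_pow_left₀ (norm_nonneg _) hv1 2
      rw [mul_pow, ← pow_mul, mul_comm k 2] at this
      exact this
    have hG := exp_neg_sq_div_mul_add_sqrt_pow_le k ‖z.2‖ hs0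
    have hpow : z.1 ^ (-(2 * a)) * z.1 ^ k ≤ z.1 ^ 2 := by
      rw [← Real.rpow_natCast z.1 k, ← Real.rpow_add hs0, ← Real.rpow_two]
      exact Real.rpow_le_rpow_of_exponent_ge hs0 hs1 (by linarith)
    have hr0 : 0 ≤ z.1 ^ (-(2 * a)) := Real.rpow_nonneg hs0.le _
    calc carlemanWeight a z * ‖v z‖ ^ 2
        ≤ (z.1 ^ (-(2 * a)) * Real.exp (-‖z.2‖ ^ 2 / (4 * z.1))) *
            (Ck' ^ 2 * (‖z.2‖ + Real.sqrt z.1) ^ (2 * k)) :=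
          mul_le_mul hW1 hv2 (sq_nonneg _) (by positivity)
      _ = Ck' ^ 2 * z.1 ^ (-(2 * a)) *
            (Real.exp (-‖z.2‖ ^ 2 / (4 * z.1)) * (‖z.2‖ + Real.sqrt z.1) ^ (2 * k)) := by ring
      _ ≤ Ck' ^ 2 * z.1 ^ (-(2 * a)) * (Dk * z.1 ^ k) :=
          mul_le_mul_of_nonneg_left hG (by positivity)
      _ = Ck' ^ 2 * Dk * (z.1 ^ (-(2 * a)) * z.1 ^ k) := by ring
      _ ≤ Ck' ^ 2 * Dk * z.1 ^ 2 := mul_le_mul_of_nonneg_left hpow (by positivity)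
      _ = Λ * z.1 ^ 2 := by rw [hΛ]
  -- ## the Carleman step for every `ε ∈ (0, 1/4]`, and `ε → 0`
  set Vρ : ℝ := (volume (closedBall (0 : E) ρ)).toReal with hVρ
  have hVρ0 : 0 ≤ Vρ := ENNReal.toReal_nonneg
  set M₂ : ℝ := Kc * A ^ 2 * ω with hM₂
  set M₁ : ℝ := 4 * (C + 16 * c₀ * C ^ 2) * Λ + 16 * c₀ * C * A ^ 2 * ω with hM₁
  have hM₁0 : 0 ≤ M₁ := by positivity
  have hM₂0 : 0 ≤ M₂ := by positivity
  set Q : Set (ℝ × E) := Ioo (1 / 2 : ℝ) 1 ×ˢ ball y₀ 1 with hQ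
  have key : ∀ ε : ℝ, 0 < ε → ε ≤ 1 / 4 →
      ∫ z in Q, carlemanWeight a z * ‖v z‖ ^ 2 ≤ 2 * (Vρ * (7 / 4 * M₂ + ε * M₁)) := by
    intro ε hε hε4
    exact carleman_step_c12 hO hρ4 hδ hδc ha2 hω0 hΛ0 hC1 hε hε4 hy₀' hcut hsub hv hvx hineq
      hvA hgA hWω hWΛ
  have hlim : ∫ z in Q, carlemanWeight a z * ‖v z‖ ^ 2 ≤ 2 * (Vρ * (7 / 4 * M₂)) := by
    refine le_of_forall_pos_le_add fun θ hθ => ?_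
    have hden : 0 < 2 * Vρ * M₁ + 1 := by positivity
    set ε : ℝ := min (1 / 4) (θ / (2 * Vρ * M₁ + 1)) with hεdef
    have hε0 : 0 < ε := lt_min (by norm_num) (div_pos hθ hden)
    have hε4 : ε ≤ 1 / 4 := min_le_left _ _
    have hεθ : ε ≤ θ / (2 * Vρ * M₁ + 1) := min_le_right _ _
    have h1 := key ε hε0 hε4
    have h2 : 2 * (Vρ * (ε * M₁)) ≤ θ := by
      rw [le_div_iff₀ hden] at hεθ
      have e : ε * (2 * Vρ * M₁ + 1) = 2 * (Vρ * (ε * M₁)) + ε := by ring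
      linarith
    calc ∫ z in Q, carlemanWeight a z * ‖v z‖ ^ 2 ≤ 2 * (Vρ * (7 / 4 * M₂ + ε * M₁)) := h1
      _ = 2 * (Vρ * (7 / 4 * M₂)) + 2 * (Vρ * (ε * M₁)) := by ring
      _ ≤ 2 * (Vρ * (7 / 4 * M₂)) + θ := by linarith
  -- ## the lower bound of the weight on `Q`
  set w₀ : ℝ := Real.exp (-(μ ^ 2 * ρ ^ 2 / 4 + 1)) with hw₀
  have hw₀0 : 0 < w₀ := Real.exp_pos _
  have hWlow : ∀ z ∈ Q, w₀ ≤ carlemanWeight a z := by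
    intro z hz
    have hz1 : 1 / 2 ≤ z.1 := hz.1.1.le
    have hz2 : z.1 ≤ 1 := hz.1.2.le
    refine le_trans ?_ (exp_neg_le_carlemanWeight ha0 hz1 hz2)
    rw [hw₀, Real.exp_le_exp, neg_le_neg_iff]
    have hy : ‖z.2‖ ≤ μ * ρ / 2 + 1 := by
      have h1 : ‖z.2 - y₀‖ < 1 := by rw [← dist_eq_norm]; exact hz.2
      have h2 : ‖z.2‖ ≤ ‖z.2 - y₀‖ + ‖y₀‖ := norm_le_norm_sub_add _ _
      have h3 : ‖y₀‖ ≤ μ * ρ / 2 := by rw [hμ]; linarith [hy₀]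
      linarith
    have hy0 : 0 ≤ ‖z.2‖ := norm_nonneg _
    have hμρ : 0 ≤ μ * ρ / 2 := by positivity
    have h1 : ‖z.2‖ ^ 2 ≤ (μ * ρ / 2 + 1) ^ 2 := pow_le_pow_left₀ hy0 hy 2
    nlinarith only [h1, sq_nonneg (μ * ρ / 2 - 1)]
  -- ## `w₀ ∫_Q |v|² ≤ ∫_Q W |v|²`
  have hy₀'' : ‖y₀‖ + 1 ≤ ρ := by linarith
  have hK'sub := inner_closure_subset_cylinder (E := E) hy₀''
  have cW : ContinuousOn (carlemanWeight a) (Icc (1 / 2 : ℝ) 1 ×ˢ closedBall y₀ 1) :=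
    (continuousOn_carlemanWeight a (by norm_num : (0 : ℝ) < 1 / 2)).mono fun z hz => by
      show 1 / 2 / 2 < z.1
      linarith [hz.1.1]
  have cv : ContinuousOn (fun z => ‖v z‖ ^ 2) (Icc (1 / 2 : ℝ) 1 ×ˢ closedBall y₀ 1) :=
    ((hv.continuousOn.mono (hK'sub.trans hsub)).norm).pow 2
  have iv : IntegrableOn (fun z => ‖v z‖ ^ 2) Q volume := integrableOn_inner_of_continuousOn cv
  have iWv : IntegrableOn (fun z => carlemanWeight a z * ‖v z‖ ^ 2) Q volume :=
    integrableOn_inner_of_continuousOn (cW.mul cv)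
  have hQm : MeasurableSet Q := measurableSet_Ioo.prod measurableSet_ball
  have hlowint : w₀ * ∫ z in Q, ‖v z‖ ^ 2 ≤ ∫ z in Q, carlemanWeight a z * ‖v z‖ ^ 2 := by
    rw [← integral_const_mul]
    exact setIntegral_mono_on (iv.const_mul w₀) iWv hQm fun z hz =>
      mul_le_mul_of_nonneg_right (hWlow z hz) (sq_nonneg _)
  -- ## conclusion
  have hVρeq : Vρ = ρ ^ n * V₁ := by
    rw [hVρ, Measure.addHaar_closedBall' volume (0 : E) hρ0.le, ENNReal.toReal_mul,
      ENNReal.toReal_ofReal (by positivity), hV₁, hn]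
  have hI : ∫ z in Q, ‖v z‖ ^ 2 ≤ 2 * (Vρ * (7 / 4 * M₂)) / w₀ := by
    rw [le_div_iff₀ hw₀0, mul_comm]
    exact hlowint.trans hlim
  have hw₀inv : w₀⁻¹ = Real.exp (μ ^ 2 * ρ ^ 2 / 4 + 1) := by
    rw [hw₀, Real.exp_neg, inv_inv]
  have hexp : Real.exp (μ ^ 2 * ρ ^ 2 / 4 + 1) * ω =
      Real.exp 1 * (Real.exp (-(β / 4 * ρ ^ 2)) * Real.exp (-(β / 4 * ρ ^ 2))) := by
    rw [hω, ← Real.exp_add, ← Real.exp_add, ← Real.exp_add, hμ2]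
    congr 1
    ring
  have hρn : ρ ^ n * Real.exp (-(β / 4 * ρ ^ 2)) ≤ n ! / (β / 4) ^ n :=
    pow_mul_exp_neg_mul_sq_le n (by positivity) hρ1
  have hAe : 0 ≤ A ^ 2 * Real.exp (-(β / 4 * ρ ^ 2)) := by positivity
  calc ∫ z in Q, ‖v z‖ ^ 2 ≤ 2 * (Vρ * (7 / 4 * M₂)) / w₀ := hI
    _ = Real.exp 1 * (7 / 2) * Kc * V₁ * (ρ ^ n * Real.exp (-(β / 4 * ρ ^ 2))) *
          (A ^ 2 * Real.exp (-(β / 4 * ρ ^ 2))) := by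
        rw [div_eq_mul_inv, hw₀inv, hVρeq, hM₂]
        calc 2 * (ρ ^ n * V₁ * (7 / 4 * (Kc * A ^ 2 * ω))) * Real.exp (μ ^ 2 * ρ ^ 2 / 4 + 1)
            = (7 / 2) * Kc * V₁ * A ^ 2 * ρ ^ n * (Real.exp (μ ^ 2 * ρ ^ 2 / 4 + 1) * ω) := by
              ring
          _ = _ := by rw [hexp]; ring
    _ ≤ Real.exp 1 * (7 / 2) * Kc * V₁ * (n ! / (β / 4) ^ n) *
          (A ^ 2 * Real.exp (-(β / 4 * ρ ^ 2))) := by gcongr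
    _ ≤ (Real.exp 1 * (7 / 2) * Kc * V₁ * (n ! / (β / 4) ^ n) + 1) *
          (A ^ 2 * Real.exp (-(β / 4 * ρ ^ 2))) :=
        mul_le_mul_of_nonneg_right (by linarith) hAe
    _ = K * A ^ 2 * Real.exp (-(β / 4 * ρ ^ 2)) := by rw [hK]; ring

end CarlemanC12

/-! ### Lemma A.1 and Theorem A.2.4 in the class -/

set_option maxHeartbeats 800000 in
/-- **Lemma A.1 (Gaussian decay near a zero of infinite order)** (Seregin 2014, App. A.2,
Lemma A.1, (A.2.4), for `C²` solutions and an arbitrary spatial centre `x₁`). For all `n, m`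
and `c₁ ≥ 0` there are `β₁ ∈ (0, 1)`, `β₂ > 0`, `γ ∈ (0, 1/5]` such that: if
`u : ℝ × ℝⁿ → ℝᵐ` is `C²` on `]0, T[ × B(x₁, R)`, satisfies there
`|∂ₜu + Δu| ≤ c₁ (|u| + |∇u|)` and `|u| ≤ M`, and vanishes to infinite order at `(0, x₁)`,
`|u(t, x)| ≤ C_k (|x - x₁| + √t)^k` on the cylinder for every `k`, then there is `K` with
`|u(t, x)| ≤ K e^{-|x - x₁|²/(8t)}` for all `(t, x)` with `0 < t ≤ γT`, `t ≤ γ`,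
`|x - x₁| ≤ β₁R`, `β₂ t ≤ |x - x₁|²`. (Seregin: `0 < t ≤ γT`, `|x| ≤ β₁R`, `β₂t ≤ |x|²`,
`|u| ≤ c₂ A₀ e^{-|x|²/4t}`; the weaker exponent and the solution-dependent constant suffice
for Thm. 2.4.) [cite: Seregin2014, App. A.2 Lemma A.1 (A.2.4)] -/
theorem exists_gaussian_decay_c12 (n m : ℕ) {c₁ : ℝ} (hc₁ : 0 ≤ c₁) :
    ∃ β₁ β₂ γ : ℝ, 0 < β₁ ∧ β₁ < 1 ∧ 0 < β₂ ∧ 0 < γ ∧ γ ≤ 1 / 5 ∧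
    ∀ (u : ℝ × EuclideanSpace ℝ (Fin n) → EuclideanSpace ℝ (Fin m))
      (x₁ : EuclideanSpace ℝ (Fin n)) (R T M : ℝ), 0 < R → 0 < T → 0 ≤ M →
      ContDiffOn ℝ 1 u (Ioo 0 T ×ˢ ball x₁ R) →
      (∀ e, ContDiffOn ℝ 1 (dx e u) (Ioo 0 T ×ˢ ball x₁ R)) →
      (∀ z ∈ Ioo 0 T ×ˢ ball x₁ R,
        ‖dt u z + lap u z‖ ≤ c₁ * (‖u z‖ + Real.sqrt (gradSq u z))) →
      (∀ z ∈ Ioo 0 T ×ˢ ball x₁ R, ‖u z‖ ≤ M) →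
      (∀ k : ℕ, ∃ Ck : ℝ, ∀ z ∈ Ioo 0 T ×ˢ ball x₁ R,
        ‖u z‖ ≤ Ck * (‖z.2 - x₁‖ + Real.sqrt z.1) ^ k) →
      ∃ K : ℝ, ∀ (t : ℝ) (x : EuclideanSpace ℝ (Fin n)), 0 < t → t ≤ γ * T → t ≤ γ →
        ‖x - x₁‖ ≤ β₁ * R → β₂ * t ≤ ‖x - x₁‖ ^ 2 →
        ‖u (t, x)‖ ≤ K * Real.exp (-(‖x - x₁‖ ^ 2 / (8 * t))) := by
  -- ## the constants
  obtain ⟨β, δ₀, ρ₀, K, hβ0, hβ28, hδ₀, hρ₀, hK0, hdecay⟩ :=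
    exists_carleman_decay_c12 (E := EuclideanSpace ℝ (Fin n)) (F := EuclideanSpace ℝ (Fin m))
  obtain ⟨c₉, hc₉, h218⟩ := norm_sq_le_integral_of_backwardHeat_c12
    (E := EuclideanSpace ℝ (Fin n)) (F := EuclideanSpace ℝ (Fin m)) c₁
  obtain ⟨Cg, hCg, hgrad⟩ :=
    exists_sqrt_gradSq_le_of_backwardHeat_c12 (EuclideanSpace ℝ (Fin n)) (EuclideanSpace ℝ (Fin m))
  set μ : ℝ := Real.sqrt (2 * β) with hμ
  have hμ0 : 0 < μ := Real.sqrt_pos.2 (by linarith)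
  have hμ2 : μ ^ 2 = 2 * β := Real.sq_sqrt (by linarith)
  have hμhalf : μ ≤ 1 / 2 := by
    rw [hμ, show (1 / 2 : ℝ) = Real.sqrt (1 / 4) by
      rw [show (1 / 4 : ℝ) = (1 / 2) ^ 2 by norm_num, Real.sqrt_sq (by norm_num)]]
    exact Real.sqrt_le_sqrt (by linarith)
  set β₁ : ℝ := 3 * μ / 8 with hβ₁
  set β₂ : ℝ := β * ρ₀ ^ 2 with hβ₂
  set γ : ℝ := min (1 / 5) (δ₀ ^ 2 / (2 * c₁ ^ 2 + 1)) with hγ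
  have hγ5 : γ ≤ 1 / 5 := min_le_left _ _
  have hγδ : γ ≤ δ₀ ^ 2 / (2 * c₁ ^ 2 + 1) := min_le_right _ _
  have hγ0 : 0 < γ := lt_min (by norm_num) (by positivity)
  refine ⟨β₁, β₂, γ, by positivity, by rw [hβ₁]; linarith, by positivity, hγ0, hγ5, ?_⟩
  intro u x₁ R T M hR hT hM hu hux hineq huM hvan
  -- ## the gradient bound `G` on `]0, 3T/4] × B̄(x₁, 3R/4)` (interior estimate)
  set Oc : Set (ℝ × EuclideanSpace ℝ (Fin n)) := Ioo 0 T ×ˢ ball x₁ R with hOc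
  have hOco : IsOpen Oc := isOpen_Ioo.prod isOpen_ball
  set r : ℝ := min (R / 8) (min (Real.sqrt T / 4) 1) with hr
  have hr0 : 0 < r := lt_min (by positivity) (lt_min (by positivity) one_pos)
  have hrR : r ≤ R / 8 := min_le_left _ _
  have hrT : r ≤ Real.sqrt T / 4 := (min_le_right _ _).trans (min_le_left _ _)
  have hr1 : r ≤ 1 := (min_le_right _ _).trans (min_le_right _ _)
  have hrT2 : r ^ 2 ≤ T / 16 := by
    have h1 : r ^ 2 ≤ (Real.sqrt T / 4) ^ 2 := pow_le_pow_left₀ hr0.le hrT 2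
    rw [div_pow, Real.sq_sqrt hT.le] at h1
    linarith
  set G : ℝ := Cg * (1 + c₁) * M / r with hG
  have hG0 : 0 ≤ G := by positivity
  have hGb : ∀ z ∈ Ioc 0 (3 * T / 4) ×ˢ closedBall x₁ (3 * R / 4), Real.sqrt (gradSq u z) ≤ G := by
    rintro ⟨t₀, x₀⟩ ⟨⟨ht₀0, ht₀1⟩, hx₀⟩
    rw [mem_closedBall, dist_eq_norm] at hx₀
    have hsub : Icc (t₀ - t₀ / 2) (t₀ + r ^ 2) ×ˢ closedBall x₀ r ⊆ Oc := by
      rintro ⟨s, y⟩ ⟨⟨hs0, hs1⟩, hy⟩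
      rw [mem_closedBall, dist_eq_norm] at hy
      refine ⟨⟨by linarith, by linarith⟩, ?_⟩
      rw [mem_ball, dist_eq_norm]
      calc ‖y - x₁‖ ≤ ‖y - x₀‖ + ‖x₀ - x₁‖ := norm_sub_le_norm_sub_add_norm_sub _ _ _
        _ < R := by linarith
    have hsub' : Icc t₀ (t₀ + r ^ 2) ×ˢ closedBall x₀ r ⊆ Oc := fun z hz =>
      hsub ⟨⟨by linarith [hz.1.1], hz.1.2⟩, hz.2⟩
    exact hgrad hOco hr0 hr1 (by linarith) hc₁ hM hsub hu hux (fun z hz => hineq z (hsub' hz))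
      fun z hz => huM z (hsub' hz)
  set A : ℝ := M + G with hA
  have hA0 : 0 ≤ A := by positivity
  have hMA : M ≤ A := by rw [hA]; linarith
  -- ## the claim
  refine ⟨Real.sqrt (c₉ * K) * A, fun t x ht htT htγ hxR hxt => ?_⟩
  set d : EuclideanSpace ℝ (Fin n) := x - x₁ with hd
  have ht5 : t ≤ 1 / 5 := htγ.trans hγ5
  have htT5 : t ≤ T / 5 := htT.trans (by
    calc γ * T ≤ 1 / 5 * T := mul_le_mul_of_nonneg_right hγ5 hT.le
      _ = T / 5 := by ring)
  -- `λ = √(2t)`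
  set lam : ℝ := Real.sqrt (2 * t) with hlam
  have hlam0 : 0 < lam := Real.sqrt_pos.2 (by linarith)
  have hlam2 : lam ^ 2 = 2 * t := Real.sq_sqrt (by linarith)
  have hlam1 : lam ≤ 1 := by
    rw [hlam, show (1 : ℝ) = Real.sqrt 1 from Real.sqrt_one.symm]
    exact Real.sqrt_le_sqrt (by linarith)
  -- `δ = c₁ λ ≤ δ₀`
  have hδ : c₁ * lam ≤ δ₀ := by
    have h1 : (c₁ * lam) ^ 2 ≤ δ₀ ^ 2 := by
      rw [mul_pow, hlam2]
      have h2 : t * (2 * c₁ ^ 2 + 1) ≤ δ₀ ^ 2 := by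
        rw [← le_div_iff₀ (by positivity)]; exact htγ.trans hγδ
      have h3 : 0 ≤ c₁ ^ 2 * t := by positivity
      nlinarith only [h2, h3, ht]
    exact (pow_le_pow_iff_left₀ (by positivity) hδ₀.le two_ne_zero).1 h1
  have hβne : β ≠ 0 := hβ0.ne'
  have htne : t ≠ 0 := ht.ne'
  have hμne : μ ≠ 0 := hμ0.ne'
  have hlamne : lam ≠ 0 := hlam0.ne'
  -- ## the rescaled data: `ξ = d/μ`, `ρ = 2|ξ|/λ`, `y₀ = d/λ`
  set ξ : EuclideanSpace ℝ (Fin n) := μ⁻¹ • d with hξdef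
  have hξ : ‖ξ‖ = ‖d‖ / μ := by
    rw [hξdef, norm_smul, norm_inv, Real.norm_of_nonneg hμ0.le, div_eq_inv_mul]
  set ρ : ℝ := 2 * ‖ξ‖ / lam with hρ
  have hρnn : 0 ≤ ρ := by positivity
  have hlamρ : lam * ρ = 2 * ‖ξ‖ := by rw [hρ]; field_simp
  have hρsq : ρ ^ 2 = ‖d‖ ^ 2 / (β * t) := by
    rw [eq_div_iff (by positivity)]
    have e1 : ρ * lam * μ = 2 * ‖d‖ := by
      rw [mul_comm ρ lam, hlamρ, hξ]
      field_simp
    have e2 : ρ ^ 2 * (β * t) = (ρ * lam * μ) ^ 2 / 4 := by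
      rw [mul_pow, mul_pow, hlam2, hμ2]; ring
    rw [e2, e1]
    ring
  have hρ₀ρ : ρ₀ ≤ ρ := by
    have h1 : ρ₀ ^ 2 ≤ ρ ^ 2 := by
      rw [hρsq, le_div_iff₀ (by positivity)]
      calc ρ₀ ^ 2 * (β * t) = β * ρ₀ ^ 2 * t := by ring
        _ ≤ ‖d‖ ^ 2 := hxt
    exact (pow_le_pow_iff_left₀ (by linarith) hρnn two_ne_zero).1 h1
  have hρ4 : 4 ≤ ρ := hρ₀.trans hρ₀ρ
  set y₀ : EuclideanSpace ℝ (Fin n) := lam⁻¹ • d with hy₀def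
  have hny₀ : ‖y₀‖ = ‖d‖ / lam := by
    rw [hy₀def, norm_smul, norm_inv, Real.norm_of_nonneg hlam0.le, div_eq_inv_mul]
  have hy₀ρ : ‖y₀‖ ≤ Real.sqrt (2 * β) * ρ / 2 := by
    rw [← hμ, hny₀, hρ, hξ]
    apply le_of_eq
    field_simp
  have hy₀1 : ‖y₀‖ + 1 ≤ ρ := by
    have h1 : Real.sqrt (2 * β) * ρ / 2 ≤ (1 / 2) * ρ / 2 := by rw [← hμ]; gcongr
    linarith
  have hξR : 2 * ‖ξ‖ ≤ 3 * R / 4 := by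
    have h1 : ‖d‖ / μ ≤ 3 * R / 8 := by
      rw [div_le_iff₀ hμ0]
      calc ‖d‖ ≤ 3 * μ / 8 * R := hxR
        _ = 3 * R / 8 * μ := by ring
    rw [hξ]; linarith
  -- ## the rescaled function `v = u ∘ A` on `O = A⁻¹(]0,T[ × B(x₁,R))`
  set O : Set (ℝ × EuclideanSpace ℝ (Fin n)) :=
    (fun w : ℝ × EuclideanSpace ℝ (Fin n) => (lam ^ 2 * w.1, x₁ + lam • w.2)) ⁻¹' Oc with hOdef
  have hOo : IsOpen O := hOco.preimage (continuous_parabolicDilation lam x₁)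
  set v : ℝ × EuclideanSpace ℝ (Fin n) → EuclideanSpace ℝ (Fin m) :=
    fun w => u (lam ^ 2 * w.1, x₁ + lam • w.2) with hvdef
  have hvO : ContDiffOn ℝ 1 v O := contDiffOn_comp_parabolicDilation hu
  have hvOx : ∀ e, ContDiffOn ℝ 1 (dx e v) O := fun e =>
    contDiffOn_one_dx_comp_parabolicDilation_c12 hOco hu hux e
  set Cyl : Set (ℝ × EuclideanSpace ℝ (Fin n)) :=
    Ioc (0 : ℝ) (7 / 4) ×ˢ closedBall (0 : EuclideanSpace ℝ (Fin n)) ρ with hCyl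
  have himg : ∀ w ∈ Cyl,
      (lam ^ 2 * w.1, x₁ + lam • w.2) ∈ Ioc 0 (3 * T / 4) ×ˢ closedBall x₁ (3 * R / 4) := by
    intro w hw
    obtain ⟨⟨hw0, hw1⟩, hw2⟩ := hw
    rw [mem_closedBall, dist_zero_right] at hw2
    refine ⟨⟨by rw [hlam2]; positivity, ?_⟩, ?_⟩
    · show lam ^ 2 * w.1 ≤ 3 * T / 4
      rw [hlam2]
      calc 2 * t * w.1 ≤ 2 * t * (7 / 4) := by gcongr
        _ ≤ 2 * (T / 5) * (7 / 4) := by gcongr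
        _ ≤ 3 * T / 4 := by linarith
    · rw [mem_closedBall, dist_eq_norm, add_sub_cancel_left, norm_smul,
        Real.norm_of_nonneg hlam0.le]
      calc lam * ‖w.2‖ ≤ lam * ρ := mul_le_mul_of_nonneg_left hw2 hlam0.le
        _ = 2 * ‖ξ‖ := hlamρ
        _ ≤ 3 * R / 4 := hξR
  have hinner_sub : Ioc 0 (3 * T / 4) ×ˢ closedBall x₁ (3 * R / 4) ⊆ Oc :=
    prod_mono (fun s hs => ⟨hs.1, by linarith [hs.2]⟩) (closedBall_subset_ball (by linarith))
  have hCylO : Cyl ⊆ O := fun w hw => hinner_sub (himg w hw)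
  -- the inequality with the small constant `c₁ λ`
  have hineqv : ∀ w ∈ O, ‖dt v w + lap v w‖ ≤ c₁ * lam * (‖v w‖ + Real.sqrt (gradSq v w)) :=
    fun w hw => norm_dt_add_lap_comp_parabolicDilation_le_c12 hOco hu hux hc₁ hlam0 hlam1 hw (hineq _ hw)
  -- the bounds `|v| ≤ A`, `|∇v|² ≤ A²` on the cylinder
  have hvA : ∀ w ∈ Cyl, ‖v w‖ ≤ A := fun w hw => (huM _ (hinner_sub (himg w hw))).trans hMA
  have hgA : ∀ w ∈ Cyl, gradSq v w ≤ A ^ 2 := by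
    intro w hw
    have hz := himg w hw
    have hzO : (lam ^ 2 * w.1, x₁ + lam • w.2) ∈ Oc := hinner_sub hz
    have hud : DifferentiableAt ℝ u (lam ^ 2 * w.1, x₁ + lam • w.2) :=
      (hu.differentiableOn one_ne_zero).differentiableAt (hOco.mem_nhds hzO)
    have e1 : gradSq v w = lam ^ 2 * gradSq u (lam ^ 2 * w.1, x₁ + lam • w.2) :=
      gradSq_comp_parabolicDilation hud
    rw [e1]
    have h1 : Real.sqrt (gradSq u (lam ^ 2 * w.1, x₁ + lam • w.2)) ≤ G := hGb _ hz
    have h2 : gradSq u (lam ^ 2 * w.1, x₁ + lam • w.2) ≤ G ^ 2 := by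
      have h3 := pow_le_pow_left₀ (Real.sqrt_nonneg _) h1 2
      rwa [Real.sq_sqrt (gradSq_nonneg _ _)] at h3
    have h4 : G ^ 2 ≤ A ^ 2 := pow_le_pow_left₀ hG0 (by rw [hA]; linarith) 2
    have h5 : lam ^ 2 ≤ 1 := pow_le_one₀ hlam0.le hlam1
    calc lam ^ 2 * gradSq u (lam ^ 2 * w.1, x₁ + lam • w.2) ≤ 1 * G ^ 2 :=
          mul_le_mul h5 h2 (gradSq_nonneg _ _) zero_le_one
      _ ≤ A ^ 2 := by rw [one_mul]; exact h4
  -- the infinite-order vanishing of `v` at the origin, (A.2.6)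
  have hvan_v : ∀ k : ℕ, ∃ Ck : ℝ, ∀ w ∈ Cyl, ‖v w‖ ≤ Ck * (‖w.2‖ + Real.sqrt w.1) ^ k := by
    intro k
    obtain ⟨Ck, hCk⟩ := hvan k
    refine ⟨max Ck 0, fun w hw => ?_⟩
    have hz := hinner_sub (himg w hw)
    have hw0 : 0 < w.1 := hw.1.1
    have h1 := hCk _ hz
    dsimp only at h1
    have h2 : ‖x₁ + lam • w.2 - x₁‖ + Real.sqrt (lam ^ 2 * w.1) = lam * (‖w.2‖ + Real.sqrt w.1) := by
      rw [add_sub_cancel_left, norm_smul, Real.norm_of_nonneg hlam0.le,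
        Real.sqrt_mul' _ hw0.le, Real.sqrt_sq hlam0.le]
      ring
    rw [h2] at h1
    calc ‖v w‖ = ‖u (lam ^ 2 * w.1, x₁ + lam • w.2)‖ := rfl
      _ ≤ Ck * (lam * (‖w.2‖ + Real.sqrt w.1)) ^ k := h1
      _ ≤ max Ck 0 * (lam * (‖w.2‖ + Real.sqrt w.1)) ^ k :=
          mul_le_mul_of_nonneg_right (le_max_left _ _) (by positivity)
      _ = max Ck 0 * (lam ^ k * (‖w.2‖ + Real.sqrt w.1) ^ k) := by rw [mul_pow]
      _ ≤ max Ck 0 * (1 * (‖w.2‖ + Real.sqrt w.1) ^ k) := by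
          refine mul_le_mul_of_nonneg_left ?_ (le_max_right _ _)
          exact mul_le_mul_of_nonneg_right (pow_le_one₀ hlam0.le hlam1) (by positivity)
      _ = max Ck 0 * (‖w.2‖ + Real.sqrt w.1) ^ k := by rw [one_mul]
  -- ## the Carleman decay estimate and (A.2.18)
  have hdec := hdecay v O ρ (c₁ * lam) A y₀ hOo hρ₀ρ (by positivity) hδ hy₀ρ hCylO hvO hvOx
    (fun w hw => hineqv w (hCylO hw)) hvA hgA hvan_v
  have hsub218 : Icc (1 / 2 : ℝ) 1 ×ˢ closedBall y₀ 1 ⊆ O :=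
    (inner_closure_subset_cylinder hy₀1).trans hCylO
  have hineq218 : ∀ z ∈ O, ‖dt v z + lap v z‖ ≤ c₁ * (Real.sqrt (gradSq v z) + ‖v z‖) := by
    intro z hz
    refine (hineqv z hz).trans ?_
    rw [add_comm (Real.sqrt _)]
    exact mul_le_mul_of_nonneg_right (mul_le_of_le_one_right hc₁ hlam1) (by positivity)
  have h218v := h218 y₀ v O hOo hsub218 hvO hvOx hineq218
  -- `v(1/2, y₀) = u(t, x)` and `βρ²/4 = |d|²/4t`
  have hvpt : v ((1 / 2 : ℝ), y₀) = u (t, x) := by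
    show u (lam ^ 2 * (1 / 2), x₁ + lam • y₀) = u (t, x)
    refine congrArg u (Prod.ext ?_ ?_)
    · show lam ^ 2 * (1 / 2) = t
      rw [hlam2]; ring
    · show x₁ + lam • y₀ = x
      rw [hy₀def, smul_smul, mul_inv_cancel₀ hlamne, one_smul, hd]
      abel
  have hexp : Real.exp (-(β / 4 * ρ ^ 2)) = Real.exp (-(‖d‖ ^ 2 / (4 * t))) := by
    congr 2
    rw [hρsq]
    field_simp
  have he2 : Real.exp (-(‖d‖ ^ 2 / (8 * t))) ^ 2 = Real.exp (-(‖d‖ ^ 2 / (4 * t))) := by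
    rw [sq, ← Real.exp_add]
    congr 1
    ring
  have hsq : ‖u (t, x)‖ ^ 2 ≤ (Real.sqrt (c₉ * K) * A * Real.exp (-(‖d‖ ^ 2 / (8 * t)))) ^ 2 := by
    have h1 : ‖u (t, x)‖ ^ 2 ≤ c₉ * (K * A ^ 2 * Real.exp (-(‖d‖ ^ 2 / (4 * t)))) := by
      rw [← hvpt, ← hexp]
      exact h218v.trans (mul_le_mul_of_nonneg_left hdec hc₉.le)
    have h2 : (Real.sqrt (c₉ * K) * A * Real.exp (-(‖d‖ ^ 2 / (8 * t)))) ^ 2 =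
        c₉ * (K * A ^ 2 * Real.exp (-(‖d‖ ^ 2 / (4 * t)))) := by
      rw [mul_pow, mul_pow, Real.sq_sqrt (by positivity), he2]
      ring
    rw [h2]
    exact h1
  exact (pow_le_pow_iff_left₀ (norm_nonneg _) (by positivity) two_ne_zero).1 hsq

/-- **Unique continuation across spatial boundaries, uncurried form** (Escauriaza–Seregin–
Šverák 2003, Thm. 4.1 = Seregin 2014, App. A.2, Thm. 2.4, for `C²` functions): let
`U : ℝ × ℝⁿ → ℝᵐ` be `C¹`, with every `∂ₑU ∈ C¹`, on `]0, T[ × B(0, R)`, continuous on `[0, T[ × B(0, R)`, with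
`|∂ₜU + ΔU| ≤ c₁(|U| + |∇U|)` on the open cylinder (`c₁ ≥ 0`) and `|U(z)| ≤ C_k(|z.2| + √z.1)^k`
there for every `k`. Then `U(0, x) = 0` for all `x ∈ B(0, R)`. Proof: Lemma A.1
(`exists_gaussian_decay_c12`) at the centres of an increasing family of balls (Seregin: "Theorem 2.4
is an easy consequence of" Lemma A.1), see the module docstring. [cite: Seregin2014, App. A.2 Thm. 2.4] -/
theorem uniqueContinuation_uncurried_c12 (n m : ℕ) {c₁ R T : ℝ} (hc₁ : 0 ≤ c₁) (hR : 0 < R)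
    (hT : 0 < T) {U : ℝ × EuclideanSpace ℝ (Fin n) → EuclideanSpace ℝ (Fin m)}
    (hU : ContDiffOn ℝ 1 U (Ioo 0 T ×ˢ ball 0 R))
    (hUx : ∀ e, ContDiffOn ℝ 1 (dx e U) (Ioo 0 T ×ˢ ball 0 R))
    (hUc : ContinuousOn U (Ico 0 T ×ˢ ball 0 R))
    (hineq : ∀ z ∈ Ioo 0 T ×ˢ ball (0 : EuclideanSpace ℝ (Fin n)) R,
      ‖dt U z + lap U z‖ ≤ c₁ * (‖U z‖ + Real.sqrt (gradSq U z)))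
    (hvan : ∀ k : ℕ, ∃ C : ℝ, ∀ z ∈ Ioo 0 T ×ˢ ball (0 : EuclideanSpace ℝ (Fin n)) R,
      ‖U z‖ ≤ C * (‖z.2‖ + Real.sqrt z.1) ^ k) :
    ∀ x ∈ ball (0 : EuclideanSpace ℝ (Fin n)) R, U (0, x) = 0 := by
  intro x hx
  obtain ⟨β₁, β₂, γ, hβ₁0, hβ₁1, hβ₂0, hγ0, -, hG⟩ := exists_gaussian_decay_c12 n m hc₁
  -- ## the global bound `M` (the case `k = 0`)
  obtain ⟨C₀, hC₀⟩ := hvan 0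
  set M : ℝ := max C₀ 0 with hMdef
  have hM0 : 0 ≤ M := le_max_right _ _
  have hM : ∀ z ∈ Ioo 0 T ×ˢ ball (0 : EuclideanSpace ℝ (Fin n)) R, ‖U z‖ ≤ M := by
    intro z hz
    have h := hC₀ z hz
    rw [pow_zero, mul_one] at h
    exact h.trans (le_max_left _ _)
  -- ## the local vanishing predicate and its propagation
  set LV : EuclideanSpace ℝ (Fin n) → Prop := fun x₁ => ∀ k : ℕ, ∃ C r : ℝ, 0 < r ∧
    ∀ z ∈ Ioo 0 T ×ˢ ball (0 : EuclideanSpace ℝ (Fin n)) R, ‖z.2 - x₁‖ < r → z.1 < r →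
      ‖U z‖ ≤ C * (‖z.2 - x₁‖ + Real.sqrt z.1) ^ k with hLV
  have hLV0 : LV 0 := by
    intro k
    obtain ⟨C, hC⟩ := hvan k
    refine ⟨C, 1, one_pos, fun z hz _ _ => ?_⟩
    simpa only [sub_zero] using hC z hz
  have hprop : ∀ x₁ ∈ ball (0 : EuclideanSpace ℝ (Fin n)) R, LV x₁ →
      ∀ x₂ : EuclideanSpace ℝ (Fin n), ‖x₂ - x₁‖ ≤ β₁ / 2 * (R - ‖x₁‖) → LV x₂ := by
    intro x₁ hx₁ hL x₂ hx₂
    rw [mem_ball, dist_zero_right] at hx₁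
    set R₁ : ℝ := R - ‖x₁‖ with hR₁
    have hR₁0 : 0 < R₁ := by rw [hR₁]; linarith
    have hsub : Ioo 0 T ×ˢ ball x₁ R₁ ⊆ Ioo 0 T ×ˢ ball (0 : EuclideanSpace ℝ (Fin n)) R := by
      refine prod_mono subset_rfl fun y hy => ?_
      rw [mem_ball, dist_eq_norm] at hy
      rw [mem_ball, dist_zero_right]
      calc ‖y‖ = ‖(y - x₁) + x₁‖ := by rw [sub_add_cancel]
        _ ≤ ‖y - x₁‖ + ‖x₁‖ := norm_add_le _ _
        _ < R := by rw [hR₁] at hy; linarith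
    -- (A.2.3) on the whole cylinder centred at `x₁`
    have hvan₁ : ∀ k : ℕ, ∃ C : ℝ, ∀ z ∈ Ioo 0 T ×ˢ ball x₁ R₁,
        ‖U z‖ ≤ C * (‖z.2 - x₁‖ + Real.sqrt z.1) ^ k :=
      vanishing_order_of_local (fun z hz => hM z (hsub hz)) fun k => by
        obtain ⟨C, r, hr, h⟩ := hL k
        exact ⟨C, r, hr, fun z hz => h z (hsub hz)⟩
    -- Lemma A.1 at `x₁`
    obtain ⟨Kf, hKf⟩ := hG U x₁ R₁ T M hR₁0 hT hM0 (hU.mono hsub) (fun e => (hUx e).mono hsub)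
      (fun z hz => hineq z (hsub hz)) (fun z hz => hM z (hsub hz)) hvan₁
    by_cases hx₂₁ : x₂ = x₁
    · rw [hx₂₁]; exact hL
    · refine local_vanishing_of_gaussian (S := Ioo 0 T ×ˢ ball (0 : EuclideanSpace ℝ (Fin n)) R)
        (Kf := Kf) (tmax := min (γ * T) γ) (L := β₁ * R₁) (lt_min (by positivity) hγ0) hβ₂0 hx₂₁
        (by linarith [mul_pos hβ₁0 hR₁0]) ?_ (fun z hz => hz.1.1)
      intro z hz ht hxz hβz
      have h := hKf z.1 z.2 hz.1.1 (ht.trans (min_le_left _ _)) (ht.trans (min_le_right _ _))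
        hxz hβz
      simpa only [Prod.mk.eta] using h
  -- ## the induction over the radii `R(1 - (1 - θ)^N)`, `θ = β₁/2`
  set θ : ℝ := β₁ / 2 with hθ
  have hθ0 : 0 < θ := by positivity
  have hθ1 : θ < 1 := by rw [hθ]; linarith
  have hiter : ∀ N : ℕ, ∀ y : EuclideanSpace ℝ (Fin n),
      ‖y‖ ≤ R * (1 - (1 - θ) ^ N) → ‖y‖ < R → LV y := by
    intro N
    induction N with
    | zero =>
      intro y hy _
      have h0 : y = 0 := by
        have h : ‖y‖ ≤ 0 := by simpa using hy
        exact norm_le_zero_iff.1 h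
      rw [h0]
      exact hLV0
    | succ N ih =>
      intro y hy hyR
      set rN : ℝ := R * (1 - (1 - θ) ^ N) with hrN
      by_cases hle : ‖y‖ ≤ rN
      · exact ih y hle hyR
      · rw [not_le] at hle
        have hq0 : 0 < (1 - θ) ^ N := pow_pos (by linarith) N
        have hq1 : (1 - θ) ^ N ≤ 1 := pow_le_one₀ (by linarith) (by linarith)
        have hrN0 : 0 ≤ rN := by rw [hrN]; exact mul_nonneg hR.le (by linarith)
        have hrNR : rN < R := by
          rw [hrN]
          have : R * (1 - (1 - θ) ^ N) = R - R * (1 - θ) ^ N := by ring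
          rw [this]
          linarith [mul_pos hR hq0]
        have hy0 : 0 < ‖y‖ := lt_of_le_of_lt hrN0 hle
        set y₁ : EuclideanSpace ℝ (Fin n) := (rN / ‖y‖) • y with hy₁
        have hny₁ : ‖y₁‖ = rN := by
          rw [hy₁, norm_smul, Real.norm_of_nonneg (div_nonneg hrN0 hy0.le),
            div_mul_cancel₀ _ hy0.ne']
        have hLV₁ : LV y₁ := ih y₁ (by rw [hny₁]) (by rw [hny₁]; exact hrNR)
        have hdist : ‖y - y₁‖ = ‖y‖ - rN := by
          have e : y - y₁ = (1 - rN / ‖y‖) • y := by rw [hy₁, sub_smul, one_smul]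
          have hc : 0 ≤ 1 - rN / ‖y‖ := by
            rw [sub_nonneg, div_le_one hy0]; exact hle.le
          rw [e, norm_smul, Real.norm_of_nonneg hc, sub_mul, one_mul, div_mul_cancel₀ _ hy0.ne']
        refine hprop y₁ (by rw [mem_ball, dist_zero_right, hny₁]; exact hrNR) hLV₁ y ?_
        rw [hdist, hny₁]
        have e : R * (1 - (1 - θ) ^ (N + 1)) - rN = θ * (R - rN) := by rw [hrN]; ring
        linarith
  -- ## every point of `B(0, R)` is a zero of infinite order
  rw [mem_ball, dist_zero_right] at hx
  obtain ⟨N, hN⟩ : ∃ N : ℕ, (1 - θ) ^ N < 1 - ‖x‖ / R :=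
    exists_pow_lt_of_lt_one (by rw [sub_pos, div_lt_one hR]; exact hx) (by linarith)
  have hxN : ‖x‖ ≤ R * (1 - (1 - θ) ^ N) := by
    have h1 : ‖x‖ / R < 1 - (1 - θ) ^ N := by linarith
    rw [div_lt_iff₀ hR] at h1
    linarith
  have hLVx : LV x := hiter N x hxN hx
  -- ## conclusion by continuity up to `t = 0`
  obtain ⟨C, r, hr, hC⟩ := hLVx 1
  have hxmem : ((0 : ℝ), x) ∈ Ico 0 T ×ˢ ball (0 : EuclideanSpace ℝ (Fin n)) R :=
    ⟨⟨le_rfl, hT⟩, by rwa [mem_ball, dist_zero_right]⟩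
  have hcw : ContinuousWithinAt U (Ico 0 T ×ˢ ball (0 : EuclideanSpace ℝ (Fin n)) R) (0, x) :=
    hUc _ hxmem
  have hpath : Tendsto (fun s : ℝ => ((s, x) : ℝ × EuclideanSpace ℝ (Fin n))) (𝓝[Ioo 0 T] 0)
      (𝓝[Ico 0 T ×ˢ ball (0 : EuclideanSpace ℝ (Fin n)) R] (0, x)) := by
    apply tendsto_nhdsWithin_of_tendsto_nhds_of_eventually_within
    · exact ((continuous_id.prodMk continuous_const).tendsto 0).mono_left nhdsWithin_le_nhds
    · filter_upwards [self_mem_nhdsWithin] with s hs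
      exact ⟨Ioo_subset_Ico_self hs, by rwa [mem_ball, dist_zero_right]⟩
  have hlim : Tendsto (fun s : ℝ => ‖U (s, x)‖) (𝓝[Ioo 0 T] 0) (𝓝 ‖U (0, x)‖) :=
    (hcw.tendsto.comp hpath).norm
  have hbound : ∀ᶠ s in 𝓝[Ioo 0 T] 0, ‖U (s, x)‖ ≤ C * Real.sqrt s := by
    have hmem : Ioo 0 (min r T) ∈ 𝓝[Ioo 0 T] (0 : ℝ) := by
      rw [nhdsWithin_Ioo_eq_nhdsGT hT]
      exact Ioo_mem_nhdsGT (lt_min hr hT)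
    filter_upwards [hmem] with s hs
    have hz : ((s, x) : ℝ × EuclideanSpace ℝ (Fin n)) ∈
        Ioo 0 T ×ˢ ball (0 : EuclideanSpace ℝ (Fin n)) R :=
      ⟨⟨hs.1, hs.2.trans_le (min_le_right _ _)⟩, by rwa [mem_ball, dist_zero_right]⟩
    have h := hC (s, x) hz (by simp [hr]) (hs.2.trans_le (min_le_left _ _))
    simpa using h
  have hsqrt : Tendsto (fun s : ℝ => C * Real.sqrt s) (𝓝[Ioo 0 T] 0) (𝓝 0) := by
    have h := ((Real.continuous_sqrt.tendsto 0).const_mul C).mono_left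
      (nhdsWithin_le_nhds (s := Ioo (0 : ℝ) T) (a := (0 : ℝ)))
    simpa using h
  haveI : (𝓝[Ioo 0 T] (0 : ℝ)).NeBot := by
    rw [nhdsWithin_Ioo_eq_nhdsGT hT]; infer_instance
  have hle : ‖U (0, x)‖ ≤ 0 := le_of_tendsto_of_tendsto hlim hsqrt hbound
  exact norm_le_zero_iff.1 hle

end Carleman

end

end Literature.Analysis.FluidPDE
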